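import Literature.ModelTheory.FiniteModelTheory.CFIUncoloured
import Literature.ModelTheory.FiniteModelTheory.CFIUncolouredStructure
import Literature.Combinatorics.SimpleGraph.DegreeTwoWalks
import Mathlib.Combinatorics.SimpleGraph.Connectivity.Finite
import Mathlib.Algebra.BigOperators.Ring.Finset
import Mathlib.Data.ZMod.Basic
import Mathlib.Tactic.Ring
import Literature.Computability.Complexity.TwoColouringScan
import Literature.Computability.Complexity.CodeFPClosure
import Literature.ModelTheory.FiniteModelTheory.CPTCardProgramProofs
import Literature.Computability.Complexity.TwoColouringScanFP
import HarnessLib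

/-!
# Discharge of `ChenFlumLiu2025_ptime_separation` (Chen–Flum–Liu 2025, Thm. 8.1): the parity separator

Topic `Literature/ModelTheory/FiniteModelTheory`; sibling of `CFIUncoloured.lean`, whose named fact
`ChenFlumLiu2025_ptime_separation` — "There is a polynomial time algorithm accepting (all graphs
isomorphic to) `Y(G)` for all `G` and rejecting the corresponding `Ỹ(G)`" (Chen–Flum–Liu 2025,
Thm. 8.1), rendered as the existence of an `IsPTIMEClass` class of finite graphs containing every
graph isomorphic to `cfiEven G` and no graph isomorphic to `cfiGraph G {e}`, for all connected `G`
on `Fin v`, `v ≥ 2`, and edges `e` — is PROVED here: **`theorem ChenFlumLiu2025_ptime_separation_holds`**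
(Part IV, at the end of the file). (The other named fact of `CFIUncoloured.lean`, Cor. 12.3 of the source,
is discharged in the sibling `CFIUncolouredProofs.lean`.)

The class is `CFISep.cfiSeparatingClass`, the finite graphs accepted by the PARITY SEPARATOR
`Verdict` (Part I: a graph invariant, defined on every finite simple graph and invariant under
isomorphisms, `verdict_repMin_iff_of_iso`) with least representatives. Part II (correctness) proves
that the separator ACCEPTS `CFI(G, ∅) = Y(G)` and REJECTS `CFI(G, {e}) = Y^e(G) ≅ Ỹ(G)` for every
connected base graph `G` on at least two vertices, every edge `e` and every admissible choice of
representatives (`verdict_cfiGraph_of_forall_notMem`, `not_verdict_cfiGraph_of_singleton`). Part III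
(polynomial time) writes the separator as a first-order functional program `CFISep.verdictL` on
adjacency codes (`CFISep.verdictL_eq_decide`) and assembles it in the tree's typed `FP` algebra
`CodeFP`, whence `CFISep.isPTIMEClass_cfiSeparatingClass`. Part IV combines them.

The algorithm follows the proof of Thm. 8.1 of the source in its first step (the gadgets over base
vertices of degree `≥ 3` are recovered through short cycles, the classes of `∼`) and replaces the
propagation / ordering / counting of the printed proof by a parity count along the chains of
degree-`≤ 2` base vertices (Part II, §B–§D), which needs no names `a`/`b` for the recovered
vertices; the base graphs without vertices of degree `≥ 3` (paths and cycles, Lemma 6.8 of the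
source) are told apart by dead-end walks and connectivity (Part II, §E).

## References

* [ChenFlumLiu2025] Y. Chen, J. Flum, M. Liu, *Some remarks on the uncolored versions of the
  original CFI-graphs*, arXiv:2507.01459 (2025), Thm. 8.1 (with its proof, §8), Lemma 6.8,
  Lemma 7.13, Cor. 7.11, §1 (Fig. 1.1).
* [CaiFurerImmerman1992] J.-Y. Cai, M. Fürer, N. Immerman, *An optimal lower bound on the number
  of variables for graph identification*, Combinatorica 12 (1992), 389–410, §6.
* [AroraBarak2009] S. Arora, B. Barak, *Computational Complexity: A Modern Approach*, Cambridge
  University Press 2009, §1.3 (closure of polynomial time under composition and polynomially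
  bounded loops).
-/

/-!
## Part I. The parity separator of the uncoloured CFI graphs: definition and isomorphism invariance

Topic `Literature/ModelTheory/FiniteModelTheory`; the graph invariant behind the discharge of
`ChenFlumLiu2025_ptime_separation` (`CFIUncoloured.lean`; Chen–Flum–Liu 2025, Thm. 8.1: "there is
a polynomial time algorithm accepting `Y(G)` for all `G` and rejecting the corresponding `Ỹ(G)`").
This part DEFINES the accepting condition `Verdict` of such an algorithm on an arbitrary finite
simple graph `Z` and proves that it is invariant under graph isomorphisms (so that it defines an
isomorphism-closed class of finite graphs); Part II
evaluates it on the CFI graphs and Part III implements it in polynomial time.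

The algorithm (cf. the proof of Thm. 8.1 in the source, which we follow in its first step and
simplify afterwards — documented in Part II):
* `IsCore x`: `deg x ≥ 3` (the vertices of the gadgets over base vertices of degree `≥ 3`);
  `rigidGraph Z`: the edges lying on a six-cycle (the gadget edges of these gadgets);
  `SameCore`: reachability in `rigidGraph` (same gadget); `IsMid x`: a core vertex all of whose
  neighbours are in its core (the middle vertices); a REPRESENTATIVE map `ρ : V → V` is a
  parameter (intended: a middle vertex of the core of `x`; the program takes the least one);
* from a core link `x` (core, not middle) the non-backtracking walk (`DegreeTwoWalks.lean`) is
  started through its unique neighbour outside its core (`firstMove`, `linkStart`); it ends at a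
  core vertex (`CorrBad`: "bad" iff exactly one of `x`, the end is adjacent to its representative)
  or at a dead end (`PendBad`: bad iff `x ~ ρ x` and the length is `≡ 0 (mod 3)`, or `x ≁ ρ x` and
  the length is `≡ 1 (mod 3)`);
* `Verdict ρ`: if core vertices exist, "`nCorr / 4 + nPend / 2` is even" (`nCorr`, `nPend` the
  numbers of bad core links of the two kinds); otherwise (base graph a path or a cycle) "some
  vertex of degree one starts a walk of length `≢ 1 (mod 3)`, or the graph is two-regular and
  disconnected".

* Isomorphism invariance: `Verdict` (with representatives transported along the isomorphism),
  `verdict_iff_of_iso`; the least-representative map `repMin` is transported to an admissible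
  representative map (`IsRepMap.transport`, `verdict_repMin_iff_of_iso`).
-/

noncomputable section

namespace Literature.ModelTheory.FiniteModelTheory

open Finset Literature.Combinatorics.SimpleGraph

/-! ### The invariant -/

section Defs

variable {V : Type*} [Fintype V] [DecidableEq V] (Z : SimpleGraph V) [DecidableRel Z.Adj]

/-- A CORE vertex: degree at least three. [cite: ChenFlumLiu2025, §8 (proof of Thm. 8.1: "`deg(x) ≥ 3`")] -/
def IsCore (x : V) : Prop := 3 ≤ Z.degree x

/-- `IsCore` is decidable. [folklore] -/
instance (x : V) : Decidable (IsCore Z x) := Nat.decLe _ _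

/-- The RIGID subgraph: the edges of `Z` lying on a six-cycle. [cite: ChenFlumLiu2025, §8 (proof
of Thm. 8.1: "`x` and `y` are on a cycle of length at most eight")] -/
def rigidGraph : SimpleGraph V where
  Adj x y := Z.Adj x y ∧ SixCycleThrough Z x y
  symm := ⟨fun _ _ h => ⟨h.1.symm, h.2.symm⟩⟩
  loopless := ⟨fun _ h => h.1.ne rfl⟩

/-- Rigid adjacency is decidable. [folklore] -/
instance : DecidableRel (rigidGraph Z).Adj := fun x y =>
  inferInstanceAs (Decidable (Z.Adj x y ∧ SixCycleThrough Z x y))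

/-- SAME CORE: joined by a path of rigid edges (the equivalence relation `∼` of the source).
[cite: ChenFlumLiu2025, §8 (proof of Thm. 8.1, the relation `∼`)] -/
def SameCore (x y : V) : Prop := (rigidGraph Z).Reachable x y

/-- `SameCore` is decidable. [folklore] -/
instance (x y : V) : Decidable (SameCore Z x y) :=
  inferInstanceAs (Decidable ((rigidGraph Z).Reachable x y))

/-- A MIDDLE vertex: a core vertex all of whose neighbours lie in its core (the link vertices are
the ones with a neighbour outside, Lemma 7.13 of the source). [cite: ChenFlumLiu2025, Lemma 7.13 and §8] -/
def IsMid (x : V) : Prop := IsCore Z x ∧ ∀ y, Z.Adj x y → SameCore Z x y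

/-- `IsMid` is decidable. [folklore] -/
instance (x : V) : Decidable (IsMid Z x) :=
  inferInstanceAs (Decidable (IsCore Z x ∧ ∀ y, Z.Adj x y → SameCore Z x y))

/-- The neighbours of `x` outside its core. [folklore] -/
def outNbrs (x : V) : Finset V := (Z.neighborFinset x).filter fun y => ¬ SameCore Z x y

/-- The FIRST MOVE from a core link: its unique neighbour outside its core (itself if there is no
unique such neighbour). [cite: ChenFlumLiu2025, §8 (proof of Thm. 8.1: "a vertex … that has a
neighbor in some of the already known `L(u, v)`")] -/
noncomputable def firstMove (x : V) : V :=
  if h : (outNbrs Z x).card = 1 then (Finset.card_eq_one.mp h).choose else x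

/-- The starting state of the walk from a core link. [folklore] -/
noncomputable def linkStart (x : V) : V × V := (x, firstMove Z x)

/-- A core link of CORRIDOR type (its walk ends at a core vertex) that is BAD for the
representatives `ρ`: exactly one of the link and the end of its walk is adjacent to its
representative. [cite: ChenFlumLiu2025, §8 (proof of Thm. 8.1, counting the twisted edges)] -/
def CorrBad (ρ : V → V) (x : V) : Prop :=
  IsCore Z (trailEnd Z (linkStart Z x)) ∧
    (Z.Adj x (ρ x) ↔ ¬ Z.Adj (trailEnd Z (linkStart Z x)) (ρ (trailEnd Z (linkStart Z x))))

/-- A core link of PENDANT type (its walk ends at a dead end) that is BAD for `ρ`: adjacent to its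
representative with a walk of length `≡ 0 (mod 3)`, or not adjacent with a walk of length
`≡ 1 (mod 3)` (the two dead ends of a leaf gadget, `a(u,v)` and `m(u, ∅)`, are told apart by the
residue of the length). [cite: ChenFlumLiu2025, §8 (proof of Thm. 8.1, the case `deg(v) = 1`)] -/
def PendBad (ρ : V → V) (x : V) : Prop :=
  ¬ IsCore Z (trailEnd Z (linkStart Z x)) ∧
    ((Z.Adj x (ρ x) ∧ trailLen Z (linkStart Z x) % 3 = 0) ∨
      (¬ Z.Adj x (ρ x) ∧ trailLen Z (linkStart Z x) % 3 = 1))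

/-- `CorrBad` is decidable. [folklore] -/
instance (ρ : V → V) (x : V) : Decidable (CorrBad Z ρ x) := by unfold CorrBad; infer_instance

/-- `PendBad` is decidable. [folklore] -/
instance (ρ : V → V) (x : V) : Decidable (PendBad Z ρ x) := by unfold PendBad; infer_instance

/-- The CORE LINKS: core vertices that are not middle vertices. [cite: ChenFlumLiu2025, Lemma 7.13] -/
def coreLinks : Finset V := univ.filter fun x => IsCore Z x ∧ ¬ IsMid Z x

/-- The number of bad core links of corridor type. [folklore] -/
def nCorr (ρ : V → V) : ℕ := ((coreLinks Z).filter (CorrBad Z ρ)).card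

/-- The number of bad core links of pendant type. [folklore] -/
def nPend (ρ : V → V) : ℕ := ((coreLinks Z).filter (PendBad Z ρ)).card

/-- The unique neighbour of a vertex of degree one (itself otherwise). [folklore] -/
noncomputable def firstNbr (x : V) : V :=
  if h : (Z.neighborFinset x).card = 1 then (Finset.card_eq_one.mp h).choose else x

/-- **The verdict** of the separating algorithm for the representatives `ρ`. With core vertices:
`nCorr / 4 + nPend / 2` is even. Without (the base graph is a path or a cycle, Lemma 6.8 of the
source): some vertex of degree one starts a walk of length `≢ 1 (mod 3)`, or the graph is
two-regular and disconnected. [cite: ChenFlumLiu2025, Thm. 8.1 (proof, §8) and Lemma 6.8] -/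
def Verdict (ρ : V → V) : Prop :=
  ((∃ x, IsCore Z x) ∧ Even (nCorr Z ρ / 4 + nPend Z ρ / 2)) ∨
    ((¬ ∃ x, IsCore Z x) ∧
      ((∃ x, Z.degree x = 1 ∧ trailLen Z (x, firstNbr Z x) % 3 ≠ 1) ∨
        ((∀ x, Z.degree x = 2) ∧ ∃ u w, ¬ Z.Reachable u w)))

/-- The middle vertices of the core of `x`. [folklore] -/
def midsOf (x : V) : Finset V := univ.filter fun y => SameCore Z x y ∧ IsMid Z y

/-- **The least representative**: the least middle vertex of the core of `x` (for a linear order on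
the vertices; `x` itself if there is none). [cite: ChenFlumLiu2025, §8 (proof of Thm. 8.1: "we fix
an arbitrary ordering `<` of `V(Z)`")] -/
def repMin [LinearOrder V] (x : V) : V :=
  if h : (midsOf Z x).Nonempty then (midsOf Z x).min' h else x

/-- An ADMISSIBLE representative map: on every core that has a middle vertex it is constant and
picks a middle vertex of that core. [folklore] -/
structure IsRepMap (ρ : V → V) : Prop where
  /-- Vertices of the same core (with a middle vertex) get the same representative. -/
  eq_of_sameCore : ∀ x y, SameCore Z x y → (midsOf Z x).Nonempty → ρ x = ρ y
  /-- The representative is a middle vertex of the core if there is one. -/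
  mem_midsOf : ∀ x, (midsOf Z x).Nonempty → ρ x ∈ midsOf Z x

end Defs

/-! ### Elementary properties -/

section Basic

variable {V : Type*} [Fintype V] [DecidableEq V] {Z : SimpleGraph V} [DecidableRel Z.Adj]

omit [Fintype V] [DecidableEq V] [DecidableRel Z.Adj] in
/-- `SameCore` is reflexive. [folklore] -/
theorem sameCore_refl (x : V) : SameCore Z x x := SimpleGraph.Reachable.refl x

omit [Fintype V] [DecidableEq V] [DecidableRel Z.Adj] in
/-- `SameCore` is symmetric. [folklore] -/
theorem SameCore.symm {x y : V} (h : SameCore Z x y) : SameCore Z y x := SimpleGraph.Reachable.symm h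

omit [Fintype V] [DecidableEq V] [DecidableRel Z.Adj] in
/-- `SameCore` is transitive. [folklore] -/
theorem SameCore.trans {x y z : V} (h : SameCore Z x y) (h' : SameCore Z y z) : SameCore Z x z :=
  SimpleGraph.Reachable.trans h h'

omit [Fintype V] [DecidableEq V] [DecidableRel Z.Adj] in
/-- A rigid edge joins vertices of the same core. [folklore] -/
theorem sameCore_of_rigid {x y : V} (h : Z.Adj x y) (h6 : SixCycleThrough Z x y) : SameCore Z x y :=
  SimpleGraph.Adj.reachable (G := rigidGraph Z) ⟨h, h6⟩

/-- `midsOf` depends only on the core. [folklore] -/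
theorem midsOf_eq_of_sameCore {x y : V} (h : SameCore Z x y) : midsOf Z x = midsOf Z y := by
  ext z
  simp only [midsOf, mem_filter, mem_univ, true_and]
  exact ⟨fun hz => ⟨h.symm.trans hz.1, hz.2⟩, fun hz => ⟨h.trans hz.1, hz.2⟩⟩

/-- Membership in `midsOf`. [folklore] -/
theorem mem_midsOf {x y : V} : y ∈ midsOf Z x ↔ SameCore Z x y ∧ IsMid Z y := by
  simp only [midsOf, mem_filter, mem_univ, true_and]

omit [Fintype V] [DecidableEq V] in
/-- `min'` does not depend on the nonemptiness proof. [folklore] -/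
theorem min'_congr [LinearOrder V] {s t : Finset V} (hs : s.Nonempty) (ht : t.Nonempty) (h : s = t) :
    s.min' hs = t.min' ht := by
  subst h
  rfl

/-- **The least representative map is admissible.** [folklore] -/
theorem isRepMap_repMin [LinearOrder V] : IsRepMap Z (repMin Z) where
  eq_of_sameCore x y h hne := by
    have hm := midsOf_eq_of_sameCore h
    have hne' : (midsOf Z y).Nonempty := hm ▸ hne
    unfold repMin
    rw [dif_pos hne, dif_pos hne']
    exact min'_congr hne hne' hm
  mem_midsOf x h := by
    unfold repMin
    rw [dif_pos h]
    exact min'_mem _ _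

/-- The first move from a vertex whose outside neighbours are exactly `{q}` is `q`. [folklore] -/
theorem firstMove_eq_of_outNbrs_eq {x q : V} (h : outNbrs Z x = {q}) : firstMove Z x = q := by
  have h1 : (outNbrs Z x).card = 1 := by rw [h, card_singleton]
  have key : ∀ (t : Finset V) (hex : ∃ a, t = {a}), t = {q} → hex.choose = q := by
    intro t hex ht
    subst ht
    exact (singleton_inj.mp hex.choose_spec).symm
  unfold firstMove
  rw [dif_pos h1, key _ _ h]

/-- Without a unique outside neighbour the first move is trivial. [folklore] -/
theorem firstMove_eq_self {x : V} (h : (outNbrs Z x).card ≠ 1) : firstMove Z x = x := by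
  unfold firstMove
  rw [dif_neg h]

omit [DecidableEq V] in
/-- The unique neighbour of a vertex whose neighbourhood is `{q}` is `q`. [folklore] -/
theorem firstNbr_eq_of_neighborFinset_eq {x q : V} (h : Z.neighborFinset x = {q}) : firstNbr Z x = q := by
  have h1 : (Z.neighborFinset x).card = 1 := by rw [h, card_singleton]
  have key : ∀ (t : Finset V) (hex : ∃ a, t = {a}), t = {q} → hex.choose = q := by
    intro t hex ht
    subst ht
    exact (singleton_inj.mp hex.choose_spec).symm
  unfold firstNbr
  rw [dif_pos h1, key _ _ h]

omit [DecidableEq V] in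
/-- Without a unique neighbour `firstNbr` is trivial. [folklore] -/
theorem firstNbr_eq_self {x : V} (h : (Z.neighborFinset x).card ≠ 1) : firstNbr Z x = x := by
  unfold firstNbr
  rw [dif_neg h]

/-- Membership in `outNbrs`. [folklore] -/
theorem mem_outNbrs {x y : V} : y ∈ outNbrs Z x ↔ Z.Adj x y ∧ ¬ SameCore Z x y := by
  simp only [outNbrs, mem_filter, SimpleGraph.mem_neighborFinset]

/-- Membership in `coreLinks`. [folklore] -/
theorem mem_coreLinks {x : V} : x ∈ coreLinks Z ↔ IsCore Z x ∧ ¬ IsMid Z x := by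
  simp only [coreLinks, mem_filter, mem_univ, true_and]

end Basic

/-! ### Transport along graph isomorphisms -/

section Iso

variable {V V' : Type*} [Fintype V] [DecidableEq V] [Fintype V'] [DecidableEq V']
  {Z : SimpleGraph V} {Z' : SimpleGraph V'} [DecidableRel Z.Adj] [DecidableRel Z'.Adj]

/-- The vertex embedding of an isomorphism. [folklore] -/
abbrev isoEmb (ψ : Z ≃g Z') : V ↪ V' := ψ.toEquiv.toEmbedding

omit [DecidableEq V] [DecidableEq V'] in
/-- Neighbourhoods are mapped. [folklore] -/
theorem neighborFinset_iso (ψ : Z ≃g Z') (x : V) :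
    Z'.neighborFinset (ψ x) = (Z.neighborFinset x).map (isoEmb ψ) := by
  ext y
  rw [SimpleGraph.mem_neighborFinset, mem_map]
  constructor
  · intro h
    refine ⟨ψ.symm y, ?_, ψ.apply_symm_apply y⟩
    rw [SimpleGraph.mem_neighborFinset, ← ψ.map_adj_iff, ψ.apply_symm_apply]
    exact h
  · rintro ⟨z, hz, rfl⟩
    rw [SimpleGraph.mem_neighborFinset] at hz
    exact ψ.map_adj_iff.mpr hz

omit [DecidableEq V] [DecidableEq V'] in
/-- Degrees are preserved. [folklore] -/
theorem degree_iso (ψ : Z ≃g Z') (x : V) : Z'.degree (ψ x) = Z.degree x := by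
  rw [← SimpleGraph.card_neighborFinset_eq_degree, ← SimpleGraph.card_neighborFinset_eq_degree,
    neighborFinset_iso, card_map]

omit [Fintype V] [DecidableEq V] [Fintype V'] [DecidableEq V'] [DecidableRel Z.Adj] [DecidableRel Z'.Adj] in
/-- Six-cycles are mapped. [folklore] -/
theorem SixCycleThrough.map_iso (ψ : Z ≃g Z') {x y : V} (h : SixCycleThrough Z x y) :
    SixCycleThrough Z' (ψ x) (ψ y) := by
  obtain ⟨v₂, v₃, v₄, v₅, h₁, h₂, h₃, h₄, h₅, hnd⟩ := h
  exact ⟨ψ v₂, ψ v₃, ψ v₄, ψ v₅, ψ.map_adj_iff.mpr h₁, ψ.map_adj_iff.mpr h₂, ψ.map_adj_iff.mpr h₃,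
    ψ.map_adj_iff.mpr h₄, ψ.map_adj_iff.mpr h₅, hnd.map ψ.injective⟩

omit [Fintype V] [DecidableEq V] [Fintype V'] [DecidableEq V'] [DecidableRel Z.Adj] [DecidableRel Z'.Adj] in
/-- Six-cycles correspond under isomorphisms. [folklore] -/
theorem sixCycleThrough_iso (ψ : Z ≃g Z') (x y : V) :
    SixCycleThrough Z' (ψ x) (ψ y) ↔ SixCycleThrough Z x y := by
  constructor
  · intro h
    have := h.map_iso ψ.symm
    rwa [ψ.symm_apply_apply, ψ.symm_apply_apply] at this
  · exact fun h => h.map_iso ψ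

/-- The isomorphism of the rigid subgraphs. [folklore] -/
def rigidIso (ψ : Z ≃g Z') : rigidGraph Z ≃g rigidGraph Z' where
  toEquiv := ψ.toEquiv
  map_rel_iff' := by
    intro a b
    show (Z'.Adj (ψ a) (ψ b) ∧ SixCycleThrough Z' (ψ a) (ψ b)) ↔ (Z.Adj a b ∧ SixCycleThrough Z a b)
    rw [ψ.map_adj_iff, sixCycleThrough_iso]

omit [Fintype V] [DecidableEq V] [Fintype V'] [DecidableEq V'] [DecidableRel Z.Adj] [DecidableRel Z'.Adj] in
/-- Cores correspond. [folklore] -/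
theorem sameCore_iso (ψ : Z ≃g Z') (x y : V) : SameCore Z' (ψ x) (ψ y) ↔ SameCore Z x y :=
  SimpleGraph.Iso.reachable_iff (φ := rigidIso ψ)

omit [DecidableEq V] [DecidableEq V'] in
/-- Core vertices correspond. [folklore] -/
theorem isCore_iso (ψ : Z ≃g Z') (x : V) : IsCore Z' (ψ x) ↔ IsCore Z x := by
  unfold IsCore
  rw [degree_iso]

omit [DecidableEq V] [DecidableEq V'] in
/-- Middle vertices correspond. [folklore] -/
theorem isMid_iso (ψ : Z ≃g Z') (x : V) : IsMid Z' (ψ x) ↔ IsMid Z x := by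
  unfold IsMid
  rw [isCore_iso]
  refine and_congr_right fun _ => ⟨fun h y hy => ?_, fun h y' hy' => ?_⟩
  · have := h (ψ y) (ψ.map_adj_iff.mpr hy)
    rwa [sameCore_iso] at this
  · obtain ⟨y, rfl⟩ := ψ.surjective y'
    rw [sameCore_iso]
    exact h y (ψ.map_adj_iff.mp hy')

/-- `midsOf` is mapped. [folklore] -/
theorem midsOf_iso (ψ : Z ≃g Z') (x : V) : midsOf Z' (ψ x) = (midsOf Z x).map (isoEmb ψ) := by
  ext y'
  rw [mem_midsOf, mem_map]
  constructor
  · rintro ⟨h1, h2⟩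
    obtain ⟨y, rfl⟩ := ψ.surjective y'
    rw [sameCore_iso] at h1
    rw [isMid_iso] at h2
    exact ⟨y, mem_midsOf.mpr ⟨h1, h2⟩, rfl⟩
  · rintro ⟨y, hy, rfl⟩
    rw [mem_midsOf] at hy
    exact ⟨(sameCore_iso ψ x y).mpr hy.1, (isMid_iso ψ y).mpr hy.2⟩

/-- `outNbrs` is mapped. [folklore] -/
theorem outNbrs_iso (ψ : Z ≃g Z') (x : V) : outNbrs Z' (ψ x) = (outNbrs Z x).map (isoEmb ψ) := by
  ext y'
  rw [mem_outNbrs, mem_map]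
  constructor
  · rintro ⟨h1, h2⟩
    obtain ⟨y, rfl⟩ := ψ.surjective y'
    rw [ψ.map_adj_iff] at h1
    rw [sameCore_iso] at h2
    exact ⟨y, mem_outNbrs.mpr ⟨h1, h2⟩, rfl⟩
  · rintro ⟨y, hy, rfl⟩
    rw [mem_outNbrs] at hy
    exact ⟨ψ.map_adj_iff.mpr hy.1, fun h => hy.2 ((sameCore_iso ψ x y).mp h)⟩

/-- `coreLinks` is mapped. [folklore] -/
theorem coreLinks_iso (ψ : Z ≃g Z') : coreLinks Z' = (coreLinks Z).map (isoEmb ψ) := by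
  ext y'
  rw [mem_coreLinks, mem_map]
  constructor
  · rintro ⟨h1, h2⟩
    obtain ⟨y, rfl⟩ := ψ.surjective y'
    rw [isCore_iso] at h1
    rw [isMid_iso] at h2
    exact ⟨y, mem_coreLinks.mpr ⟨h1, h2⟩, rfl⟩
  · rintro ⟨y, hy, rfl⟩
    rw [mem_coreLinks] at hy
    exact ⟨(isCore_iso ψ y).mpr hy.1, fun h => hy.2 ((isMid_iso ψ y).mp h)⟩

omit [Fintype V] [DecidableEq V] [Fintype V'] [DecidableEq V'] [DecidableRel Z.Adj] [DecidableRel Z'.Adj] in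
/-- The map of a singleton along an embedding, read backwards. [folklore] -/
theorem eq_singleton_of_map_eq {s : Finset V} (ψ : Z ≃g Z') (h1 : s.card = 1) :
    ∃ q, s = {q} ∧ s.map (isoEmb ψ) = {ψ q} := by
  obtain ⟨q, rfl⟩ := card_eq_one.mp h1
  exact ⟨q, rfl, by rw [map_singleton]; rfl⟩

/-- The first move is mapped. [folklore] -/
theorem firstMove_iso (ψ : Z ≃g Z') (x : V) : firstMove Z' (ψ x) = ψ (firstMove Z x) := by
  by_cases h1 : (outNbrs Z x).card = 1
  · obtain ⟨q, hq, hmap⟩ := eq_singleton_of_map_eq ψ h1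
    rw [firstMove_eq_of_outNbrs_eq hq, firstMove_eq_of_outNbrs_eq (by rw [outNbrs_iso, hmap])]
  · rw [firstMove_eq_self h1, firstMove_eq_self (by rwa [outNbrs_iso, card_map])]

omit [DecidableEq V] [DecidableEq V'] in
/-- `firstNbr` is mapped. [folklore] -/
theorem firstNbr_iso (ψ : Z ≃g Z') (x : V) : firstNbr Z' (ψ x) = ψ (firstNbr Z x) := by
  by_cases h1 : (Z.neighborFinset x).card = 1
  · obtain ⟨q, hq, hmap⟩ := eq_singleton_of_map_eq ψ h1
    rw [firstNbr_eq_of_neighborFinset_eq hq, firstNbr_eq_of_neighborFinset_eq (by rw [neighborFinset_iso, hmap])]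
  · rw [firstNbr_eq_self h1, firstNbr_eq_self (by rwa [neighborFinset_iso, card_map])]

/-! #### Transport of the non-backtracking walk -/

/-- Exits are mapped. [folklore] -/
theorem exits_iso (ψ : Z ≃g Z') (s : V × V) : exits Z' (ψ s.1, ψ s.2) = (exits Z s).map (isoEmb ψ) := by
  unfold exits
  dsimp only
  rw [neighborFinset_iso, map_erase]
  rfl

/-- Moving states correspond. [folklore] -/
theorem moves_iso (ψ : Z ≃g Z') (s : V × V) : Moves Z' (ψ s.1, ψ s.2) ↔ Moves Z s := by
  unfold Moves
  rw [exits_iso, card_map]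

/-- One step is mapped. [folklore] -/
theorem trailStep_iso (ψ : Z ≃g Z') (s : V × V) :
    trailStep Z' (ψ s.1, ψ s.2) = (ψ (trailStep Z s).1, ψ (trailStep Z s).2) := by
  by_cases h1 : (exits Z s).card = 1
  · obtain ⟨q, hq, hmap⟩ := eq_singleton_of_map_eq ψ h1
    rw [trailStep_of_exits_eq hq, trailStep_of_exits_eq (by rw [exits_iso, hmap])]
  · rw [trailStep_of_not_moves (s := s) h1, trailStep_of_not_moves (by rwa [moves_iso])]

/-- The run is mapped. [folklore] -/
theorem trailRun_iso (ψ : Z ≃g Z') (s : V × V) (k : ℕ) :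
    trailRun Z' k (ψ s.1, ψ s.2) = (ψ (trailRun Z k s).1, ψ (trailRun Z k s).2) := by
  induction k with
  | zero => rfl
  | succ k ih => rw [trailRun_succ, trailRun_succ, ih, trailStep_iso]

/-- The vertex sequence is mapped. [folklore] -/
theorem trailVert_iso (ψ : Z ≃g Z') (s : V × V) (k : ℕ) : trailVert Z' (ψ s.1, ψ s.2) k = ψ (trailVert Z s k) := by
  rcases k with _ | k
  · rfl
  · show (trailRun Z' k (ψ s.1, ψ s.2)).2 = ψ (trailRun Z k s).2
    rw [trailRun_iso]

/-- The number of moves is preserved. [folklore] -/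
theorem trailMoves_iso (ψ : Z ≃g Z') (s : V × V) (N : ℕ) : trailMoves Z' N (ψ s.1, ψ s.2) = trailMoves Z N s := by
  unfold trailMoves
  congr 1
  ext k
  simp only [mem_filter, mem_range]
  rw [trailRun_iso, moves_iso (s := trailRun Z k s)]

/-- The length of the maximal walk is preserved. [folklore] -/
theorem trailLen_iso (ψ : Z ≃g Z') (s : V × V) : trailLen Z' (ψ s.1, ψ s.2) = trailLen Z s := by
  unfold trailLen
  rw [trailMoves_iso, Fintype.card_congr ψ.toEquiv]

/-- The end of the maximal walk is mapped. [folklore] -/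
theorem trailEnd_iso (ψ : Z ≃g Z') (s : V × V) : trailEnd Z' (ψ s.1, ψ s.2) = ψ (trailEnd Z s) := by
  unfold trailEnd
  rw [Fintype.card_congr ψ.toEquiv, trailRun_iso]

/-- The start of the walk from a core link is mapped. [folklore] -/
theorem linkStart_iso (ψ : Z ≃g Z') (x : V) : linkStart Z' (ψ x) = (ψ (linkStart Z x).1, ψ (linkStart Z x).2) := by
  unfold linkStart
  rw [firstMove_iso]

/-! #### Transport of the verdict -/

variable {ρ : V → V} {ρ' : V' → V'}

/-- Bad corridor-type links correspond (representatives transported). [folklore] -/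
theorem corrBad_iso (ψ : Z ≃g Z') (hρ : ∀ x, ρ' (ψ x) = ψ (ρ x)) (x : V) : CorrBad Z' ρ' (ψ x) ↔ CorrBad Z ρ x := by
  unfold CorrBad
  rw [linkStart_iso, trailEnd_iso, isCore_iso, hρ, hρ, ψ.map_adj_iff, ψ.map_adj_iff]

/-- Bad pendant-type links correspond. [folklore] -/
theorem pendBad_iso (ψ : Z ≃g Z') (hρ : ∀ x, ρ' (ψ x) = ψ (ρ x)) (x : V) : PendBad Z' ρ' (ψ x) ↔ PendBad Z ρ x := by
  unfold PendBad
  rw [linkStart_iso, trailEnd_iso, isCore_iso, trailLen_iso, hρ, ψ.map_adj_iff]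

omit [Fintype V] [DecidableEq V] [Fintype V'] [DecidableEq V'] [DecidableRel Z.Adj] [DecidableRel Z'.Adj] in
/-- Counting a transported predicate over a transported finset. [folklore] -/
theorem card_filter_map_iso (ψ : Z ≃g Z') {s : Finset V} {P : V → Prop} {P' : V' → Prop} [DecidablePred P]
    [DecidablePred P'] (hP : ∀ x, P' (ψ x) ↔ P x) : ((s.map (isoEmb ψ)).filter P').card = (s.filter P).card := by
  rw [filter_map, card_map]
  congr 1
  ext x
  simp only [mem_filter, Function.comp_apply]
  exact and_congr_right fun _ => hP x

/-- `nCorr` is preserved. [folklore] -/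
theorem nCorr_iso (ψ : Z ≃g Z') (hρ : ∀ x, ρ' (ψ x) = ψ (ρ x)) : nCorr Z' ρ' = nCorr Z ρ := by
  unfold nCorr
  rw [coreLinks_iso ψ, card_filter_map_iso ψ (corrBad_iso ψ hρ)]

/-- `nPend` is preserved. [folklore] -/
theorem nPend_iso (ψ : Z ≃g Z') (hρ : ∀ x, ρ' (ψ x) = ψ (ρ x)) : nPend Z' ρ' = nPend Z ρ := by
  unfold nPend
  rw [coreLinks_iso ψ, card_filter_map_iso ψ (pendBad_iso ψ hρ)]

/-- **The verdict is invariant under isomorphisms** (representatives transported).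
[cite: ChenFlumLiu2025, Thm. 8.1 ("accepting (all graphs isomorphic to) `Y(G)`")] -/
theorem verdict_iff_of_iso (ψ : Z ≃g Z') (hρ : ∀ x, ρ' (ψ x) = ψ (ρ x)) : Verdict Z' ρ' ↔ Verdict Z ρ := by
  have hcore : (∃ x, IsCore Z' x) ↔ ∃ x, IsCore Z x := by
    constructor
    · rintro ⟨x', hx'⟩
      obtain ⟨x, rfl⟩ := ψ.surjective x'
      exact ⟨x, (isCore_iso ψ x).mp hx'⟩
    · rintro ⟨x, hx⟩
      exact ⟨ψ x, (isCore_iso ψ x).mpr hx⟩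
  have hdead : (∃ x, Z'.degree x = 1 ∧ trailLen Z' (x, firstNbr Z' x) % 3 ≠ 1) ↔
      ∃ x, Z.degree x = 1 ∧ trailLen Z (x, firstNbr Z x) % 3 ≠ 1 := by
    constructor
    · rintro ⟨x', h1, h2⟩
      obtain ⟨x, rfl⟩ := ψ.surjective x'
      rw [degree_iso] at h1
      rw [firstNbr_iso, trailLen_iso ψ (x, firstNbr Z x)] at h2
      exact ⟨x, h1, h2⟩
    · rintro ⟨x, h1, h2⟩
      refine ⟨ψ x, by rw [degree_iso]; exact h1, ?_⟩
      rw [firstNbr_iso, trailLen_iso ψ (x, firstNbr Z x)]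
      exact h2
  have hreg : (∀ x, Z'.degree x = 2) ↔ ∀ x, Z.degree x = 2 := by
    constructor
    · intro h x
      rw [← degree_iso ψ]
      exact h _
    · intro h x'
      obtain ⟨x, rfl⟩ := ψ.surjective x'
      rw [degree_iso]
      exact h x
  have hconn : (∃ u w, ¬ Z'.Reachable u w) ↔ ∃ u w, ¬ Z.Reachable u w := by
    constructor
    · rintro ⟨u', w', h⟩
      obtain ⟨u, rfl⟩ := ψ.surjective u'
      obtain ⟨w, rfl⟩ := ψ.surjective w'
      exact ⟨u, w, fun hr => h (SimpleGraph.Iso.reachable_iff.mpr hr)⟩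
    · rintro ⟨u, w, h⟩
      exact ⟨ψ u, ψ w, fun hr => h (SimpleGraph.Iso.reachable_iff.mp hr)⟩
  unfold Verdict
  rw [hcore, hdead, hreg, hconn, nCorr_iso ψ hρ, nPend_iso ψ hρ]

/-- The representative map transported along an isomorphism. [folklore] -/
noncomputable def transportRep (ψ : Z ≃g Z') (ρ' : V' → V') : V → V := fun x => ψ.symm (ρ' (ψ x))

omit [Fintype V] [DecidableEq V] [Fintype V'] [DecidableEq V'] [DecidableRel Z.Adj] [DecidableRel Z'.Adj] in
/-- The transport equation. [folklore] -/
theorem transportRep_spec (ψ : Z ≃g Z') (ρ' : V' → V') (x : V) : ρ' (ψ x) = ψ (transportRep ψ ρ' x) := by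
  unfold transportRep
  rw [ψ.apply_symm_apply]

/-- **Admissible representatives transport to admissible representatives.** [folklore] -/
theorem IsRepMap.transport (ψ : Z ≃g Z') (h : IsRepMap Z' ρ') : IsRepMap Z (transportRep ψ ρ') where
  eq_of_sameCore x y hxy hne := by
    unfold transportRep
    congr 1
    apply h.eq_of_sameCore _ _ ((sameCore_iso ψ x y).mpr hxy)
    rw [midsOf_iso]
    exact hne.map
  mem_midsOf x hne := by
    have := h.mem_midsOf (ψ x) (by rw [midsOf_iso]; exact hne.map)
    rw [midsOf_iso, mem_map] at this
    obtain ⟨y, hy, hy'⟩ := this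
    unfold transportRep
    rw [← hy', show (isoEmb ψ) y = ψ y from rfl, ψ.symm_apply_apply]
    exact hy

/-- **The verdict on an isomorphic copy**, with least representatives on the copy and the
transported (admissible) representatives on the original. [cite: ChenFlumLiu2025, Thm. 8.1] -/
theorem verdict_repMin_iff_of_iso [LinearOrder V'] (ψ : Z ≃g Z') :
    Verdict Z' (repMin Z') ↔ Verdict Z (transportRep ψ (repMin Z')) :=
  verdict_iff_of_iso ψ (transportRep_spec ψ (repMin Z'))

end Iso

end Literature.ModelTheory.FiniteModelTheory

end

/-!
## Part II. The parity separator on the uncoloured CFI graphs: correctness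

Topic `Literature/ModelTheory/FiniteModelTheory`; the mathematical half of the discharge of
`ChenFlumLiu2025_ptime_separation` (`CFIUncoloured.lean`; Chen–Flum–Liu 2025, Thm. 8.1). We prove
that the invariant `Verdict` of Part I ACCEPTS `CFI(G, ∅) = Y(G)` and REJECTS
`CFI(G, {e}) = Y^e(G) ≅ Ỹ(G)` for every connected base graph `G` with at least two vertices, every
edge `e` of `G`, and every admissible choice of representatives (`IsRepMap`).

Proof architecture (the source, §8, recovers the gadgets of degree `≥ 3` by short cycles, then
"propagates" along the vertices of degree `≤ 2`, fixes an ordering to name `a`/`b`, and counts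
twisted edges; we follow the first step and replace the rest by a parity count that needs no
names):
* §A: in `CFI(G, T)` the core vertices are the vertices over base vertices of degree `≥ 3`, the
  rigid edges are their gadget edges, `SameCore` = same (high) gadget, the middle vertices are the
  `m(u, S)`, the core links are the `(u, w, c)` with `deg u ≥ 3`, the first move from a core link
  is its connection partner, and an admissible representative map picks one even set `S_u` per
  high base vertex `u` (`CFIUncolouredStructure.lean` supplies the local facts);
* §B: SIMULATION — along a chain `x₀, x₁, …` of the base graph through degree-two vertices
  (`DegreeTwoWalks.lean`) the walk of `CFI(G, T)` started at `((x₀,x₁,γ), (x₁,x₀,γ ⊕ t₀))`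
  advances three steps per base vertex and carries the bit `γ ⊕ (t₀ ⊕ ⋯ ⊕ t_{k-1})`
  (`tau`); at a high end it stops at a core link, at a leaf end at the dead end `a` or `m(∅)`
  according to the bit;
* §C: hence for a core link over the high dart `d = (u, w)`: `CorrBad ⇔` (end of the chain of `d`
  is high) `∧ τ(d) ⊕ [w ∈ S_u] ⊕ [x_L ∈ S_{x_{L+1}}]`, `PendBad ⇔` (end is a leaf)
  `∧ τ(d) ⊕ [w ∈ S_u]`, where `τ(d)` is the parity of the twisted edges on the chain;
* §D: ACCOUNTING — `nCorr = 2·#{bad corridor darts}`, `nPend = 2·#{bad pendant darts}`,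
  the reversal `trailRev` is a fixed-point-free involution on the bad corridor darts, and modulo 2
  `nCorr/4 + nPend/2 ≡ Σ_{chains} τ + Σ_u |S_u| ≡ |T|` (every edge lies on exactly one chain up to
  reversal, `IsTrailStart.eq_or_eq_rev_of_mem_trailEdges`, `exists_isTrailStart_mem_trailEdges`);
* §E: the base graphs without a vertex of degree `≥ 3`: paths (dead-end walks have length
  `≡ 0, 2` for `T = ∅` and `≡ 1 (mod 3)` for `T = {e}`) and cycles (`Y` is disconnected by the
  letter potential, `Y^e` is connected since the walk runs twice around), Lemma 6.8 of the source.

Main results: `verdict_cfiGraph_of_forall_notMem`, `not_verdict_cfiGraph_of_singleton`.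
-/

noncomputable section

namespace Literature.ModelTheory.FiniteModelTheory

open Finset Literature.Combinatorics.SimpleGraph

variable {v : ℕ} {G : SimpleGraph (Fin v)} [DecidableRel G.Adj]
  {T : Set (Sym2 (Fin v))} [DecidablePred (· ∈ T)]

/-! ### §A. Cores, middle vertices, first moves and representatives in `CFI(G, T)` -/

/-- Core vertices are the vertices over base vertices of degree `≥ 3`. [cite: ChenFlumLiu2025, §8] -/
theorem isCore_iff (x : CFIVertex G) : IsCore (cfiGraph G T) x ↔ 3 ≤ G.degree (base x) :=
  three_le_degree_iff x

/-- Rigid adjacency: a gadget edge over a base vertex of degree `≥ 3`. [cite: ChenFlumLiu2025, §8] -/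
theorem rigid_adj_iff (x y : CFIVertex G) :
    (rigidGraph (cfiGraph G T)).Adj x y ↔ (cfiGraph G T).Adj x y ∧ base x = base y ∧ 3 ≤ G.degree (base x) := by
  show ((cfiGraph G T).Adj x y ∧ SixCycleThrough (cfiGraph G T) x y) ↔ _
  constructor
  · rintro ⟨h, h6⟩
    exact ⟨h, (sixCycleThrough_iff_of_adj h).mp h6⟩
  · rintro ⟨h, hb⟩
    exact ⟨h, (sixCycleThrough_iff_of_adj h).mpr hb⟩

/-- Vertices of the same core have the same base. [folklore] -/
theorem base_eq_of_sameCore {x y : CFIVertex G} (h : SameCore (cfiGraph G T) x y) : base x = base y :=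
  apply_eq_of_reachable (Z := rigidGraph (cfiGraph G T)) base (fun a b hab => ((rigid_adj_iff a b).mp hab).2.1) h

/-- A non-core vertex is alone in its core. [folklore] -/
theorem eq_of_sameCore_of_not_isCore {x y : CFIVertex G} (hx : ¬ IsCore (cfiGraph G T) x)
    (h : SameCore (cfiGraph G T) x y) : x = y := by
  obtain ⟨W⟩ := h
  cases W with
  | nil => rfl
  | cons hadj _ =>
    exact absurd ((isCore_iff x).mpr ((rigid_adj_iff _ _).mp hadj).2.2) hx

/-- A gadget edge over a base vertex of degree `≥ 3` joins vertices of the same core. [folklore] -/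
theorem sameCore_of_adj {x y : CFIVertex G} (h : (cfiGraph G T).Adj x y) (hb : base x = base y)
    (h3 : 3 ≤ G.degree (base x)) : SameCore (cfiGraph G T) x y :=
  sameCore_of_rigid h ((sixCycleThrough_iff_of_adj h).mpr ⟨hb, h3⟩)

/-- Every vertex of a high gadget is in the core of `m(u, ∅)`. [cite: ChenFlumLiu2025, Lemma 3.1] -/
theorem sameCore_emptyMid {u : Fin v} (h3 : 3 ≤ G.degree u) {x : CFIVertex G} (hx : base x = u) :
    SameCore (cfiGraph G T) x (midV ⟨u, emptyMid G u⟩) := by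
  -- a `b`-link is adjacent to `m(u, ∅)`
  have hb : ∀ (w : Fin v) (hw : G.Adj u w),
      SameCore (cfiGraph G T) (linkV (⟨(u, w), hw⟩, false)) (midV ⟨u, emptyMid G u⟩) := fun w hw =>
    sameCore_of_adj (adj_midV_linkV_of_iff hw (emptyMid G u) false (by simp)).symm rfl h3
  -- an `a`-link reaches a `b`-link through `m(u, {w, w'})`
  have ha : ∀ (w : Fin v) (hw : G.Adj u w),
      SameCore (cfiGraph G T) (linkV (⟨(u, w), hw⟩, true)) (midV ⟨u, emptyMid G u⟩) := by
    intro w hw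
    obtain ⟨w', w'', hw', hw'', hne', hne'', hne⟩ := exists_two_other_neighbors w h3
    have h1 : (cfiGraph G T).Adj (linkV (⟨(u, w), hw⟩, true)) (midV ⟨u, pairMid hw hw' hne'.symm⟩) :=
      (adj_midV_linkV_of_iff hw _ true (by simp)).symm
    have h2 : (cfiGraph G T).Adj (midV ⟨u, pairMid hw hw' hne'.symm⟩) (linkV (⟨(u, w''), hw''⟩, false)) :=
      adj_midV_linkV_of_iff hw'' _ false (by
        simp only [pairMid_val, mem_insert, mem_singleton, Bool.false_eq_true, false_iff, not_or]
        exact ⟨hne'', hne.symm⟩)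
    exact (sameCore_of_adj h1 rfl h3).trans ((sameCore_of_adj h2 rfl h3).trans (hb w'' hw''))
  rcases linkV_or_midV x with ⟨⟨⟨⟨u', w⟩, hw⟩, c⟩, rfl⟩ | ⟨⟨u', S⟩, rfl⟩
  · simp only [base_linkV] at hx
    subst hx
    cases c
    · exact hb w hw
    · exact ha w hw
  · simp only [base_midV] at hx
    subst hx
    -- a middle vertex is adjacent to some link of its gadget
    obtain ⟨w, hw⟩ := (G.degree_pos_iff_exists_adj u').mp (by omega)
    have h1 : (cfiGraph G T).Adj (midV ⟨u', S⟩) (linkV (⟨(u', w), hw⟩, decide (w ∈ S.1))) :=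
      adj_midV_linkV_of_iff hw S _ decide_eq_true_iff
    refine (sameCore_of_adj h1 rfl h3).trans ?_
    cases decide (w ∈ S.1)
    · exact hb w hw
    · exact ha w hw

/-- **`SameCore` in `CFI(G, T)`**: for a core vertex, the vertices over the same base vertex.
[cite: ChenFlumLiu2025, §8 (the classes of `∼` are the gadgets)] -/
theorem sameCore_iff_of_isCore {x y : CFIVertex G} (hx : IsCore (cfiGraph G T) x) :
    SameCore (cfiGraph G T) x y ↔ base x = base y := by
  rw [isCore_iff] at hx
  constructor
  · exact base_eq_of_sameCore
  · intro hb
    exact (sameCore_emptyMid hx rfl).trans (sameCore_emptyMid (hb ▸ hx) hb.symm).symm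

/-- **Middle vertices of `CFI(G, T)`**: the `m(u, S)` over base vertices of degree `≥ 3`.
[cite: ChenFlumLiu2025, Lemma 7.13] -/
theorem isMid_iff (x : CFIVertex G) : IsMid (cfiGraph G T) x ↔ 3 ≤ G.degree (base x) ∧ ∃ m, x = midV m := by
  constructor
  · rintro ⟨hc, hall⟩
    rw [isCore_iff] at hc
    refine ⟨hc, ?_⟩
    rcases linkV_or_midV x with ⟨x, rfl⟩ | ⟨m, rfl⟩
    · have := base_eq_of_sameCore (hall _ (adj_linkV_conn x))
      exact absurd this.symm (base_conn_ne x)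
    · exact ⟨m, rfl⟩
  · rintro ⟨h3, ⟨u, S⟩, rfl⟩
    refine ⟨(isCore_iff _).mpr h3, fun y hy => ?_⟩
    obtain ⟨w, hw, c, rfl, -⟩ := (adj_midV_iff u S y).mp hy
    exact sameCore_of_adj hy rfl h3

/-- **The core links of `CFI(G, T)`**: the links over base vertices of degree `≥ 3`.
[cite: ChenFlumLiu2025, Lemma 7.13 and §8] -/
theorem mem_coreLinks_iff (y : CFIVertex G) :
    y ∈ coreLinks (cfiGraph G T) ↔ ∃ x : CFIDart G × Bool, y = linkV x ∧ 3 ≤ G.degree x.1.1.1 := by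
  rw [mem_coreLinks, isCore_iff, isMid_iff]
  constructor
  · rintro ⟨h3, hnm⟩
    rcases linkV_or_midV y with ⟨x, rfl⟩ | ⟨m, rfl⟩
    · exact ⟨x, rfl, h3⟩
    · exact absurd ⟨h3, m, rfl⟩ hnm
  · rintro ⟨x, rfl, h3⟩
    refine ⟨h3, fun ⟨_, m, hm⟩ => absurd hm linkV_ne_midV⟩

/-- The outside neighbours of a core link: exactly its connection partner. [cite: ChenFlumLiu2025, §8] -/
theorem outNbrs_linkV {x : CFIDart G × Bool} (h3 : 3 ≤ G.degree x.1.1.1) :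
    outNbrs (cfiGraph G T) (linkV x) = {linkV (conn G T x)} := by
  have hc : IsCore (cfiGraph G T) (linkV x) := (isCore_iff _).mpr h3
  ext y
  rw [mem_outNbrs, mem_singleton, sameCore_iff_of_isCore hc, adj_linkV_iff]
  constructor
  · rintro ⟨⟨S, rfl, -⟩ | rfl, hb⟩
    · exact absurd rfl hb
    · rfl
  · rintro rfl
    exact ⟨Or.inr rfl, fun hb => base_conn_ne x hb.symm⟩

/-- **The first move from a core link is its connection partner.** [cite: ChenFlumLiu2025, §8] -/
theorem firstMove_linkV {x : CFIDart G × Bool} (h3 : 3 ≤ G.degree x.1.1.1) :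
    firstMove (cfiGraph G T) (linkV x) = linkV (conn G T x) :=
  firstMove_eq_of_outNbrs_eq (outNbrs_linkV h3)

/-- The starting state of the walk from a core link. [folklore] -/
theorem linkStart_linkV {x : CFIDart G × Bool} (h3 : 3 ≤ G.degree x.1.1.1) :
    linkStart (cfiGraph G T) (linkV x) = (linkV x, linkV (conn G T x)) := by
  unfold linkStart
  rw [firstMove_linkV h3]

/-- The middle vertices of the core of a core vertex: all `m(u, S)` of its gadget. [folklore] -/
theorem mem_midsOf_iff_of_isCore {x : CFIVertex G} (hx : IsCore (cfiGraph G T) x) (y : CFIVertex G) :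
    y ∈ midsOf (cfiGraph G T) x ↔ ∃ S, y = midV ⟨base x, S⟩ := by
  rw [mem_midsOf, sameCore_iff_of_isCore hx, isMid_iff]
  constructor
  · rintro ⟨hb, -, ⟨u, S⟩, rfl⟩
    simp only [base_midV] at hb
    subst hb
    exact ⟨S, rfl⟩
  · rintro ⟨S, rfl⟩
    rw [isCore_iff] at hx
    exact ⟨rfl, hx, _, rfl⟩

/-- The even set chosen by the representatives at a base vertex (junk `∅` if none). [folklore] -/
def repSet (ρ : CFIVertex G → CFIVertex G) (u : Fin v) :
    {S : Finset (Fin v) // S ⊆ G.neighborFinset u ∧ Even S.card} :=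
  if h : ∃ S, ρ (midV ⟨u, emptyMid G u⟩) = midV ⟨u, S⟩ then h.choose else emptyMid G u

/-- **Admissible representatives on `CFI(G, T)`**: every core vertex over the high base vertex
`u` is represented by `m(u, S_u)` with `S_u = repSet ρ u`. [folklore] -/
theorem rep_eq_of_isRepMap {ρ : CFIVertex G → CFIVertex G} (hρ : IsRepMap (cfiGraph G T) ρ)
    {x : CFIVertex G} (h3 : 3 ≤ G.degree (base x)) : ρ x = midV ⟨base x, repSet ρ (base x)⟩ := by
  set u := base x with hu
  have hcm : IsCore (cfiGraph G T) (midV ⟨u, emptyMid G u⟩) := (isCore_iff _).mpr h3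
  have hne : (midsOf (cfiGraph G T) (midV ⟨u, emptyMid G u⟩)).Nonempty :=
    ⟨midV ⟨u, emptyMid G u⟩, (mem_midsOf_iff_of_isCore hcm _).mpr ⟨_, rfl⟩⟩
  have hmem₀ := hρ.mem_midsOf _ hne
  rw [mem_midsOf_iff_of_isCore hcm] at hmem₀
  have hmem : ∃ S, ρ (midV ⟨u, emptyMid G u⟩) = midV ⟨u, S⟩ := hmem₀
  -- so `repSet ρ u` is such an `S`
  have hrep : ρ (midV ⟨u, emptyMid G u⟩) = midV ⟨u, repSet ρ u⟩ := by
    unfold repSet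
    rw [dif_pos hmem]
    exact hmem.choose_spec
  -- `x` is in the same core as `m(u, ∅)`
  have hsc : SameCore (cfiGraph G T) x (midV ⟨u, emptyMid G u⟩) := sameCore_emptyMid h3 rfl
  have hne' : (midsOf (cfiGraph G T) x).Nonempty := by
    rw [midsOf_eq_of_sameCore hsc]; exact hne
  rw [hρ.eq_of_sameCore _ _ hsc hne', hrep]

/-- Adjacency of a core link to its representative, as a bit. [folklore] -/
theorem adj_rep_iff {ρ : CFIVertex G → CFIVertex G} (hρ : IsRepMap (cfiGraph G T) ρ)
    {u w : Fin v} (hw : G.Adj u w) (c : Bool) (h3 : 3 ≤ G.degree u) :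
    (cfiGraph G T).Adj (linkV (⟨(u, w), hw⟩, c)) (ρ (linkV (⟨(u, w), hw⟩, c))) ↔ (c = true ↔ w ∈ (repSet ρ u).1) := by
  rw [rep_eq_of_isRepMap hρ (x := linkV (⟨(u, w), hw⟩, c)) h3, SimpleGraph.adj_comm]
  show (cfiGraph G T).Adj (midV ⟨u, repSet ρ u⟩) (linkV (⟨(u, w), hw⟩, c)) ↔ _
  rw [adj_midV_linkV]
  simp

/-! ### §B. Simulation of the walk along a chain of the base graph -/

section Generic

variable {V : Type*} [Fintype V] [DecidableEq V] {Z : SimpleGraph V} [DecidableRel Z.Adj]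

/-- The length of the maximal walk from a start is determined by its stopping pattern.
[folklore] -/
theorem _root_.Literature.Combinatorics.SimpleGraph.IsTrailStart.trailLen_eq_of_stop {s : V × V} (h : IsTrailStart Z s) {ℓ : ℕ}
    (hmov : ∀ k < ℓ, Moves Z (trailRun Z k s)) (hstop : ¬ Moves Z (trailRun Z ℓ s)) : trailLen Z s = ℓ := by
  rcases Nat.lt_trichotomy (trailLen Z s) ℓ with hlt | heq | hgt
  · exact absurd (hmov _ hlt) h.not_moves
  · exact heq
  · exact absurd (h.moves hgt) hstop

/-- The end of the maximal walk from a start with a known stopping pattern. [folklore] -/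
theorem _root_.Literature.Combinatorics.SimpleGraph.IsTrailStart.trailEnd_eq_of_stop {s : V × V} (h : IsTrailStart Z s) {ℓ : ℕ}
    (hmov : ∀ k < ℓ, Moves Z (trailRun Z k s)) (hstop : ¬ Moves Z (trailRun Z ℓ s)) :
    trailEnd Z s = (trailRun Z ℓ s).2 := by
  unfold trailEnd
  rw [h.trailRun_card, h.trailLen_eq_of_stop hmov hstop]

/-- Erasing the first element of a pair. [folklore] -/
theorem pair_erase_left {α : Type*} [DecidableEq α] {a b : α} (h : a ≠ b) : ({a, b} : Finset α).erase a = {b} := by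
  rw [erase_insert]
  rwa [mem_singleton]

/-- Erasing the second element of a pair. [folklore] -/
theorem pair_erase_right {α : Type*} [DecidableEq α] {a b : α} (h : a ≠ b) : ({a, b} : Finset α).erase b = {a} := by
  rw [pair_comm]
  exact pair_erase_left h.symm

/-- A Boolean is the decision of a proposition it is equivalent to. [folklore] -/
theorem decide_eq_of_iff' {p : Prop} [Decidable p] {b : Bool} (h : b = true ↔ p) : decide p = b := by
  cases b
  · simpa using h
  · simpa using h

end Generic

/-- The accumulated twist bit along a vertex sequence: `τ_k = t(x₀x₁) ⊕ ⋯ ⊕ t(x_{k-1}x_k)`.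
[cite: ChenFlumLiu2025, §8 (proof of Thm. 8.1: counting the twisted edges)] -/
def tau (T : Set (Sym2 (Fin v))) [DecidablePred (· ∈ T)] (x : ℕ → Fin v) : ℕ → Bool
  | 0 => false
  | k + 1 => xor (tau T x k) (twist T (x k) (x (k + 1)))

/-- `τ₀ = false`. [folklore] -/
@[simp] theorem tau_zero (x : ℕ → Fin v) : tau T x 0 = false := rfl

/-- `τ_{k+1} = τ_k ⊕ t_k`. [folklore] -/
theorem tau_succ (x : ℕ → Fin v) (k : ℕ) : tau T x (k + 1) = xor (tau T x k) (twist T (x k) (x (k + 1))) := rfl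

omit [DecidableRel G.Adj] in
/-- The connection partner of the forward link `(x_k, x_{k+1}, γ ⊕ τ_k)` is the backward link
`(x_{k+1}, x_k, γ ⊕ τ_{k+1})`, and conversely. [folklore] -/
theorem conn_forward (x : ℕ → Fin v) (γ : Bool) (k : ℕ) (h : G.Adj (x k) (x (k + 1))) :
    conn G T (⟨(x k, x (k + 1)), h⟩, xor γ (tau T x k)) = (⟨(x (k + 1), x k), h.symm⟩, xor γ (tau T x (k + 1))) := by
  refine Prod.ext rfl ?_
  show xor (xor γ (tau T x k)) (twist T (x k) (x (k + 1))) = xor γ (tau T x (k + 1))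
  rw [tau_succ, Bool.xor_assoc]

omit [DecidableRel G.Adj] in
/-- See `conn_forward`. [folklore] -/
theorem conn_backward (x : ℕ → Fin v) (γ : Bool) (k : ℕ) (h : G.Adj (x k) (x (k + 1))) :
    conn G T (⟨(x (k + 1), x k), h.symm⟩, xor γ (tau T x (k + 1))) = (⟨(x k, x (k + 1)), h⟩, xor γ (tau T x k)) := by
  rw [← conn_forward x γ k h, conn_conn]

/-- **One base vertex of degree two = three steps of the CFI walk.** From the state
`((x_k, x_{k+1}, γ ⊕ τ_k), (x_{k+1}, x_k, γ ⊕ τ_{k+1}))`, if `x_{k+1}` has exactly the two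
neighbours `x_k ≠ x_{k+2}`, the walk moves to the middle vertex of the gadget of `x_{k+1}` with the
bit `γ ⊕ τ_{k+1}`, then to the link towards `x_{k+2}`, then across the connection.
[cite: ChenFlumLiu2025, §8 (proof of Thm. 8.1: the gadgets of the vertices of degree `≤ 2`)] -/
theorem sim_local (x : ℕ → Fin v) (γ : Bool) (k : ℕ) (h₁ : G.Adj (x k) (x (k + 1))) (h₂ : G.Adj (x (k + 1)) (x (k + 2)))
    (hN : G.neighborFinset (x (k + 1)) = {x k, x (k + 2)}) (hne : x k ≠ x (k + 2))
    (s₀ : CFIVertex G × CFIVertex G) (m : ℕ)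
    (hrun : trailRun (cfiGraph G T) m s₀ =
      (linkV (⟨(x k, x (k + 1)), h₁⟩, xor γ (tau T x k)), linkV (conn G T (⟨(x k, x (k + 1)), h₁⟩, xor γ (tau T x k))))) :
    trailRun (cfiGraph G T) (m + 1) s₀ =
        (linkV (⟨(x (k + 1), x k), h₁.symm⟩, xor γ (tau T x (k + 1))),
          midV ⟨x (k + 1), lowMid h₁.symm h₂ hne (xor γ (tau T x (k + 1)))⟩) ∧
      trailRun (cfiGraph G T) (m + 2) s₀ =
        (midV ⟨x (k + 1), lowMid h₁.symm h₂ hne (xor γ (tau T x (k + 1)))⟩,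
          linkV (⟨(x (k + 1), x (k + 2)), h₂⟩, xor γ (tau T x (k + 1)))) ∧
      trailRun (cfiGraph G T) (m + 3) s₀ =
        (linkV (⟨(x (k + 1), x (k + 2)), h₂⟩, xor γ (tau T x (k + 1))),
          linkV (conn G T (⟨(x (k + 1), x (k + 2)), h₂⟩, xor γ (tau T x (k + 1))))) ∧
      Moves (cfiGraph G T) (trailRun (cfiGraph G T) m s₀) ∧ Moves (cfiGraph G T) (trailRun (cfiGraph G T) (m + 1) s₀) ∧
      Moves (cfiGraph G T) (trailRun (cfiGraph G T) (m + 2) s₀) := by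
  set β := xor γ (tau T x k) with hβ
  set δ := xor γ (tau T x (k + 1)) with hδ
  set F : CFIVertex G := linkV (⟨(x k, x (k + 1)), h₁⟩, β) with hF
  set B : CFIVertex G := linkV (⟨(x (k + 1), x k), h₁.symm⟩, δ) with hB
  set M : CFIVertex G := midV ⟨x (k + 1), lowMid h₁.symm h₂ hne δ⟩ with hM
  set F' : CFIVertex G := linkV (⟨(x (k + 1), x (k + 2)), h₂⟩, δ) with hF'
  set B' : CFIVertex G := linkV (conn G T (⟨(x (k + 1), x (k + 2)), h₂⟩, δ)) with hB'
  have hB_eq : linkV (conn G T (⟨(x k, x (k + 1)), h₁⟩, β)) = B := by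
    rw [hB, ← conn_forward x γ k h₁]
  have hF_eq : linkV (conn G T (⟨(x (k + 1), x k), h₁.symm⟩, δ)) = F := by
    rw [hF, ← conn_backward x γ k h₁]
  have hdec : decide (x k ∈ (lowMid h₁.symm h₂ hne δ).1) = δ :=
    decide_eq_of_iff' (mem_lowMid_iff h₁.symm h₂ hne δ).1
  have hdec' : decide (x (k + 2) ∈ (lowMid h₁.symm h₂ hne δ).1) = δ :=
    decide_eq_of_iff' (mem_lowMid_iff h₁.symm h₂ hne δ).2
  have hrun0 : trailRun (cfiGraph G T) m s₀ = (F, B) := by rw [hrun, hB_eq]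
  have hex0 : exits (cfiGraph G T) (F, B) = {M} := by
    unfold exits
    dsimp only
    rw [hB, neighborFinset_linkV_of_pair hN h₁.symm h₂ hne δ, hF_eq]
    exact pair_erase_left linkV_ne_midV
  have hrun1 : trailRun (cfiGraph G T) (m + 1) s₀ = (B, M) := by
    rw [trailRun_succ, hrun0, trailStep_of_exits_eq hex0]
  have hex1 : exits (cfiGraph G T) (B, M) = {F'} := by
    unfold exits
    dsimp only
    rw [hM, neighborFinset_midV_of_pair hN h₁.symm h₂, hdec, hdec', ← hB, ← hF']
    exact pair_erase_left fun h => hne (linkV_eq_iff.mp h).2.1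
  have hrun2 : trailRun (cfiGraph G T) (m + 2) s₀ = (M, F') := by
    rw [trailRun_succ, hrun1, trailStep_of_exits_eq hex1]
  have hex2 : exits (cfiGraph G T) (M, F') = {B'} := by
    unfold exits
    dsimp only
    rw [hF', neighborFinset_linkV_of_pair' hN h₁.symm h₂ hne δ, ← hB', ← hM]
    exact pair_erase_right linkV_ne_midV
  have hrun3 : trailRun (cfiGraph G T) (m + 3) s₀ = (F', B') := by
    rw [trailRun_succ, hrun2, trailStep_of_exits_eq hex2]
  refine ⟨hrun1, hrun2, hrun3, ?_, ?_, ?_⟩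
  · rw [hrun0]; unfold Moves; rw [hex0, card_singleton]
  · rw [hrun1]; unfold Moves; rw [hex1, card_singleton]
  · rw [hrun2]; unfold Moves; rw [hex2, card_singleton]

/-- **SIMULATION.** Along a vertex sequence `x₀, x₁, …` of the base graph with edges `x_k x_{k+1}`
(`k ≤ K`) whose interior vertices `x₁, …, x_K` have exactly the two neighbours `x_{k-1} ≠ x_{k+1}`,
the walk of `CFI(G, T)` started at `((x₀, x₁, γ), (x₁, x₀, γ ⊕ t₀))` is, after `3k` steps, at
`((x_k, x_{k+1}, γ ⊕ τ_k), (x_{k+1}, x_k, γ ⊕ τ_{k+1}))`, having moved at every step.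
[cite: ChenFlumLiu2025, §8 (proof of Thm. 8.1: the gadgets of the vertices of degree `≤ 2`)] -/
theorem sim_trailRun (x : ℕ → Fin v) {K : ℕ} (hadj : ∀ k ≤ K, G.Adj (x k) (x (k + 1)))
    (hint : ∀ k, 1 ≤ k → k ≤ K → G.neighborFinset (x k) = {x (k - 1), x (k + 1)} ∧ x (k - 1) ≠ x (k + 1))
    (γ : Bool) :
    ∀ k (hk : k ≤ K),
      trailRun (cfiGraph G T) (3 * k)
          (linkV (⟨(x 0, x 1), hadj 0 (Nat.zero_le _)⟩, xor γ (tau T x 0)),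
            linkV (conn G T (⟨(x 0, x 1), hadj 0 (Nat.zero_le _)⟩, xor γ (tau T x 0)))) =
        (linkV (⟨(x k, x (k + 1)), hadj k hk⟩, xor γ (tau T x k)),
          linkV (conn G T (⟨(x k, x (k + 1)), hadj k hk⟩, xor γ (tau T x k)))) ∧
      ∀ j < 3 * k, Moves (cfiGraph G T) (trailRun (cfiGraph G T) j
          (linkV (⟨(x 0, x 1), hadj 0 (Nat.zero_le _)⟩, xor γ (tau T x 0)),
            linkV (conn G T (⟨(x 0, x 1), hadj 0 (Nat.zero_le _)⟩, xor γ (tau T x 0)))))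
  | 0, _ => ⟨rfl, fun j hj => absurd hj (Nat.not_lt_zero _)⟩
  | k + 1, hk => by
    obtain ⟨ih, ihm⟩ := sim_trailRun x hadj hint γ k (Nat.le_of_succ_le hk)
    obtain ⟨hN, hne⟩ := hint (k + 1) (Nat.succ_pos _) hk
    rw [Nat.add_sub_cancel] at hN hne
    obtain ⟨-, -, hrun3, hm0, hm1, hm2⟩ :=
      sim_local (T := T) x γ k (hadj k (Nat.le_of_succ_le hk)) (hadj (k + 1) hk) hN hne _ (3 * k) ih
    refine ⟨?_, fun j hj => ?_⟩
    · rw [show 3 * (k + 1) = 3 * k + 3 by omega, hrun3]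
    · rcases Nat.lt_or_ge j (3 * k) with hlt | hge
      · exact ihm j hlt
      · have : j = 3 * k ∨ j = 3 * k + 1 ∨ j = 3 * k + 2 := by omega
        rcases this with rfl | rfl | rfl
        · exact hm0
        · exact hm1
        · exact hm2

/-- **The walk stops at a high end**: if `x_{K+1}` has degree `≥ 3` the state after `3K` steps
does not move (its current vertex is a core link). [cite: ChenFlumLiu2025, §8] -/
theorem not_moves_of_high_end (x : ℕ → Fin v) {K : ℕ} (h : G.Adj (x K) (x (K + 1)))
    (h3 : 3 ≤ G.degree (x (K + 1))) (b : Bool) :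
    ¬ Moves (cfiGraph G T) (linkV (⟨(x K, x (K + 1)), h⟩, b), linkV (conn G T (⟨(x K, x (K + 1)), h⟩, b))) := by
  intro hm
  have hs : (cfiGraph G T).Adj (linkV (⟨(x K, x (K + 1)), h⟩, b)) (linkV (conn G T (⟨(x K, x (K + 1)), h⟩, b))) :=
    adj_linkV_conn _
  unfold Moves at hm
  have hc : (exits (cfiGraph G T) (linkV (⟨(x K, x (K + 1)), h⟩, b), linkV (conn G T (⟨(x K, x (K + 1)), h⟩, b)))).card =
      (cfiGraph G T).degree (linkV (conn G T (⟨(x K, x (K + 1)), h⟩, b))) - 1 :=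
    card_exits (s := (linkV (⟨(x K, x (K + 1)), h⟩, b), linkV (conn G T (⟨(x K, x (K + 1)), h⟩, b)))) hs
  have := three_le_degree_linkV (T := T) (x := conn G T (⟨(x K, x (K + 1)), h⟩, b)) h3
  omega

/-- **The walk stops at the `a`-link of a leaf end.** [cite: ChenFlumLiu2025, §8 (case `deg(v) = 1`)] -/
theorem not_moves_of_leaf_end_true (x : ℕ → Fin v) {K : ℕ} (h : G.Adj (x K) (x (K + 1)))
    (hN : G.neighborFinset (x (K + 1)) = {x K}) (γ : Bool) (hbit : xor γ (tau T x (K + 1)) = true) :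
    ¬ Moves (cfiGraph G T)
      (linkV (⟨(x K, x (K + 1)), h⟩, xor γ (tau T x K)), linkV (conn G T (⟨(x K, x (K + 1)), h⟩, xor γ (tau T x K)))) := by
  rw [conn_forward x γ K h, hbit]
  apply not_moves_of_no_exit
  intro w hw
  dsimp only at hw ⊢
  rw [← SimpleGraph.mem_neighborFinset, neighborFinset_linkV_true_of_singleton hN, mem_singleton] at hw
  rw [hw, ← hbit, conn_backward x γ K h]

/-- **The walk makes one more step at the `b`-link of a leaf end and stops at `m(∅)`.**
[cite: ChenFlumLiu2025, §8 (case `deg(v) = 1`)] -/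
theorem step_of_leaf_end_false (x : ℕ → Fin v) {K : ℕ} (h : G.Adj (x K) (x (K + 1)))
    (hN : G.neighborFinset (x (K + 1)) = {x K}) (γ : Bool) (hbit : xor γ (tau T x (K + 1)) = false) :
    Moves (cfiGraph G T)
        (linkV (⟨(x K, x (K + 1)), h⟩, xor γ (tau T x K)), linkV (conn G T (⟨(x K, x (K + 1)), h⟩, xor γ (tau T x K)))) ∧
      trailStep (cfiGraph G T)
          (linkV (⟨(x K, x (K + 1)), h⟩, xor γ (tau T x K)), linkV (conn G T (⟨(x K, x (K + 1)), h⟩, xor γ (tau T x K)))) =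
        (linkV (⟨(x (K + 1), x K), h.symm⟩, false), midV ⟨x (K + 1), emptyMid G (x (K + 1))⟩) ∧
      ¬ Moves (cfiGraph G T) (linkV (⟨(x (K + 1), x K), h.symm⟩, false), midV ⟨x (K + 1), emptyMid G (x (K + 1))⟩) := by
  have hex : exits (cfiGraph G T)
      (linkV (⟨(x K, x (K + 1)), h⟩, xor γ (tau T x K)), linkV (conn G T (⟨(x K, x (K + 1)), h⟩, xor γ (tau T x K)))) =
      {midV ⟨x (K + 1), emptyMid G (x (K + 1))⟩} := by
    unfold exits
    dsimp only
    rw [conn_forward x γ K h, hbit, neighborFinset_linkV_false_of_singleton hN, ← hbit, conn_backward x γ K h]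
    exact pair_erase_left linkV_ne_midV
  refine ⟨by unfold Moves; rw [hex, card_singleton], ?_, ?_⟩
  · rw [trailStep_of_exits_eq hex, conn_forward x γ K h, hbit]
  · apply not_moves_of_no_exit
    intro w hw
    dsimp only at hw ⊢
    rw [← SimpleGraph.mem_neighborFinset, neighborFinset_midV_of_singleton hN h.symm, mem_singleton] at hw
    exact hw

/-! ### §C. The walk from a link over a chain of the base graph -/

section Chain

variable {d : Fin v × Fin v}

/-- The interior of a maximal chain of the base graph satisfies the hypotheses of the simulation.
[folklore] -/
theorem chain_hint (hd : IsTrailStart G d) (k : ℕ) (hk1 : 1 ≤ k) (hk : k ≤ trailLen G d) :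
    G.neighborFinset (trailVert G d k) = {trailVert G d (k - 1), trailVert G d (k + 1)} ∧
      trailVert G d (k - 1) ≠ trailVert G d (k + 1) :=
  ⟨hd.neighborFinset_trailVert hk1 hk, (hd.trailVert_succ_ne_pred hk1 hk).symm⟩

/-- The starting state of the CFI walk over the chain of `d` with letter `γ`:
`((x₀, x₁, γ), (x₁, x₀, γ ⊕ t₀))`. [folklore] -/
def zStart (T : Set (Sym2 (Fin v))) [DecidablePred (· ∈ T)] (hd : IsTrailStart G d) (γ : Bool) :
    CFIVertex G × CFIVertex G :=
  (linkV (⟨(trailVert G d 0, trailVert G d 1), hd.adj_trailVert (Nat.zero_le _)⟩, xor γ (tau T (trailVert G d) 0)),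
    linkV (conn G T (⟨(trailVert G d 0, trailVert G d 1), hd.adj_trailVert (Nat.zero_le _)⟩, xor γ (tau T (trailVert G d) 0))))

/-- The starting state, spelled with `d`. [folklore] -/
theorem zStart_eq (hd : IsTrailStart G d) (γ : Bool) :
    zStart T hd γ = (linkV (⟨(d.1, d.2), hd.adj⟩, γ), linkV (conn G T (⟨(d.1, d.2), hd.adj⟩, γ))) := by
  unfold zStart
  simp only [tau_zero, Bool.xor_false]
  rfl

/-- **The CFI walk over a chain, after `3k` steps.** [cite: ChenFlumLiu2025, §8] -/
theorem trailRun_zStart (hd : IsTrailStart G d) (γ : Bool) {k : ℕ} (hk : k ≤ trailLen G d) :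
    trailRun (cfiGraph G T) (3 * k) (zStart T hd γ) =
        (linkV (⟨(trailVert G d k, trailVert G d (k + 1)), hd.adj_trailVert hk⟩, xor γ (tau T (trailVert G d) k)),
          linkV (conn G T (⟨(trailVert G d k, trailVert G d (k + 1)), hd.adj_trailVert hk⟩,
            xor γ (tau T (trailVert G d) k)))) ∧
      ∀ j < 3 * k, Moves (cfiGraph G T) (trailRun (cfiGraph G T) j (zStart T hd γ)) :=
  sim_trailRun (trailVert G d) (fun _ hk => hd.adj_trailVert hk) (chain_hint hd) γ k hk

/-- **Length and end at a HIGH end of the chain**: `3L` steps, ending at the core link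
`(x_{L+1}, x_L, γ ⊕ τ_{L+1})`. [cite: ChenFlumLiu2025, §8] -/
theorem trailLen_zStart_of_high (hd : IsTrailStart G d) (γ : Bool) (hst : IsTrailStart (cfiGraph G T) (zStart T hd γ))
    (h3 : 3 ≤ G.degree (trailVert G d (trailLen G d + 1))) :
    trailLen (cfiGraph G T) (zStart T hd γ) = 3 * trailLen G d ∧
      trailEnd (cfiGraph G T) (zStart T hd γ) =
        linkV (⟨(trailVert G d (trailLen G d + 1), trailVert G d (trailLen G d)), (hd.adj_trailVert le_rfl).symm⟩,
          xor γ (tau T (trailVert G d) (trailLen G d + 1))) := by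
  obtain ⟨hrun, hmov⟩ := trailRun_zStart (T := T) hd γ (le_refl (trailLen G d))
  have hstop : ¬ Moves (cfiGraph G T) (trailRun (cfiGraph G T) (3 * trailLen G d) (zStart T hd γ)) := by
    rw [hrun]
    exact not_moves_of_high_end (trailVert G d) (hd.adj_trailVert le_rfl) h3 _
  refine ⟨hst.trailLen_eq_of_stop hmov hstop, ?_⟩
  rw [hst.trailEnd_eq_of_stop hmov hstop, hrun]
  show linkV (conn G T _) = _
  rw [conn_forward (trailVert G d) γ (trailLen G d) (hd.adj_trailVert le_rfl)]

/-- **Length and end at a LEAF end with final bit `true`**: `3L` steps, ending at the `a`-link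
of the leaf gadget. [cite: ChenFlumLiu2025, §8 (case `deg(v) = 1`)] -/
theorem trailLen_zStart_of_leaf_true (hd : IsTrailStart G d) (γ : Bool) (hst : IsTrailStart (cfiGraph G T) (zStart T hd γ))
    (h1 : G.degree (trailVert G d (trailLen G d + 1)) = 1)
    (hbit : xor γ (tau T (trailVert G d) (trailLen G d + 1)) = true) :
    trailLen (cfiGraph G T) (zStart T hd γ) = 3 * trailLen G d ∧
      trailEnd (cfiGraph G T) (zStart T hd γ) =
        linkV (⟨(trailVert G d (trailLen G d + 1), trailVert G d (trailLen G d)), (hd.adj_trailVert le_rfl).symm⟩, true) := by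
  obtain ⟨hrun, hmov⟩ := trailRun_zStart (T := T) hd γ (le_refl (trailLen G d))
  have hN := neighborFinset_eq_singleton_of_degree h1 (hd.adj_trailVert le_rfl).symm
  have hstop : ¬ Moves (cfiGraph G T) (trailRun (cfiGraph G T) (3 * trailLen G d) (zStart T hd γ)) := by
    rw [hrun]
    exact not_moves_of_leaf_end_true (trailVert G d) (hd.adj_trailVert le_rfl) hN γ hbit
  refine ⟨hst.trailLen_eq_of_stop hmov hstop, ?_⟩
  rw [hst.trailEnd_eq_of_stop hmov hstop, hrun]
  show linkV (conn G T _) = _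
  rw [conn_forward (trailVert G d) γ (trailLen G d) (hd.adj_trailVert le_rfl), hbit]

/-- **Length and end at a LEAF end with final bit `false`**: `3L + 1` steps, ending at `m(∅)` of
the leaf gadget. [cite: ChenFlumLiu2025, §8 (case `deg(v) = 1`)] -/
theorem trailLen_zStart_of_leaf_false (hd : IsTrailStart G d) (γ : Bool) (hst : IsTrailStart (cfiGraph G T) (zStart T hd γ))
    (h1 : G.degree (trailVert G d (trailLen G d + 1)) = 1)
    (hbit : xor γ (tau T (trailVert G d) (trailLen G d + 1)) = false) :
    trailLen (cfiGraph G T) (zStart T hd γ) = 3 * trailLen G d + 1 ∧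
      trailEnd (cfiGraph G T) (zStart T hd γ) =
        midV ⟨trailVert G d (trailLen G d + 1), emptyMid G (trailVert G d (trailLen G d + 1))⟩ := by
  obtain ⟨hrun, hmov⟩ := trailRun_zStart (T := T) hd γ (le_refl (trailLen G d))
  have hN := neighborFinset_eq_singleton_of_degree h1 (hd.adj_trailVert le_rfl).symm
  obtain ⟨hm, hstep, hstop⟩ := step_of_leaf_end_false (T := T) (trailVert G d) (hd.adj_trailVert le_rfl) hN γ hbit
  have hrun1 : trailRun (cfiGraph G T) (3 * trailLen G d + 1) (zStart T hd γ) =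
      (linkV (⟨(trailVert G d (trailLen G d + 1), trailVert G d (trailLen G d)), (hd.adj_trailVert le_rfl).symm⟩, false),
        midV ⟨trailVert G d (trailLen G d + 1), emptyMid G (trailVert G d (trailLen G d + 1))⟩) := by
    rw [trailRun_succ, hrun, hstep]
  have hmov' : ∀ j < 3 * trailLen G d + 1, Moves (cfiGraph G T) (trailRun (cfiGraph G T) j (zStart T hd γ)) := by
    intro j hj
    rcases Nat.lt_or_ge j (3 * trailLen G d) with hlt | hge
    · exact hmov j hlt
    · rw [show j = 3 * trailLen G d by omega, hrun]
      exact hm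
  have hstop' : ¬ Moves (cfiGraph G T) (trailRun (cfiGraph G T) (3 * trailLen G d + 1) (zStart T hd γ)) := by
    rw [hrun1]; exact hstop
  refine ⟨hst.trailLen_eq_of_stop hmov' hstop', ?_⟩
  rw [hst.trailEnd_eq_of_stop hmov' hstop', hrun1]

/-- The end vertex of a maximal chain has degree `≥ 3` or is a leaf. [folklore] -/
theorem high_or_leaf_end (hd : IsTrailStart G d) :
    3 ≤ G.degree (trailVert G d (trailLen G d + 1)) ∨ G.degree (trailVert G d (trailLen G d + 1)) = 1 := by
  have hne := hd.degree_trailVert_succ_trailLen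
  have hpos : 0 < G.degree (trailVert G d (trailLen G d + 1)) :=
    (G.degree_pos_iff_exists_adj _).mpr ⟨_, (hd.adj_trailVert le_rfl).symm⟩
  omega

end Chain

/-! ### §C'. Bad core links in terms of the chain of their dart -/

section CoreLink

variable {ρ : CFIVertex G → CFIVertex G}

/-- The dart of a core link is a start of the base graph. [folklore] -/
theorem isTrailStart_of_high {u w : Fin v} (hw : G.Adj u w) (h3 : 3 ≤ G.degree u) :
    IsTrailStart G (u, w) := ⟨hw, fun h2 => by have h2' : G.degree u = 2 := h2; omega⟩

/-- The walk of a core link starts at `zStart`. [folklore] -/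
theorem linkStart_eq_zStart {u w : Fin v} (hw : G.Adj u w) (h3 : 3 ≤ G.degree u) (γ : Bool) :
    linkStart (cfiGraph G T) (linkV (⟨(u, w), hw⟩, γ)) = zStart T (isTrailStart_of_high hw h3) γ := by
  rw [linkStart_linkV (x := (⟨(u, w), hw⟩, γ)) h3, zStart_eq]

/-- The CFI walk from a core link is a start of the CFI graph. [folklore] -/
theorem isTrailStart_zStart_of_high {u w : Fin v} (hw : G.Adj u w) (h3 : 3 ≤ G.degree u) (γ : Bool) :
    IsTrailStart (cfiGraph G T) (zStart T (isTrailStart_of_high hw h3) γ) := by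
  rw [zStart_eq]
  refine ⟨adj_linkV_conn _, ?_⟩
  have := three_le_degree_linkV (T := T) (x := (⟨(u, w), hw⟩, γ)) h3
  dsimp only
  omega

/-- The final bit decides between the two dead ends of a leaf gadget: `xor` as `≠`. [folklore] -/
theorem xor_eq_true_iff' (a b : Bool) : xor a b = true ↔ a ≠ b := by
  cases a <;> cases b <;> simp

/-- **A core link of corridor type is bad iff `τ ⊕ σ(d) ⊕ σ(d') = 1`**, where `d = (u, w)` is
its dart, the end `x_{L+1}` of the chain of `d` is high, `d' = (x_{L+1}, x_L)`, `τ` is the twist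
parity of the chain and `σ` records membership of the second vertex in the representative set of
the first. [cite: ChenFlumLiu2025, §8 (proof of Thm. 8.1)] -/
theorem corrBad_linkV_iff (hρ : IsRepMap (cfiGraph G T) ρ) {u w : Fin v} (hw : G.Adj u w) (h3 : 3 ≤ G.degree u)
    (γ : Bool) :
    CorrBad (cfiGraph G T) ρ (linkV (⟨(u, w), hw⟩, γ)) ↔
      3 ≤ G.degree (trailVert G (u, w) (trailLen G (u, w) + 1)) ∧
        xor (tau T (trailVert G (u, w)) (trailLen G (u, w) + 1))
          (xor (decide (w ∈ (repSet ρ u).1))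
            (decide (trailVert G (u, w) (trailLen G (u, w)) ∈
              (repSet ρ (trailVert G (u, w) (trailLen G (u, w) + 1))).1))) = true := by
  have hd := isTrailStart_of_high hw h3
  have hst := isTrailStart_zStart_of_high (T := T) hw h3 γ
  unfold CorrBad
  rw [linkStart_eq_zStart hw h3 γ, adj_rep_iff hρ hw γ h3]
  rcases high_or_leaf_end hd with hhigh | hleaf
  · obtain ⟨-, hend⟩ := trailLen_zStart_of_high (T := T) hd γ hst hhigh
    rw [hend, isCore_iff, base_linkV, adj_rep_iff hρ _ _ hhigh]
    simp only [hhigh, true_and]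
    generalize tau T (trailVert G (u, w)) (trailLen G (u, w) + 1) = t
    by_cases hσ₁ : w ∈ (repSet ρ u).1 <;>
      by_cases hσ₂ : trailVert G (u, w) (trailLen G (u, w)) ∈ (repSet ρ (trailVert G (u, w) (trailLen G (u, w) + 1))).1 <;>
        cases γ <;> cases t <;> simp [hσ₁, hσ₂]
  · -- leaf end: the end is not a core vertex
    have hnot : ¬ 3 ≤ G.degree (trailVert G (u, w) (trailLen G (u, w) + 1)) := by omega
    have hncE : ¬ IsCore (cfiGraph G T) (trailEnd (cfiGraph G T) (zStart T hd γ)) := by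
      intro hc
      rw [isCore_iff] at hc
      rcases Bool.eq_false_or_eq_true (xor γ (tau T (trailVert G (u, w)) (trailLen G (u, w) + 1))) with hb | hb
      · rw [(trailLen_zStart_of_leaf_true (T := T) hd γ hst hleaf hb).2, base_linkV] at hc
        exact hnot hc
      · rw [(trailLen_zStart_of_leaf_false (T := T) hd γ hst hleaf hb).2, base_midV] at hc
        exact hnot hc
    simp only [hncE, false_and, hnot]

/-- **A core link of pendant type is bad iff `τ ⊕ σ(d) = 1`** (the end of the chain of its dart
is a leaf). [cite: ChenFlumLiu2025, §8 (proof of Thm. 8.1, case `deg(v) = 1`)] -/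
theorem pendBad_linkV_iff (hρ : IsRepMap (cfiGraph G T) ρ) {u w : Fin v} (hw : G.Adj u w) (h3 : 3 ≤ G.degree u)
    (γ : Bool) :
    PendBad (cfiGraph G T) ρ (linkV (⟨(u, w), hw⟩, γ)) ↔
      ¬ 3 ≤ G.degree (trailVert G (u, w) (trailLen G (u, w) + 1)) ∧
        xor (tau T (trailVert G (u, w)) (trailLen G (u, w) + 1)) (decide (w ∈ (repSet ρ u).1)) = true := by
  have hd := isTrailStart_of_high hw h3
  have hst := isTrailStart_zStart_of_high (T := T) hw h3 γ
  unfold PendBad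
  rw [linkStart_eq_zStart hw h3 γ, adj_rep_iff hρ hw γ h3]
  rcases high_or_leaf_end hd with hhigh | hleaf
  · obtain ⟨-, hend⟩ := trailLen_zStart_of_high (T := T) hd γ hst hhigh
    have hc : IsCore (cfiGraph G T) (trailEnd (cfiGraph G T) (zStart T hd γ)) := by
      rw [hend, isCore_iff]; exact hhigh
    simp [hc, hhigh]
  · have hnot : ¬ 3 ≤ G.degree (trailVert G (u, w) (trailLen G (u, w) + 1)) := by omega
    rcases Bool.eq_false_or_eq_true (xor γ (tau T (trailVert G (u, w)) (trailLen G (u, w) + 1))) with hb | hb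
    · obtain ⟨hlen, hend⟩ := trailLen_zStart_of_leaf_true (T := T) hd γ hst hleaf hb
      have hncE : ¬ IsCore (cfiGraph G T) (trailEnd (cfiGraph G T) (zStart T hd γ)) := by
        intro hc
        rw [isCore_iff, hend, base_linkV] at hc
        exact hnot hc
      have hmod : trailLen (cfiGraph G T) (zStart T hd γ) % 3 = 0 := by rw [hlen]; omega
      simp only [hncE, not_false_eq_true, true_and, hnot, hmod]
      revert hb
      generalize tau T (trailVert G (u, w)) (trailLen G (u, w) + 1) = t
      by_cases hσ : w ∈ (repSet ρ u).1 <;> cases γ <;> cases t <;> simp [hσ]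
    · obtain ⟨hlen, hend⟩ := trailLen_zStart_of_leaf_false (T := T) hd γ hst hleaf hb
      have hncE : ¬ IsCore (cfiGraph G T) (trailEnd (cfiGraph G T) (zStart T hd γ)) := by
        intro hc
        rw [isCore_iff, hend, base_midV] at hc
        exact hnot hc
      have hmod : trailLen (cfiGraph G T) (zStart T hd γ) % 3 = 1 := by rw [hlen]; omega
      simp only [hncE, not_false_eq_true, true_and, hnot, hmod]
      revert hb
      generalize tau T (trailVert G (u, w)) (trailLen G (u, w) + 1) = t
      by_cases hσ : w ∈ (repSet ρ u).1 <;> cases γ <;> cases t <;> simp [hσ]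

end CoreLink

/-! ### §D. Accounting over the high darts of the base graph -/

section Accounting

variable (G) in
/-- The HIGH DARTS: ordered adjacent pairs `(u, w)` with `deg u ≥ 3` (positions of the core links).
[cite: ChenFlumLiu2025, §8] -/
def highDarts : Finset (CFIDart G) := univ.filter fun p => 3 ≤ G.degree p.1.1

omit [DecidablePred (· ∈ T)] in
/-- Membership in `highDarts`. [folklore] -/
theorem mem_highDarts {p : CFIDart G} : p ∈ highDarts G ↔ 3 ≤ G.degree p.1.1 := by
  simp only [highDarts, mem_filter, mem_univ, true_and]

omit [DecidablePred (· ∈ T)] in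
/-- A high dart is a start of the base graph. [folklore] -/
theorem isTrailStart_of_mem_highDarts {p : CFIDart G} (hp : p ∈ highDarts G) : IsTrailStart G p.1 :=
  isTrailStart_of_high p.2 (mem_highDarts.mp hp)

/-- The end vertex `x_{L+1}` of the chain of a dart. [folklore] -/
def chainEnd (p : CFIDart G) : Fin v := trailVert G p.1 (trailLen G p.1 + 1)

variable (T) in
/-- The twist parity `τ(d)` of the chain of a dart. [folklore] -/
def tauD (p : CFIDart G) : Bool := tau T (trailVert G p.1) (trailLen G p.1 + 1)

/-- The representative bit `σ(d) = [w ∈ S_u]` of the dart `d = (u, w)`. [folklore] -/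
def sigD (ρ : CFIVertex G → CFIVertex G) (p : CFIDart G) : Bool := decide (p.1.2 ∈ (repSet ρ p.1.1).1)

/-- The REVERSED dart `(x_{L+1}, x_L)` of the chain of a dart (the dart itself if that pair is not
adjacent, which does not happen for starts). [folklore] -/
def revD (p : CFIDart G) : CFIDart G :=
  if h : G.Adj (trailRev G p.1).1 (trailRev G p.1).2 then ⟨trailRev G p.1, h⟩ else p

omit [DecidablePred (· ∈ T)] in
/-- The reversed dart of a high dart is the reversed start. [folklore] -/
theorem revD_val {p : CFIDart G} (hp : p ∈ highDarts G) : (revD p).1 = trailRev G p.1 := by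
  unfold revD
  rw [dif_pos (isTrailStart_of_mem_highDarts hp).rev.adj]

/-- A high dart is BAD OF CORRIDOR TYPE: its chain ends high and `τ ⊕ σ(d) ⊕ σ(d') = 1`.
[cite: ChenFlumLiu2025, §8] -/
def CorrBadD (ρ : CFIVertex G → CFIVertex G) (p : CFIDart G) : Prop :=
  3 ≤ G.degree (chainEnd p) ∧ xor (tauD T p) (xor (sigD ρ p) (sigD ρ (revD p))) = true

/-- A high dart is BAD OF PENDANT TYPE: its chain ends at a leaf and `τ ⊕ σ(d) = 1`.
[cite: ChenFlumLiu2025, §8] -/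
def PendBadD (ρ : CFIVertex G → CFIVertex G) (p : CFIDart G) : Prop :=
  ¬ 3 ≤ G.degree (chainEnd p) ∧ xor (tauD T p) (sigD ρ p) = true

/-- `CorrBadD` is decidable. [folklore] -/
instance (ρ : CFIVertex G → CFIVertex G) (p : CFIDart G) : Decidable (CorrBadD (T := T) ρ p) := by
  unfold CorrBadD; infer_instance

/-- `PendBadD` is decidable. [folklore] -/
instance (ρ : CFIVertex G → CFIVertex G) (p : CFIDart G) : Decidable (PendBadD (T := T) ρ p) := by
  unfold PendBadD; infer_instance

variable {ρ : CFIVertex G → CFIVertex G}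

/-- `CorrBad` of a core link is `CorrBadD` of its dart. [folklore] -/
theorem corrBad_iff_corrBadD (hρ : IsRepMap (cfiGraph G T) ρ) {p : CFIDart G} (hp : p ∈ highDarts G) (γ : Bool) :
    CorrBad (cfiGraph G T) ρ (linkV (p, γ)) ↔ CorrBadD (T := T) ρ p := by
  have h := corrBad_linkV_iff (T := T) hρ p.2 (mem_highDarts.mp hp) γ
  unfold CorrBadD chainEnd tauD sigD
  rw [revD_val hp]
  exact h

/-- `PendBad` of a core link is `PendBadD` of its dart. [folklore] -/
theorem pendBad_iff_pendBadD (hρ : IsRepMap (cfiGraph G T) ρ) {p : CFIDart G} (hp : p ∈ highDarts G) (γ : Bool) :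
    PendBad (cfiGraph G T) ρ (linkV (p, γ)) ↔ PendBadD (T := T) ρ p :=
  pendBad_linkV_iff (T := T) hρ p.2 (mem_highDarts.mp hp) γ

/-- **The core links are the links over the high darts** (two per dart). [cite: ChenFlumLiu2025, §8] -/
theorem coreLinks_eq :
    coreLinks (cfiGraph G T) =
      (highDarts G ×ˢ (univ : Finset Bool)).map ⟨fun q => linkV (q.1, q.2), fun _ _ h => Prod.ext_iff.mpr
        ⟨congrArg Prod.fst (linkV_inj.mp h), congrArg Prod.snd (linkV_inj.mp h)⟩⟩ := by
  ext y
  rw [mem_coreLinks_iff, mem_map]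
  constructor
  · rintro ⟨⟨p, c⟩, rfl, h3⟩
    exact ⟨(p, c), mem_product.mpr ⟨mem_highDarts.mpr h3, mem_univ _⟩, rfl⟩
  · rintro ⟨⟨p, c⟩, hq, rfl⟩
    rw [mem_product] at hq
    exact ⟨(p, c), rfl, mem_highDarts.mp hq.1⟩

/-- **`nCorr = 2 · #{bad corridor darts}`.** [folklore] -/
theorem nCorr_eq (hρ : IsRepMap (cfiGraph G T) ρ) :
    nCorr (cfiGraph G T) ρ = 2 * ((highDarts G).filter (CorrBadD (T := T) ρ)).card := by
  unfold nCorr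
  rw [coreLinks_eq, filter_map, card_map,
    Finset.filter_congr (q := fun q => CorrBadD (T := T) ρ q.1) (fun q hq => by
      rw [mem_product] at hq
      exact corrBad_iff_corrBadD hρ hq.1 q.2),
    filter_product_left, card_product, card_univ, Fintype.card_bool, mul_comm]

/-- **`nPend = 2 · #{bad pendant darts}`.** [folklore] -/
theorem nPend_eq (hρ : IsRepMap (cfiGraph G T) ρ) :
    nPend (cfiGraph G T) ρ = 2 * ((highDarts G).filter (PendBadD (T := T) ρ)).card := by
  unfold nPend
  rw [coreLinks_eq, filter_map, card_map,
    Finset.filter_congr (q := fun q => PendBadD (T := T) ρ q.1) (fun q hq => by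
      rw [mem_product] at hq
      exact pendBad_iff_pendBadD hρ hq.1 q.2),
    filter_product_left, card_product, card_univ, Fintype.card_bool, mul_comm]

/-! #### The reversal on the darts of corridor type -/

section Rev

variable {p : CFIDart G}

omit [DecidablePred (· ∈ T)] in
/-- The reversed dart of a corridor dart is high. [folklore] -/
theorem revD_mem_highDarts (hp : p ∈ highDarts G) (hh : 3 ≤ G.degree (chainEnd p)) : revD p ∈ highDarts G := by
  rw [mem_highDarts, revD_val hp]
  exact hh

omit [DecidablePred (· ∈ T)] in
/-- The chain of the reversed dart ends at the start. [folklore] -/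
theorem chainEnd_revD (hp : p ∈ highDarts G) : chainEnd (revD p) = p.1.1 := by
  have hd := isTrailStart_of_mem_highDarts hp
  unfold chainEnd
  rw [revD_val hp, hd.trailLen_rev, hd.trailVert_rev le_rfl, Nat.sub_self]
  rfl

omit [DecidablePred (· ∈ T)] in
/-- Hence it ends high. [folklore] -/
theorem three_le_degree_chainEnd_revD (hp : p ∈ highDarts G) : 3 ≤ G.degree (chainEnd (revD p)) := by
  rw [chainEnd_revD hp]
  exact mem_highDarts.mp hp

omit [DecidablePred (· ∈ T)] in
/-- The reversal is an involution on corridor darts. [folklore] -/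
theorem revD_revD (hp : p ∈ highDarts G) (hh : 3 ≤ G.degree (chainEnd p)) : revD (revD p) = p := by
  apply Subtype.ext
  rw [revD_val (revD_mem_highDarts hp hh), revD_val hp, (isTrailStart_of_mem_highDarts hp).trailRev_rev]

omit [DecidablePred (· ∈ T)] in
/-- The reversal has no fixed point on high darts. [folklore] -/
theorem revD_ne (hp : p ∈ highDarts G) : revD p ≠ p := fun h =>
  (isTrailStart_of_mem_highDarts hp).trailRev_ne (by rw [← revD_val hp, h])

/-- The twist bit counts the twisted edges among the first `k` edges. [folklore] -/
theorem tau_eq_decide (x : ℕ → Fin v) (k : ℕ) :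
    tau T x k = decide (Odd ((range k).filter fun i => s(x i, x (i + 1)) ∈ T).card) := by
  induction k with
  | zero => simp
  | succ k ih =>
    rw [tau_succ, ih, range_add_one, filter_insert]
    unfold twist
    by_cases ht : s(x k, x (k + 1)) ∈ T
    · rw [if_pos ht, card_insert_of_notMem (fun h => by simp at h), decide_eq_true ht]
      rcases Nat.even_or_odd ((range k).filter fun i => s(x i, x (i + 1)) ∈ T).card with he | ho
      · rw [decide_eq_false (Nat.not_odd_iff_even.mpr he), decide_eq_true he.add_one]
        rfl
      · rw [decide_eq_true ho, decide_eq_false (Nat.odd_add_one.not.mpr (not_not.mpr ho))]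
        rfl
    · rw [if_neg ht, decide_eq_false ht, Bool.xor_false]

omit [DecidablePred (· ∈ T)] in
/-- The edges of a maximal chain are pairwise distinct. [folklore] -/
theorem _root_.Literature.Combinatorics.SimpleGraph.IsTrailStart.edge_injOn {d : Fin v × Fin v}
    (hd : IsTrailStart G d) :
    Set.InjOn (fun i => s(trailVert G d i, trailVert G d (i + 1))) ↑(range (trailLen G d + 1)) := by
  have key : ∀ i j, i ≤ trailLen G d → j ≤ trailLen G d →
      s(trailVert G d i, trailVert G d (i + 1)) = s(trailVert G d j, trailVert G d (j + 1)) → i < j → False := by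
    intro i j hi hj heq hlt
    rcases Sym2.eq_iff.mp heq with ⟨-, h2⟩ | ⟨h1, h2⟩
    · have := hd.trailVert_injOn ⟨by omega, by omega⟩ ⟨by omega, by omega⟩ h2
      omega
    · have hij : i + 1 = j := hd.trailVert_injOn ⟨by omega, by omega⟩ ⟨by omega, by omega⟩ h2
      subst hij
      have := hd.trailVert_succ_ne_pred (k := i + 1) (by omega) (by omega)
      rw [Nat.add_sub_cancel] at this
      exact this h1.symm
  intro i hi j hj heq
  simp only [coe_range, Set.mem_Iio, Nat.lt_succ_iff] at hi hj
  by_contra hne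
  rcases Nat.lt_or_gt_of_ne hne with hlt | hgt
  · exact key i j hi hj heq hlt
  · exact key j i hj hi heq.symm hgt

/-- The twisted edges of a chain, counted by index or by edge. [folklore] -/
theorem card_filter_trailEdges {d : Fin v × Fin v} (hd : IsTrailStart G d) :
    ((trailEdges G d).filter (· ∈ T)).card =
      ((range (trailLen G d + 1)).filter fun i => s(trailVert G d i, trailVert G d (i + 1)) ∈ T).card := by
  unfold trailEdges
  rw [filter_image, card_image_of_injOn]
  exact hd.edge_injOn.mono (coe_subset.mpr (filter_subset _ _))

/-- **The twist parity of a high dart is the parity of the number of twisted edges on its chain.**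
[cite: ChenFlumLiu2025, §8 (counting the twisted edges)] -/
theorem tauD_eq {p : CFIDart G} (hp : p ∈ highDarts G) :
    tauD T p = decide (Odd ((trailEdges G p.1).filter (· ∈ T)).card) := by
  unfold tauD
  rw [tau_eq_decide, card_filter_trailEdges (isTrailStart_of_mem_highDarts hp)]

/-- The reversed dart has the same twist parity. [folklore] -/
theorem tauD_revD (hp : p ∈ highDarts G) (hh : 3 ≤ G.degree (chainEnd p)) : tauD T (revD p) = tauD T p := by
  rw [tauD_eq hp, tauD_eq (revD_mem_highDarts hp hh), revD_val hp, (isTrailStart_of_mem_highDarts hp).trailEdges_rev]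

/-- Badness of corridor type is invariant under reversal. [folklore] -/
theorem corrBadD_revD (hp : p ∈ highDarts G) (hh : 3 ≤ G.degree (chainEnd p)) :
    CorrBadD (T := T) ρ (revD p) ↔ CorrBadD (T := T) ρ p := by
  unfold CorrBadD
  rw [revD_revD hp hh, tauD_revD hp hh]
  simp only [three_le_degree_chainEnd_revD hp, hh, true_and]
  cases tauD T p <;> cases sigD ρ p <;> cases sigD ρ (revD p) <;> decide

end Rev

/-! #### An injective numbering of the darts (to halve the corridor count) -/

variable (G) in
/-- A numbering of the darts. [folklore] -/
def dartOrd (p : CFIDart G) : ℕ := p.1.1.val * v + p.1.2.val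

omit [DecidableRel G.Adj] [DecidablePred (· ∈ T)] in
/-- The numbering is injective. [folklore] -/
theorem dartOrd_injective : Function.Injective (dartOrd G) := by
  rintro ⟨⟨a, b⟩, h⟩ ⟨⟨a', b'⟩, h'⟩ heq
  have heq' : a.val * v + b.val = a'.val * v + b'.val := heq
  have hb := b.isLt
  have hb' := b'.isLt
  have hv : 0 < v := by omega
  have h2 : b.val = b'.val := by
    have h : (a.val * v + b.val) % v = (a'.val * v + b'.val) % v := congrArg (· % v) heq'
    rwa [Nat.mul_comm a.val, Nat.mul_comm a'.val, Nat.mul_add_mod, Nat.mul_add_mod, Nat.mod_eq_of_lt hb,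
      Nat.mod_eq_of_lt hb'] at h
  have h1 : a.val = a'.val := by
    rw [h2] at heq'
    exact Nat.eq_of_mul_eq_mul_right hv (by omega)
  exact Subtype.ext (Prod.ext (Fin.ext h1) (Fin.ext h2))

/-- The CORRIDOR darts: high darts whose chain ends high. [folklore] -/
def corrDarts : Finset (CFIDart G) := (highDarts G).filter fun p => 3 ≤ G.degree (chainEnd p)

/-- The PENDANT darts: high darts whose chain ends at a leaf. [folklore] -/
def pendDarts : Finset (CFIDart G) := (highDarts G).filter fun p => ¬ 3 ≤ G.degree (chainEnd p)

/-- The corridor darts numbered before their reversal (one per corridor). [folklore] -/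
def corrSel : Finset (CFIDart G) := (corrDarts (G := G)).filter fun p => dartOrd G p < dartOrd G (revD p)

/-- The corridor darts numbered after their reversal. [folklore] -/
def corrUnsel : Finset (CFIDart G) := (corrDarts (G := G)).filter fun p => ¬ dartOrd G p < dartOrd G (revD p)

/-- The SELECTED darts: one dart per corridor, and all pendant darts. [folklore] -/
def selDarts : Finset (CFIDart G) := corrSel (G := G) ∪ pendDarts (G := G)

variable (T) in
/-- The corridor bit `τ ⊕ σ(d) ⊕ σ(d')`. [folklore] -/
def xbit (ρ : CFIVertex G → CFIVertex G) (p : CFIDart G) : Bool :=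
  xor (tauD T p) (xor (sigD ρ p) (sigD ρ (revD p)))

variable (T) in
/-- The pendant bit `τ ⊕ σ(d)`. [folklore] -/
def ybit (ρ : CFIVertex G → CFIVertex G) (p : CFIDart G) : Bool := xor (tauD T p) (sigD ρ p)

/-! #### The parity identity -/

/-- Booleans as elements of `ZMod 2` (the same one-liner as `Literature.Computability.Complexity.Stockmeyer.bz`
in `StockmeyerEstimator.lean`, repeated here to avoid that import). [folklore] -/
def bz (b : Bool) : ZMod 2 := if b then 1 else 0

omit [DecidableRel G.Adj] [DecidablePred (· ∈ T)] in
/-- `bz` is additive for `xor` (as `Literature.Computability.Complexity.Stockmeyer.bz_xor`). [folklore] -/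
theorem bz_xor (a b : Bool) : bz (xor a b) = bz a + bz b := by
  cases a <;> cases b <;> decide

omit [DecidableRel G.Adj] [DecidablePred (· ∈ T)] in
/-- Counting the `true` values modulo two. [folklore] -/
theorem natCast_card_filter_eq_true {α : Type*} (s : Finset α) (f : α → Bool) :
    (((s.filter fun x => f x = true).card : ℕ) : ZMod 2) = ∑ x ∈ s, bz (f x) := by
  rw [natCast_card_filter]
  refine sum_congr rfl fun x _ => ?_
  unfold bz
  cases f x <;> simp

/-- **`Σ_{high darts} σ ≡ 0 (mod 2)`**: each representative set `S_u ⊆ N(u)` is even.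
[cite: CaiFurerImmerman1992, §6 (the middle vertices are the even subsets)] -/
theorem sum_sigD_eq_zero (ρ : CFIVertex G → CFIVertex G) : ∑ p ∈ highDarts G, bz (sigD ρ p) = 0 := by
  -- group the darts by their first vertex
  rw [← sum_fiberwise_of_maps_to (g := fun p : CFIDart G => p.1.1) (t := univ) (fun _ _ => mem_univ _)]
  refine sum_eq_zero fun u _ => ?_
  by_cases hu : 3 ≤ G.degree u
  · -- the fibre over `u` is `N(u)` and `Σ_{w ∈ N(u)} [w ∈ S_u] = |S_u| ≡ 0`
    have hfib : ((highDarts G).filter fun p : CFIDart G => p.1.1 = u) =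
        (G.neighborFinset u).attach.map ⟨fun w => (⟨(u, w.1), (G.mem_neighborFinset u w.1).mp w.2⟩ : CFIDart G),
          fun a b h => Subtype.ext (congrArg (fun q : CFIDart G => q.1.2) h)⟩ := by
      ext q
      simp only [mem_filter, mem_highDarts, mem_map, mem_attach, true_and, Function.Embedding.coeFn_mk,
        Subtype.exists]
      constructor
      · rintro ⟨-, rfl⟩
        exact ⟨q.1.2, (G.mem_neighborFinset _ _).mpr q.2, Subtype.ext rfl⟩
      · rintro ⟨w, hw, rfl⟩
        exact ⟨hu, rfl⟩
    rw [hfib, sum_map]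
    simp only [Function.Embedding.coeFn_mk, sigD]
    rw [sum_attach (G.neighborFinset u) (fun w => bz (decide (w ∈ (repSet ρ u).1)))]
    have : ∑ w ∈ G.neighborFinset u, bz (decide (w ∈ (repSet ρ u).1)) =
        ∑ w ∈ G.neighborFinset u, if w ∈ (repSet ρ u).1 then (1 : ZMod 2) else 0 := by
      refine sum_congr rfl fun w _ => ?_
      unfold bz
      by_cases h : w ∈ (repSet ρ u).1 <;> simp [h]
    rw [this, ← natCast_card_filter, filter_mem_eq_inter, inter_eq_right.mpr (repSet ρ u).2.1,
      ZMod.natCast_eq_zero_iff_even]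
    exact (repSet ρ u).2.2
  · -- no high dart starts at `u`
    refine sum_eq_zero fun q hq => ?_
    rw [mem_filter, mem_highDarts] at hq
    exact absurd (hq.2 ▸ hq.1) hu


/-! #### The parity identity -/

section Parity

variable {ρ : CFIVertex G → CFIVertex G} {p : CFIDart G}

omit [DecidablePred (· ∈ T)] in
/-- Membership in `corrDarts`. [folklore] -/
theorem mem_corrDarts : p ∈ corrDarts (G := G) ↔ p ∈ highDarts G ∧ 3 ≤ G.degree (chainEnd p) := by
  rw [corrDarts, mem_filter]

omit [DecidablePred (· ∈ T)] in
/-- Membership in `pendDarts`. [folklore] -/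
theorem mem_pendDarts : p ∈ pendDarts (G := G) ↔ p ∈ highDarts G ∧ ¬ 3 ≤ G.degree (chainEnd p) := by
  rw [pendDarts, mem_filter]

omit [DecidablePred (· ∈ T)] in
/-- Membership in `corrSel`. [folklore] -/
theorem mem_corrSel : p ∈ corrSel (G := G) ↔ p ∈ corrDarts (G := G) ∧ dartOrd G p < dartOrd G (revD p) := by
  rw [corrSel, mem_filter]

omit [DecidablePred (· ∈ T)] in
/-- Membership in `corrUnsel`. [folklore] -/
theorem mem_corrUnsel : p ∈ corrUnsel (G := G) ↔ p ∈ corrDarts (G := G) ∧ ¬ dartOrd G p < dartOrd G (revD p) := by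
  rw [corrUnsel, mem_filter]

omit [DecidablePred (· ∈ T)] in
/-- The reversal maps corridor darts to corridor darts. [folklore] -/
theorem revD_mem_corrDarts (hp : p ∈ corrDarts (G := G)) : revD p ∈ corrDarts (G := G) := by
  rw [mem_corrDarts] at hp ⊢
  exact ⟨revD_mem_highDarts hp.1 hp.2, three_le_degree_chainEnd_revD hp.1⟩

omit [DecidablePred (· ∈ T)] in
/-- The reversal is an involution on corridor darts. [folklore] -/
theorem revD_revD_of_mem_corrDarts (hp : p ∈ corrDarts (G := G)) : revD (revD p) = p :=
  revD_revD (mem_corrDarts.mp hp).1 (mem_corrDarts.mp hp).2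

omit [DecidablePred (· ∈ T)] in
/-- The reversal swaps selected and unselected corridor darts. [folklore] -/
theorem revD_mem_corrUnsel (hp : p ∈ corrSel (G := G)) : revD p ∈ corrUnsel (G := G) := by
  rw [mem_corrSel] at hp
  rw [mem_corrUnsel, revD_revD_of_mem_corrDarts hp.1]
  exact ⟨revD_mem_corrDarts hp.1, by omega⟩

omit [DecidablePred (· ∈ T)] in
/-- See `revD_mem_corrUnsel`. [folklore] -/
theorem revD_mem_corrSel (hp : p ∈ corrUnsel (G := G)) : revD p ∈ corrSel (G := G) := by
  rw [mem_corrUnsel] at hp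
  have hne : dartOrd G p ≠ dartOrd G (revD p) := fun h =>
    revD_ne (mem_corrDarts.mp hp.1).1 (dartOrd_injective h).symm
  rw [mem_corrSel, revD_revD_of_mem_corrDarts hp.1]
  exact ⟨revD_mem_corrDarts hp.1, by omega⟩

/-- The corridor bit is invariant under reversal. [folklore] -/
theorem xbit_revD (hp : p ∈ corrDarts (G := G)) : xbit T ρ (revD p) = xbit T ρ p := by
  unfold xbit
  rw [revD_revD_of_mem_corrDarts hp, tauD_revD (mem_corrDarts.mp hp).1 (mem_corrDarts.mp hp).2]
  cases tauD T p <;> cases sigD ρ p <;> cases sigD ρ (revD p) <;> rfl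

omit [DecidablePred (· ∈ T)] in
/-- Selected corridor darts and pendant darts are disjoint. [folklore] -/
theorem disjoint_corrSel_pendDarts : Disjoint (corrSel (G := G)) (pendDarts (G := G)) := by
  rw [disjoint_left]
  intro p hc hp
  rw [mem_corrSel, mem_corrDarts] at hc
  rw [mem_pendDarts] at hp
  exact hp.2 hc.1.2

/-- The bad corridor darts are the corridor darts with corridor bit `1`. [folklore] -/
theorem filter_corrBadD : (highDarts G).filter (CorrBadD (T := T) ρ) = (corrDarts (G := G)).filter fun p => xbit T ρ p = true := by
  rw [corrDarts, filter_filter]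
  rfl

/-- The bad pendant darts are the pendant darts with pendant bit `1`. [folklore] -/
theorem filter_pendBadD : (highDarts G).filter (PendBadD (T := T) ρ) = (pendDarts (G := G)).filter fun p => ybit T ρ p = true := by
  rw [pendDarts, filter_filter]
  rfl

/-- **The bad corridor darts pair up under reversal**: their number is twice the number of bad
SELECTED corridor darts. [folklore] -/
theorem card_filter_corrDarts_xbit :
    ((corrDarts (G := G)).filter fun p => xbit T ρ p = true).card =
      2 * ((corrSel (G := G)).filter fun p => xbit T ρ p = true).card := by
  have hsplit := card_filter_add_card_filter_not (s := (corrDarts (G := G)).filter fun p => xbit T ρ p = true)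
    (fun p => dartOrd G p < dartOrd G (revD p))
  have e1 : ((corrDarts (G := G)).filter fun p => xbit T ρ p = true).filter (fun p => dartOrd G p < dartOrd G (revD p)) =
      (corrSel (G := G)).filter fun p => xbit T ρ p = true := by
    ext q
    simp only [mem_filter, mem_corrSel]
    tauto
  have e2 : ((corrDarts (G := G)).filter fun p => xbit T ρ p = true).filter (fun p => ¬ dartOrd G p < dartOrd G (revD p)) =
      (corrUnsel (G := G)).filter fun p => xbit T ρ p = true := by
    ext q
    simp only [mem_filter, mem_corrUnsel]
    tauto
  rw [e1, e2] at hsplit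
  have e3 : ((corrUnsel (G := G)).filter fun p => xbit T ρ p = true).card =
      ((corrSel (G := G)).filter fun p => xbit T ρ p = true).card := by
    refine card_nbij' revD revD (fun p hp => ?_) (fun p hp => ?_) (fun p hp => ?_) (fun p hp => ?_)
    · rw [mem_coe, mem_filter] at hp ⊢
      exact ⟨revD_mem_corrSel hp.1, by rw [xbit_revD (mem_corrUnsel.mp hp.1).1]; exact hp.2⟩
    · rw [mem_coe, mem_filter] at hp ⊢
      exact ⟨revD_mem_corrUnsel hp.1, by rw [xbit_revD (mem_corrSel.mp hp.1).1]; exact hp.2⟩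
    · rw [mem_coe, mem_filter] at hp
      exact revD_revD_of_mem_corrDarts (mem_corrUnsel.mp hp.1).1
    · rw [mem_coe, mem_filter] at hp
      exact revD_revD_of_mem_corrDarts (mem_corrSel.mp hp.1).1
  omega

/-- **THE PARITY IDENTITY**: `nCorr / 4 + nPend / 2 ≡ #{selected darts with odd twist parity}
(mod 2)`. The corridor darts pair up under reversal (which preserves badness), so `nCorr / 4`
counts the bad selected corridor darts; modulo two the representative bits then sum to
`Σ_{high darts} σ ≡ 0`. [cite: ChenFlumLiu2025, Thm. 8.1 (proof, §8)] -/
theorem even_nCorr_div_add_nPend_div_iff (hρ : IsRepMap (cfiGraph G T) ρ) :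
    Even (nCorr (cfiGraph G T) ρ / 4 + nPend (cfiGraph G T) ρ / 2) ↔
      Even ((selDarts (G := G)).filter fun p => tauD T p = true).card := by
  have hdiv4 : ∀ n : ℕ, 2 * n / 4 = n / 2 := fun n => by omega
  have hdiv2 : ∀ n : ℕ, 2 * n / 2 = n := fun n => by omega
  rw [nCorr_eq hρ, nPend_eq hρ, hdiv4, hdiv2, filter_corrBadD, filter_pendBadD, card_filter_corrDarts_xbit, hdiv2]
  -- modulo two
  rw [← ZMod.natCast_eq_zero_iff_even, ← ZMod.natCast_eq_zero_iff_even, Nat.cast_add,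
    natCast_card_filter_eq_true, natCast_card_filter_eq_true, natCast_card_filter_eq_true]
  -- the sums
  have hsum_sel : ∑ p ∈ selDarts (G := G), bz (tauD T p) =
      ∑ p ∈ corrSel (G := G), bz (tauD T p) + ∑ p ∈ pendDarts (G := G), bz (tauD T p) := by
    rw [selDarts, sum_union disjoint_corrSel_pendDarts]
  have hre : ∑ p ∈ corrSel (G := G), bz (sigD ρ (revD p)) = ∑ p ∈ corrUnsel (G := G), bz (sigD ρ p) :=
    sum_nbij' revD revD (fun p hp => revD_mem_corrUnsel hp) (fun p hp => revD_mem_corrSel hp)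
      (fun p hp => revD_revD_of_mem_corrDarts (mem_corrSel.mp hp).1)
      (fun p hp => revD_revD_of_mem_corrDarts (mem_corrUnsel.mp hp).1) (fun p _ => rfl)
  have hsum_x : ∑ p ∈ corrSel (G := G), bz (xbit T ρ p) =
      ∑ p ∈ corrSel (G := G), bz (tauD T p) +
        (∑ p ∈ corrSel (G := G), bz (sigD ρ p) + ∑ p ∈ corrUnsel (G := G), bz (sigD ρ p)) := by
    rw [← hre, ← sum_add_distrib, ← sum_add_distrib]
    refine sum_congr rfl fun p _ => ?_
    simp only [xbit, bz_xor]
  have hsum_y : ∑ p ∈ pendDarts (G := G), bz (ybit T ρ p) =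
      ∑ p ∈ pendDarts (G := G), bz (tauD T p) + ∑ p ∈ pendDarts (G := G), bz (sigD ρ p) := by
    rw [← sum_add_distrib]
    refine sum_congr rfl fun p _ => ?_
    simp only [ybit, bz_xor]
  have hsum_σ : ∑ p ∈ corrSel (G := G), bz (sigD ρ p) + ∑ p ∈ corrUnsel (G := G), bz (sigD ρ p) +
      ∑ p ∈ pendDarts (G := G), bz (sigD ρ p) = 0 := by
    rw [corrSel, corrUnsel, sum_filter_add_sum_filter_not, corrDarts, pendDarts, sum_filter_add_sum_filter_not]
    exact sum_sigD_eq_zero ρ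
  have key : ∑ p ∈ corrSel (G := G), bz (xbit T ρ p) + ∑ p ∈ pendDarts (G := G), bz (ybit T ρ p) =
      ∑ p ∈ selDarts (G := G), bz (tauD T p) := by
    rw [hsum_x, hsum_y, hsum_sel]
    calc ∑ p ∈ corrSel (G := G), bz (tauD T p) +
            (∑ p ∈ corrSel (G := G), bz (sigD ρ p) + ∑ p ∈ corrUnsel (G := G), bz (sigD ρ p)) +
          (∑ p ∈ pendDarts (G := G), bz (tauD T p) + ∑ p ∈ pendDarts (G := G), bz (sigD ρ p))
        = (∑ p ∈ corrSel (G := G), bz (tauD T p) + ∑ p ∈ pendDarts (G := G), bz (tauD T p)) +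
          (∑ p ∈ corrSel (G := G), bz (sigD ρ p) + ∑ p ∈ corrUnsel (G := G), bz (sigD ρ p) +
            ∑ p ∈ pendDarts (G := G), bz (sigD ρ p)) := by ring
      _ = _ := by rw [hsum_σ, add_zero]
  rw [key]

end Parity

/-! #### Conclusions for `T = ∅` and `T = {e}` when a vertex of degree `≥ 3` exists -/

section HighCase

variable {ρ : CFIVertex G → CFIVertex G}

/-- Without twisted edges all twist bits vanish. [folklore] -/
theorem tau_eq_false_of_forall_notMem (hT : ∀ f, f ∉ T) (x : ℕ → Fin v) (k : ℕ) : tau T x k = false := by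
  induction k with
  | zero => rfl
  | succ k ih =>
    rw [tau_succ, ih]
    unfold twist
    rw [decide_eq_false (hT _)]
    rfl

/-- A vertex of degree `≥ 3` of the base graph yields a core vertex of `CFI(G, T)`. [folklore] -/
theorem exists_isCore_of_three_le_degree {u : Fin v} (h3 : 3 ≤ G.degree u) : ∃ x : CFIVertex G, IsCore (cfiGraph G T) x :=
  ⟨midV ⟨u, emptyMid G u⟩, (isCore_iff _).mpr h3⟩

/-- A vertex of degree `≥ 3` yields a start of the base graph. [folklore] -/
theorem exists_isTrailStart_of_three_le_degree {u : Fin v} (h3 : 3 ≤ G.degree u) : ∃ s : Fin v × Fin v, IsTrailStart G s := by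
  obtain ⟨w, hw⟩ := (G.degree_pos_iff_exists_adj u).mp (by omega)
  exact ⟨(u, w), isTrailStart_of_high hw h3⟩

/-- **`Y(G)` is accepted (base graph with a vertex of degree `≥ 3`).** [cite: ChenFlumLiu2025, Thm. 8.1] -/
theorem verdict_of_forall_notMem (hT : ∀ f, f ∉ T) (hρ : IsRepMap (cfiGraph G T) ρ) {u : Fin v} (h3 : 3 ≤ G.degree u) :
    Verdict (cfiGraph G T) ρ := by
  refine Or.inl ⟨exists_isCore_of_three_le_degree h3, (even_nCorr_div_add_nPend_div_iff hρ).mpr ?_⟩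
  have : ((selDarts (G := G)).filter fun p => tauD T p = true) = ∅ := by
    refine filter_eq_empty_iff.mpr fun p _ => ?_
    unfold tauD
    rw [tau_eq_false_of_forall_notMem hT]
    exact Bool.false_ne_true
  rw [this, card_empty]
  exact Even.zero

omit [DecidablePred (· ∈ T)] in
/-- **A chain from a leaf to a leaf is the whole (preconnected) base graph.** [folklore] -/
theorem _root_.Literature.Combinatorics.SimpleGraph.IsTrailStart.exists_trailVert_eq_of_leaf_ends
    {d : Fin v × Fin v} (hd : IsTrailStart G d) (hconn : G.Preconnected) (h0 : G.degree d.1 = 1)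
    (hL : G.degree (trailVert G d (trailLen G d + 1)) = 1) (u : Fin v) :
    ∃ k ≤ trailLen G d + 1, trailVert G d k = u := by
  have hN0 := neighborFinset_eq_singleton_of_degree h0 hd.adj
  have hNL := neighborFinset_eq_singleton_of_degree hL (hd.adj_trailVert le_rfl).symm
  refine mem_of_preconnected_of_closed hconn (U := {u | ∃ k ≤ trailLen G d + 1, trailVert G d k = u}) ?_
    (u := trailVert G d 0) ⟨0, Nat.zero_le _, rfl⟩ u
  rintro u ⟨k, hk, rfl⟩ w huw
  rcases Nat.eq_zero_or_pos k with rfl | hk1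
  · -- `N(x₀) = {x₁}`
    have hw : w ∈ G.neighborFinset d.1 := (G.mem_neighborFinset _ _).mpr huw
    rw [hN0, mem_singleton] at hw
    exact ⟨1, by omega, hw.symm⟩
  · rcases Nat.lt_or_ge k (trailLen G d + 1) with hlt | hge
    · rcases (hd.adj_trailVert_iff hk1 (by omega)).mp huw with rfl | rfl
      · exact ⟨k - 1, by omega, rfl⟩
      · exact ⟨k + 1, by omega, rfl⟩
    · have hk' : k = trailLen G d + 1 := by omega
      subst hk'
      have hw : w ∈ G.neighborFinset (trailVert G d (trailLen G d + 1)) := (G.mem_neighborFinset _ _).mpr huw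
      rw [hNL, mem_singleton] at hw
      exact ⟨trailLen G d, by omega, hw.symm⟩

omit [DecidablePred (· ∈ T)] in
/-- Hence in that case every vertex has degree `≤ 2`. [folklore] -/
theorem _root_.Literature.Combinatorics.SimpleGraph.IsTrailStart.degree_le_two_of_leaf_ends
    {d : Fin v × Fin v} (hd : IsTrailStart G d) (hconn : G.Preconnected) (h0 : G.degree d.1 = 1)
    (hL : G.degree (trailVert G d (trailLen G d + 1)) = 1) (u : Fin v) : G.degree u ≤ 2 := by
  obtain ⟨k, hk, rfl⟩ := hd.exists_trailVert_eq_of_leaf_ends hconn h0 hL u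
  rcases Nat.eq_zero_or_pos k with rfl | hk1
  · show G.degree d.1 ≤ 2
    omega
  · rcases Nat.lt_or_ge k (trailLen G d + 1) with hlt | hge
    · rw [hd.degree_trailVert hk1 (by omega)]
    · rw [show k = trailLen G d + 1 by omega, hL]
      omega

/-- **A high dart whose chain contains a given edge** (base graph connected with a vertex of
degree `≥ 3`). [folklore] -/
theorem exists_mem_highDarts_mem_trailEdges (hconn : G.Connected) {u : Fin v} (h3 : 3 ≤ G.degree u) {e : Sym2 (Fin v)}
    (he : e ∈ G.edgeSet) : ∃ p ∈ highDarts G, e ∈ trailEdges G p.1 := by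
  obtain ⟨s, hs, hes⟩ := exists_isTrailStart_mem_trailEdges hconn.preconnected
    (exists_isTrailStart_of_three_le_degree h3) he
  by_cases hs3 : 3 ≤ G.degree s.1
  · exact ⟨⟨(s.1, s.2), hs.adj⟩, mem_highDarts.mpr hs3, hes⟩
  · have hs1 : G.degree s.1 = 1 := by
      have := hs.degree_ne
      have hpos : 0 < G.degree s.1 := (G.degree_pos_iff_exists_adj _).mpr ⟨_, hs.adj⟩
      omega
    rcases high_or_leaf_end hs with hhigh | hleaf
    · refine ⟨⟨((trailRev G s).1, (trailRev G s).2), hs.rev.adj⟩, mem_highDarts.mpr hhigh, ?_⟩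
      show e ∈ trailEdges G (trailRev G s)
      rw [hs.trailEdges_rev]
      exact hes
    · have := hs.degree_le_two_of_leaf_ends hconn.preconnected hs1 hleaf u
      omega

/-- With exactly one twisted edge `e`, the twist bit of a high dart records whether `e` lies on its
chain. [folklore] -/
theorem tauD_eq_decide_mem {e : Sym2 (Fin v)} (hT : ∀ f, f ∈ T ↔ f = e) {p : CFIDart G} (hp : p ∈ highDarts G) :
    tauD T p = decide (e ∈ trailEdges G p.1) := by
  rw [tauD_eq hp, filter_congr (q := fun f => f = e) (fun f _ => hT f), filter_eq']
  by_cases h : e ∈ trailEdges G p.1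
  · rw [if_pos h, card_singleton, decide_eq_true h]
    exact decide_eq_true odd_one
  · rw [if_neg h, card_empty, decide_eq_false h]
    exact decide_eq_false (by decide)

/-- **`Y^e(G)` is rejected (base graph connected with a vertex of degree `≥ 3`)**: exactly one
selected dart has `e` on its chain. [cite: ChenFlumLiu2025, Thm. 8.1] -/
theorem not_verdict_of_singleton (hconn : G.Connected) {e : Sym2 (Fin v)} (he : e ∈ G.edgeSet)
    (hT : ∀ f, f ∈ T ↔ f = e) (hρ : IsRepMap (cfiGraph G T) ρ) {u : Fin v} (h3 : 3 ≤ G.degree u) :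
    ¬ Verdict (cfiGraph G T) ρ := by
  have hcore := exists_isCore_of_three_le_degree (T := T) h3
  rintro (⟨-, heven⟩ | ⟨hnc, -⟩)
  swap
  · exact hnc hcore
  rw [even_nCorr_div_add_nPend_div_iff hρ] at heven
  -- the selected darts with `e` on their chain: exactly one
  obtain ⟨p₀, hp₀, he₀⟩ := exists_mem_highDarts_mem_trailEdges hconn h3 he
  have hd₀ := isTrailStart_of_mem_highDarts hp₀
  have hsel_sub : ∀ p ∈ selDarts (G := G), p ∈ highDarts G := fun p hp => by
    rw [selDarts, mem_union, mem_corrSel, mem_corrDarts, mem_pendDarts] at hp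
    rcases hp with ⟨⟨h, -⟩, -⟩ | ⟨h, -⟩ <;> exact h
  have hX : ((selDarts (G := G)).filter fun p => tauD T p = true) =
      (selDarts (G := G)).filter fun p => e ∈ trailEdges G p.1 := by
    refine filter_congr fun p hp => ?_
    rw [tauD_eq_decide_mem hT (hsel_sub p hp), decide_eq_true_iff]
  rw [hX] at heven
  -- every dart with `e` on its chain is `p₀` or its reversal
  have hdet : ∀ p ∈ highDarts G, e ∈ trailEdges G p.1 → p = p₀ ∨ p = revD p₀ := by
    intro p hp hep
    rcases hd₀.eq_or_eq_rev_of_mem_trailEdges (isTrailStart_of_mem_highDarts hp) he₀ hep with h | h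
    · exact Or.inl (Subtype.ext h)
    · right
      apply Subtype.ext
      rw [h, revD_val hp₀]
  rcases high_or_leaf_end hd₀ with hhigh | hleaf
  · -- corridor: exactly one of `p₀`, `revD p₀` is selected
    have hc₀ : p₀ ∈ corrDarts (G := G) := mem_corrDarts.mpr ⟨hp₀, hhigh⟩
    have hc₁ : revD p₀ ∈ corrDarts (G := G) := revD_mem_corrDarts hc₀
    have hne : dartOrd G p₀ ≠ dartOrd G (revD p₀) := fun h => revD_ne hp₀ (dartOrd_injective h).symm
    have he₁ : e ∈ trailEdges G (revD p₀).1 := by rw [revD_val hp₀, hd₀.trailEdges_rev]; exact he₀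
    set q := if dartOrd G p₀ < dartOrd G (revD p₀) then p₀ else revD p₀ with hq
    have hq_sel : q ∈ corrSel (G := G) := by
      rw [hq]
      split_ifs with h
      · exact mem_corrSel.mpr ⟨hc₀, h⟩
      · exact mem_corrSel.mpr ⟨hc₁, by rw [revD_revD_of_mem_corrDarts hc₀]; omega⟩
    have hq_e : e ∈ trailEdges G q.1 := by
      rw [hq]; split_ifs
      · exact he₀
      · exact he₁
    have hX1 : ((selDarts (G := G)).filter fun p => e ∈ trailEdges G p.1) = {q} := by
      ext p
      rw [mem_filter, mem_singleton]
      constructor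
      · rintro ⟨hps, hep⟩
        have hp := hsel_sub p hps
        rw [selDarts, mem_union] at hps
        rcases hps with hps | hps
        · have hlt := (mem_corrSel.mp hps).2
          rcases hdet p hp hep with rfl | rfl
          · rw [hq, if_pos hlt]
          · rw [revD_revD_of_mem_corrDarts hc₀] at hlt
            rw [hq, if_neg (by omega)]
        · exfalso
          have hnot := (mem_pendDarts.mp hps).2
          rcases hdet p hp hep with rfl | rfl
          · exact hnot hhigh
          · exact hnot (three_le_degree_chainEnd_revD hp₀)
      · rintro rfl
        exact ⟨by rw [selDarts, mem_union]; exact Or.inl hq_sel, hq_e⟩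
    rw [hX1, card_singleton] at heven
    exact Nat.not_even_one heven
  · -- pendant: only `p₀`
    have hnot₁ : revD p₀ ∉ highDarts G := by
      rw [mem_highDarts, revD_val hp₀]
      show ¬ 3 ≤ G.degree (trailVert G p₀.1 (trailLen G p₀.1 + 1))
      omega
    have hX1 : ((selDarts (G := G)).filter fun p => e ∈ trailEdges G p.1) = {p₀} := by
      ext p
      rw [mem_filter, mem_singleton]
      constructor
      · rintro ⟨hps, hep⟩
        have hp := hsel_sub p hps
        rcases hdet p hp hep with rfl | rfl
        · rfl
        · exact absurd hp hnot₁
      · rintro rfl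
        refine ⟨?_, he₀⟩
        rw [selDarts, mem_union]
        exact Or.inr (mem_pendDarts.mpr ⟨hp₀, by unfold chainEnd; omega⟩)
    rw [hX1, card_singleton] at heven
    exact Nat.not_even_one heven

end HighCase

end Accounting

/-! ### §E. Base graphs without a vertex of degree `≥ 3` -/

section LowDegree

/-- The twist bit of a whole chain counts its twisted edges. [folklore] -/
theorem tau_trailLen_succ_eq {d : Fin v × Fin v} (hd : IsTrailStart G d) :
    tau T (trailVert G d) (trailLen G d + 1) = decide (Odd ((trailEdges G d).filter (· ∈ T)).card) := by
  rw [tau_eq_decide, card_filter_trailEdges hd]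

/-- With exactly one twisted edge lying on the chain, the twist bit of the chain is `1`. [folklore] -/
theorem tau_trailLen_succ_eq_true {d : Fin v × Fin v} (hd : IsTrailStart G d) {e : Sym2 (Fin v)}
    (hT : ∀ f, f ∈ T ↔ f = e) (he : e ∈ trailEdges G d) : tau T (trailVert G d) (trailLen G d + 1) = true := by
  rw [tau_trailLen_succ_eq hd, filter_congr (q := fun f => f = e) (fun f _ => hT f), filter_eq', if_pos he,
    card_singleton]
  exact decide_eq_true odd_one

/-- Without a vertex of degree `≥ 3` there is no core vertex. [folklore] -/
theorem not_isCore_of_low (hlow : ∀ u, G.degree u ≤ 2) (x : CFIVertex G) : ¬ IsCore (cfiGraph G T) x := by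
  rw [isCore_iff]
  have := hlow (base x)
  omega

omit [DecidablePred (· ∈ T)] in
/-- In a chain from a leaf to a leaf of a preconnected graph every edge lies on the chain. [folklore] -/
theorem _root_.Literature.Combinatorics.SimpleGraph.IsTrailStart.mem_trailEdges_of_leaf_ends
    {d : Fin v × Fin v} (hd : IsTrailStart G d) (hconn : G.Preconnected) (h0 : G.degree d.1 = 1)
    (hL : G.degree (trailVert G d (trailLen G d + 1)) = 1) {e : Sym2 (Fin v)} (he : e ∈ G.edgeSet) :
    e ∈ trailEdges G d := by
  induction e using Sym2.ind with
  | _ a b =>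
    rw [SimpleGraph.mem_edgeSet] at he
    obtain ⟨k, hk, rfl⟩ := hd.exists_trailVert_eq_of_leaf_ends hconn h0 hL a
    rcases Nat.eq_zero_or_pos k with rfl | hk1
    · have hb : b ∈ G.neighborFinset d.1 := (G.mem_neighborFinset _ _).mpr he
      rw [neighborFinset_eq_singleton_of_degree h0 hd.adj, mem_singleton] at hb
      subst hb
      exact mem_trailEdges_zero d
    · rcases Nat.lt_or_ge k (trailLen G d + 1) with hlt | hge
      · rcases (hd.adj_trailVert_iff hk1 (by omega)).mp he with rfl | rfl
        · refine mem_trailEdges.mpr ⟨k - 1, by omega, ?_⟩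
          rw [Sym2.eq_swap, Nat.sub_add_cancel hk1]
        · exact mem_trailEdges.mpr ⟨k, by omega, rfl⟩
      · have hk' : k = trailLen G d + 1 := by omega
        subst hk'
        have hb : b ∈ G.neighborFinset (trailVert G d (trailLen G d + 1)) := (G.mem_neighborFinset _ _).mpr he
        rw [neighborFinset_eq_singleton_of_degree hL (hd.adj_trailVert le_rfl).symm, mem_singleton] at hb
        subst hb
        exact mem_trailEdges.mpr ⟨trailLen G d, le_rfl, Sym2.eq_swap⟩

/-- **The dead ends of `CFI(G, T)`**: a vertex of degree one is the `a`-link or the middle vertex of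
a leaf gadget. [cite: ChenFlumLiu2025, §7 (proof of Lemma 7.17, case `deg(v) = 1`)] -/
theorem exists_leaf_of_degree_eq_one {x : CFIVertex G} (hx : (cfiGraph G T).degree x = 1) :
    ∃ (ℓ w : Fin v) (h : G.Adj ℓ w), G.degree ℓ = 1 ∧ (x = linkV (⟨(ℓ, w), h⟩, true) ∨ x = midV ⟨ℓ, emptyMid G ℓ⟩) := by
  rcases linkV_or_midV x with ⟨⟨⟨⟨u, w⟩, hw⟩, c⟩, rfl⟩ | ⟨⟨u, S⟩, rfl⟩
  · have hpos : 0 < G.degree u := (G.degree_pos_iff_exists_adj u).mpr ⟨w, hw⟩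
    have hnot3 : ¬ 3 ≤ G.degree u := fun h3 => by
      have := three_le_degree_linkV (T := T) (x := (⟨(u, w), hw⟩, c)) h3
      omega
    rcases (show G.degree u = 1 ∨ G.degree u = 2 by omega) with h1 | h2
    · have hN := neighborFinset_eq_singleton_of_degree h1 hw
      cases c
      · rw [← SimpleGraph.card_neighborFinset_eq_degree, neighborFinset_linkV_false_of_singleton hN,
          card_pair linkV_ne_midV] at hx
        exact absurd hx (by decide)
      · exact ⟨u, w, hw, h1, Or.inl rfl⟩
    · obtain ⟨w₂, hw₂, hne, hN⟩ := neighborFinset_eq_pair_of_degree h2 hw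
      rw [← SimpleGraph.card_neighborFinset_eq_degree, neighborFinset_linkV_of_pair hN hw hw₂ hne,
        card_pair linkV_ne_midV] at hx
      exact absurd hx (by decide)
  · rw [degree_midV] at hx
    obtain ⟨w, hw⟩ := (G.degree_pos_iff_exists_adj u).mp (by omega)
    have hS := mid_val_eq_empty_of_singleton (neighborFinset_eq_singleton_of_degree hx hw) S
    refine ⟨u, w, hw, hx, Or.inr ?_⟩
    rw [show S = emptyMid G u from Subtype.ext hS]

/-- A leaf dart is a start of the base graph. [folklore] -/
theorem isTrailStart_of_leaf {ℓ w : Fin v} (hw : G.Adj ℓ w) (h1 : G.degree ℓ = 1) : IsTrailStart G (ℓ, w) :=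
  ⟨hw, fun h2 => by have h2' : G.degree ℓ = 2 := h2; omega⟩

/-- The `a`-link of a leaf gadget has degree one. [cite: ChenFlumLiu2025, §7 (Lemma 7.17)] -/
theorem degree_aLink_eq_one {ℓ w : Fin v} (hw : G.Adj ℓ w) (h1 : G.degree ℓ = 1) :
    (cfiGraph G T).degree (linkV (⟨(ℓ, w), hw⟩, true)) = 1 := by
  rw [← SimpleGraph.card_neighborFinset_eq_degree,
    neighborFinset_linkV_true_of_singleton (neighborFinset_eq_singleton_of_degree h1 hw), card_singleton]

/-- The walk from the `a`-link of a leaf gadget starts at `zStart … true`. [folklore] -/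
theorem aLink_start_eq {ℓ w : Fin v} (hw : G.Adj ℓ w) (h1 : G.degree ℓ = 1) :
    (linkV (⟨(ℓ, w), hw⟩, true), firstNbr (cfiGraph G T) (linkV (⟨(ℓ, w), hw⟩, true))) =
      zStart T (isTrailStart_of_leaf hw h1) true := by
  rw [zStart_eq, firstNbr_eq_of_neighborFinset_eq
    (neighborFinset_linkV_true_of_singleton (neighborFinset_eq_singleton_of_degree h1 hw) hw)]

/-- It is a start of the CFI graph. [folklore] -/
theorem isTrailStart_zStart_of_leaf {ℓ w : Fin v} (hw : G.Adj ℓ w) (h1 : G.degree ℓ = 1) :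
    IsTrailStart (cfiGraph G T) (zStart T (isTrailStart_of_leaf hw h1) true) := by
  rw [zStart_eq]
  refine ⟨adj_linkV_conn _, ?_⟩
  show (cfiGraph G T).degree (linkV (⟨(ℓ, w), hw⟩, true)) ≠ 2
  rw [degree_aLink_eq_one hw h1]
  decide

/-- **The walk from the `a`-link of a leaf (no vertex of degree `≥ 3`) has length `3L` if the twist
bit of the chain is `0` and `3L + 1` if it is `1`.** [cite: ChenFlumLiu2025, Lemma 6.8 and §8] -/
theorem trailLen_aLink {ℓ w : Fin v} (hw : G.Adj ℓ w) (h1 : G.degree ℓ = 1) (hlow : ∀ u, G.degree u ≤ 2) :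
    trailLen (cfiGraph G T) (linkV (⟨(ℓ, w), hw⟩, true), firstNbr (cfiGraph G T) (linkV (⟨(ℓ, w), hw⟩, true))) =
      3 * trailLen G (ℓ, w) + (if tau T (trailVert G (ℓ, w)) (trailLen G (ℓ, w) + 1) then 1 else 0) := by
  have hd := isTrailStart_of_leaf hw h1
  have hst := isTrailStart_zStart_of_leaf (T := T) hw h1
  have hleaf : G.degree (trailVert G (ℓ, w) (trailLen G (ℓ, w) + 1)) = 1 := by
    rcases high_or_leaf_end hd with h | h
    · have := hlow (trailVert G (ℓ, w) (trailLen G (ℓ, w) + 1)); omega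
    · exact h
  rw [aLink_start_eq hw h1]
  rcases Bool.eq_false_or_eq_true (tau T (trailVert G (ℓ, w)) (trailLen G (ℓ, w) + 1)) with ht | ht
  · rw [(trailLen_zStart_of_leaf_false hd true hst hleaf (by rw [ht]; rfl)).1, ht]
    rfl
  · rw [(trailLen_zStart_of_leaf_true hd true hst hleaf (by rw [ht]; rfl)).1, ht]
    rfl

/-- **The walk from the middle vertex of a leaf** is one step longer than the walk over the same
chain with letter `b`: length `3L + 1` if the twist bit of the chain is `1`.
[cite: ChenFlumLiu2025, Lemma 6.8 and §8] -/
theorem trailLen_mLeaf_of_tau {ℓ w : Fin v} (hw : G.Adj ℓ w) (h1 : G.degree ℓ = 1) (hlow : ∀ u, G.degree u ≤ 2)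
    (ht : tau T (trailVert G (ℓ, w)) (trailLen G (ℓ, w) + 1) = true) :
    trailLen (cfiGraph G T) (midV ⟨ℓ, emptyMid G ℓ⟩, firstNbr (cfiGraph G T) (midV ⟨ℓ, emptyMid G ℓ⟩)) =
      3 * trailLen G (ℓ, w) + 1 := by
  have hd := isTrailStart_of_leaf hw h1
  have hN := neighborFinset_eq_singleton_of_degree h1 hw
  have hleaf : G.degree (trailVert G (ℓ, w) (trailLen G (ℓ, w) + 1)) = 1 := by
    rcases high_or_leaf_end hd with h | h
    · have := hlow (trailVert G (ℓ, w) (trailLen G (ℓ, w) + 1)); omega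
    · exact h
  -- the start `(m(∅), b)` and its first step to `zStart … false`
  have hNm := neighborFinset_midV_of_singleton (T := T) hN hw (emptyMid G ℓ)
  rw [firstNbr_eq_of_neighborFinset_eq hNm]
  set s : CFIVertex G × CFIVertex G := (midV ⟨ℓ, emptyMid G ℓ⟩, linkV (⟨(ℓ, w), hw⟩, false)) with hs
  have hstart : IsTrailStart (cfiGraph G T) s := by
    refine ⟨?_, ?_⟩
    · show (cfiGraph G T).Adj (midV ⟨ℓ, emptyMid G ℓ⟩) (linkV (⟨(ℓ, w), hw⟩, false))
      exact adj_midV_linkV_of_iff hw _ false (by simp)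
    · show (cfiGraph G T).degree (midV ⟨ℓ, emptyMid G ℓ⟩) ≠ 2
      rw [degree_midV, h1]; decide
  have hex0 : exits (cfiGraph G T) s = {linkV (conn G T (⟨(ℓ, w), hw⟩, false))} := by
    unfold exits
    rw [hs]
    dsimp only
    rw [neighborFinset_linkV_false_of_singleton hN]
    exact pair_erase_right linkV_ne_midV
  have hrun1 : trailRun (cfiGraph G T) 1 s = zStart T hd false := by
    rw [trailRun_succ, trailRun_zero, trailStep_of_exits_eq hex0, zStart_eq]
  have hshift : ∀ j, trailRun (cfiGraph G T) (j + 1) s = trailRun (cfiGraph G T) j (zStart T hd false) := fun j => by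
    rw [trailRun_add, hrun1]
  -- the stop pattern of the shifted walk: final bit `false ⊕ τ = true`, an `a`-end
  obtain ⟨hrun, hmov⟩ := trailRun_zStart (T := T) hd false (le_refl (trailLen G (ℓ, w)))
  have hbit : xor false (tau T (trailVert G (ℓ, w)) (trailLen G (ℓ, w) + 1)) = true := by rw [ht]; rfl
  have hstop : ¬ Moves (cfiGraph G T) (trailRun (cfiGraph G T) (3 * trailLen G (ℓ, w)) (zStart T hd false)) := by
    rw [hrun]
    exact not_moves_of_leaf_end_true (trailVert G (ℓ, w)) (hd.adj_trailVert le_rfl)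
      (neighborFinset_eq_singleton_of_degree hleaf (hd.adj_trailVert le_rfl).symm) false hbit
  refine hstart.trailLen_eq_of_stop (fun k hk => ?_) (by rw [hshift]; exact hstop)
  rcases Nat.eq_zero_or_pos k with rfl | hk1
  · show Moves (cfiGraph G T) s
    unfold Moves
    rw [hex0, card_singleton]
  · obtain ⟨j, rfl⟩ : ∃ j, k = j + 1 := ⟨k - 1, by omega⟩
    rw [hshift]
    exact hmov j (by omega)

variable {ρ : CFIVertex G → CFIVertex G}

/-- **`Y(P)` is accepted for a path `P`** (a leaf exists, no vertex of degree `≥ 3`): the `a`-link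
of a leaf is a dead end whose walk has length `3L ≢ 1 (mod 3)`. [cite: ChenFlumLiu2025, Thm. 8.1 and Lemma 6.8] -/
theorem verdict_path_of_forall_notMem (hlow : ∀ u, G.degree u ≤ 2) {ℓ : Fin v} (h1 : G.degree ℓ = 1)
    (hT : ∀ f, f ∉ T) : Verdict (cfiGraph G T) ρ := by
  obtain ⟨w, hw⟩ := (G.degree_pos_iff_exists_adj ℓ).mp (by omega)
  refine Or.inr ⟨fun ⟨x, hx⟩ => not_isCore_of_low hlow x hx, Or.inl ⟨linkV (⟨(ℓ, w), hw⟩, true),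
    degree_aLink_eq_one hw h1, ?_⟩⟩
  rw [trailLen_aLink hw h1 hlow, tau_eq_false_of_forall_notMem hT]
  simp only [Bool.false_eq_true, ite_false, add_zero, Nat.mul_mod_right]
  decide

/-- **`Y^e(P)` is rejected for a path `P`**: every dead end starts a walk of length `≡ 1 (mod 3)`
(and the graph is not two-regular, and has no core). [cite: ChenFlumLiu2025, Thm. 8.1 and Lemma 6.8] -/
theorem not_verdict_path_of_singleton (hconn : G.Connected) (hlow : ∀ u, G.degree u ≤ 2) {ℓ : Fin v}
    (h1 : G.degree ℓ = 1) {e : Sym2 (Fin v)} (he : e ∈ G.edgeSet) (hT : ∀ f, f ∈ T ↔ f = e) :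
    ¬ Verdict (cfiGraph G T) ρ := by
  obtain ⟨w, hw⟩ := (G.degree_pos_iff_exists_adj ℓ).mp (by omega)
  -- the twist bit of every leaf chain is `1`
  have htau : ∀ {ℓ' w' : Fin v} (hw' : G.Adj ℓ' w') (h1' : G.degree ℓ' = 1),
      tau T (trailVert G (ℓ', w')) (trailLen G (ℓ', w') + 1) = true := by
    intro ℓ' w' hw' h1'
    have hd := isTrailStart_of_leaf hw' h1'
    have hleaf : G.degree (trailVert G (ℓ', w') (trailLen G (ℓ', w') + 1)) = 1 := by
      rcases high_or_leaf_end hd with h | h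
      · have := hlow (trailVert G (ℓ', w') (trailLen G (ℓ', w') + 1)); omega
      · exact h
    exact tau_trailLen_succ_eq_true hd hT (hd.mem_trailEdges_of_leaf_ends hconn.preconnected h1' hleaf he)
  rintro (⟨⟨x, hx⟩, -⟩ | ⟨-, ⟨x, hx1, hx⟩ | ⟨hreg, -⟩⟩)
  · exact not_isCore_of_low hlow x hx
  · apply hx
    obtain ⟨ℓ', w', hw', h1', rfl | rfl⟩ := exists_leaf_of_degree_eq_one hx1
    · rw [trailLen_aLink hw' h1' hlow, htau hw' h1']
      simp
    · rw [trailLen_mLeaf_of_tau hw' h1' hlow (htau hw' h1')]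
      simp
  · have := hreg (linkV (⟨(ℓ, w), hw⟩, true))
    rw [degree_aLink_eq_one hw h1] at this
    exact absurd this (by decide)

end LowDegree

/-! #### Cycles -/

section Cycle

variable (hreg : ∀ u, G.degree u = 2)
include hreg

/-- Over a two-regular base graph the CFI graph is two-regular. [cite: ChenFlumLiu2025, Lemma 6.8] -/
theorem degree_eq_two_of_reg (y : CFIVertex G) : (cfiGraph G T).degree y = 2 := by
  rcases linkV_or_midV y with ⟨⟨⟨⟨u, w⟩, hw⟩, c⟩, rfl⟩ | ⟨⟨u, S⟩, rfl⟩
  · obtain ⟨w₂, hw₂, hne, hN⟩ := neighborFinset_eq_pair_of_degree (hreg u) hw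
    rw [← SimpleGraph.card_neighborFinset_eq_degree, neighborFinset_linkV_of_pair hN hw hw₂ hne, card_pair linkV_ne_midV]
  · rw [degree_midV, hreg]

omit [DecidablePred (· ∈ T)] in
/-- The LETTER potential: the bit of a link, and for a middle vertex whether its set is nonempty.
[cite: ChenFlumLiu2025, §1 (Fig. 1.1: the two cycles of `X^k`)] -/
def letter : CFIVertex G → Bool
  | .inl m => !decide (m.2.1 = ∅)
  | .inr x => x.2

/-- **Without twisted edges the letter is constant along edges** (two-regular base graph).
[cite: ChenFlumLiu2025, Lemma 6.8] -/
theorem letter_eq_of_adj (hT : ∀ f, f ∉ T) {y z : CFIVertex G} (h : (cfiGraph G T).Adj y z) :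
    letter (G := G) y = letter (G := G) z := by
  -- the basic case: link ~ anything
  have key : ∀ (x : CFIDart G × Bool) (z : CFIVertex G), (cfiGraph G T).Adj (linkV x) z →
      letter (G := G) (linkV x) = letter (G := G) z := by
    rintro ⟨⟨⟨u, w⟩, hw⟩, c⟩ z h
    rcases (adj_linkV_iff _ _).mp h with ⟨S, rfl, hc⟩ | rfl
    · obtain ⟨w₂, hw₂, hne, hN⟩ := neighborFinset_eq_pair_of_degree (hreg u) hw
      show c = !decide (S.1 = ∅)
      simp only at hc
      rcases mid_val_eq_of_pair hN hne S with hS | hS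
      · rw [hS] at hc ⊢
        simpa using hc
      · rw [hS] at hc ⊢
        have : ({w, w₂} : Finset (Fin v)) ≠ ∅ := (insert_nonempty w {w₂}).ne_empty
        simp only [mem_insert, true_or, iff_true] at hc
        rw [hc, decide_eq_false this]
        rfl
    · show c = xor c (twist T u w)
      unfold twist
      rw [decide_eq_false (hT _), Bool.xor_false]
  rcases linkV_or_midV y with ⟨x, rfl⟩ | ⟨m, rfl⟩
  · exact key x z h
  · rcases linkV_or_midV z with ⟨x, rfl⟩ | ⟨m', rfl⟩
    · exact (key x _ h.symm).symm
    · exact absurd h (not_adj_midV_midV _ _)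

variable {ρ : CFIVertex G → CFIVertex G}

/-- **`Y(C)` is accepted for a cycle `C`**: it is two-regular and disconnected (the two letters are
never joined). [cite: ChenFlumLiu2025, Thm. 8.1, Lemma 6.8 (and Fig. 1.1)] -/
theorem verdict_cycle_of_forall_notMem (hne : Nonempty (Fin v)) (hT : ∀ f, f ∉ T) : Verdict (cfiGraph G T) ρ := by
  obtain ⟨u⟩ := hne
  obtain ⟨w, hw⟩ := (G.degree_pos_iff_exists_adj u).mp (by rw [hreg]; decide)
  have hlow : ∀ u, G.degree u ≤ 2 := fun u => by rw [hreg]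
  refine Or.inr ⟨fun ⟨x, hx⟩ => not_isCore_of_low hlow x hx, Or.inr ⟨degree_eq_two_of_reg hreg,
    linkV (⟨(u, w), hw⟩, true), linkV (⟨(u, w), hw⟩, false), fun hr => ?_⟩⟩
  have := apply_eq_of_reachable (Z := cfiGraph G T) (letter (G := G)) (fun a b hab => letter_eq_of_adj hreg hT hab) hr
  rw [show letter (G := G) (linkV (⟨(u, w), hw⟩, true)) = true from rfl,
    show letter (G := G) (linkV (⟨(u, w), hw⟩, false)) = false from rfl] at this
  exact Bool.noConfusion this

/-! The cycle traversed twice. -/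

variable (hconn : G.Connected) {d : Fin v × Fin v} (hd : G.Adj d.1 d.2)
include hconn hd

local notation "n" => Fintype.card (Fin v)
local notation "x" => trailVert G d

omit [DecidablePred (· ∈ T)] in
/-- The cycle has at least three vertices. [folklore] -/
theorem cycle_three_le : 3 ≤ n := by
  rw [← returnTime_eq_card hreg hconn.preconnected hd]
  exact three_le_returnTime hreg hd

omit [DecidablePred (· ∈ T)] in
/-- Periodicity of the traversal. [folklore] -/
theorem cycle_period (k : ℕ) : x (k + n) = x k := trailVert_add_card_of_two_regular hreg hconn.preconnected hd k

omit [DecidablePred (· ∈ T)] hconn in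
/-- Neighbourhoods along the traversal. [folklore] -/
theorem cycle_neighborFinset {k : ℕ} (hk : 1 ≤ k) : G.neighborFinset (x k) = {x (k - 1), x (k + 1)} := by
  obtain ⟨k, rfl⟩ : ∃ k', k = k' + 1 := ⟨k - 1, by omega⟩
  rw [Nat.add_sub_cancel]
  exact neighborFinset_trailVert_of_two_regular hreg hd k

omit [DecidablePred (· ∈ T)] hconn in
/-- No backtracking along the traversal. [folklore] -/
theorem cycle_ne (k : ℕ) : x k ≠ x (k + 2) :=
  (trailVert_succ_succ_ne (fun j _ => moves_of_two_regular hreg hd j) (moves_of_two_regular hreg hd k)).symm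

omit [DecidablePred (· ∈ T)] in
/-- Every vertex is visited within one period, at a positive time. [folklore] -/
theorem cycle_cover_pos (u : Fin v) : ∃ k, 1 ≤ k ∧ k ≤ n ∧ x k = u := by
  obtain ⟨k, hk, rfl⟩ := exists_trailVert_eq_of_two_regular hreg hconn.preconnected hd u
  rcases Nat.eq_zero_or_pos k with rfl | hk1
  · exact ⟨n, by have := cycle_three_le hreg hconn hd; omega, le_rfl, by
      have := cycle_period hreg hconn hd 0; rwa [Nat.zero_add] at this⟩
  · exact ⟨k, hk1, hk.le, rfl⟩

omit [DecidablePred (· ∈ T)] in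
/-- Every edge is traversed within one period. [folklore] -/
theorem cycle_edge_index {e : Sym2 (Fin v)} (he : e ∈ G.edgeSet) : ∃ i < n, e = s(x i, x (i + 1)) := by
  induction e using Sym2.ind with
  | _ a b =>
    rw [SimpleGraph.mem_edgeSet] at he
    obtain ⟨k, hk1, hkn, rfl⟩ := cycle_cover_pos hreg hconn hd a
    have hb : b ∈ G.neighborFinset (x k) := (G.mem_neighborFinset _ _).mpr he
    rw [cycle_neighborFinset hreg hd hk1, mem_insert, mem_singleton] at hb
    rcases hb with rfl | rfl
    · refine ⟨k - 1, by omega, ?_⟩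
      rw [Nat.sub_add_cancel hk1, Sym2.eq_swap]
    · rcases Nat.lt_or_ge k n with hlt | hge
      · exact ⟨k, hlt, rfl⟩
      · have hk : k = n := le_antisymm hkn hge
        refine ⟨0, by omega, ?_⟩
        have h0 := cycle_period hreg hconn hd 0
        have h1 := cycle_period hreg hconn hd 1
        rw [Nat.zero_add] at h0
        rw [hk, h0, show n + 1 = 1 + n by omega, h1]

omit [DecidablePred (· ∈ T)] in
/-- The edges of one period are pairwise distinct. [folklore] -/
theorem cycle_edge_injOn : Set.InjOn (fun i => s(x i, x (i + 1))) (Set.Iio n) := by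
  have hinj := trailVert_injOn_card_of_two_regular hreg hconn.preconnected hd
  have h3 := cycle_three_le hreg hconn hd
  have key : ∀ i j, i < n → j < n → s(x i, x (i + 1)) = s(x j, x (j + 1)) → i < j → False := by
    intro i j hi hj heq hlt
    rcases Sym2.eq_iff.mp heq with ⟨h1, -⟩ | ⟨h1, h2⟩
    · exact absurd (hinj hi hj h1) (by omega)
    · rcases Nat.lt_or_ge (j + 1) n with hj1 | hj1
      · have := hinj hi hj1 h1
        omega
      · -- `j + 1 = n`: then `x_i = x_n = x_0`, so `i = 0`, and `x_1 = x_j`, so `j = 1`, `n = 2`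
        have hjn : j + 1 = n := by omega
        rw [hjn, ← Nat.zero_add (Fintype.card (Fin v)), cycle_period hreg hconn hd 0] at h1
        have hi0 : i = 0 := hinj hi (Set.mem_Iio.mpr (by omega)) h1
        subst hi0
        have hj' : 1 = j := hinj (Set.mem_Iio.mpr (by omega)) hj h2
        omega
  intro i hi j hj heq
  by_contra hne
  rcases Nat.lt_or_gt_of_ne hne with hlt | hgt
  · exact key i j hi hj heq hlt
  · exact key j i hj hi heq.symm hgt

/-- **One period carries the twist bit `1`** when exactly one edge is twisted. [cite: ChenFlumLiu2025, §1 (Fig. 1.1: "the twist … joins the two cycles")] -/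
theorem cycle_tau_card {e : Sym2 (Fin v)} (he : e ∈ G.edgeSet) (hT : ∀ f, f ∈ T ↔ f = e) : tau T x n = true := by
  rw [tau_eq_decide, filter_congr (q := fun i => s(x i, x (i + 1)) = e) (fun i _ => hT _)]
  obtain ⟨i₀, hi₀, hei₀⟩ := cycle_edge_index hreg hconn hd he
  have : ((range n).filter fun i => s(x i, x (i + 1)) = e) = {i₀} := by
    ext i
    rw [mem_filter, mem_range, mem_singleton]
    constructor
    · rintro ⟨hi, hie⟩
      exact cycle_edge_injOn hreg hconn hd hi hi₀ (hie.trans hei₀)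
    · rintro rfl
      exact ⟨hi₀, hei₀.symm⟩
  rw [this, card_singleton]
  exact decide_eq_true odd_one

/-- Periodicity of the twist bits: `τ_{k+n} = τ_k ⊕ τ_n`. [folklore] -/
theorem cycle_tau_add (k : ℕ) : tau T x (k + n) = xor (tau T x k) (tau T x n) := by
  induction k with
  | zero => rw [Nat.zero_add, tau_zero, Bool.false_xor]
  | succ k ih =>
    rw [show k + 1 + n = (k + n) + 1 by omega, tau_succ, ih, tau_succ, cycle_period hreg hconn hd,
      show k + n + 1 = (k + 1) + n by omega, cycle_period hreg hconn hd]
    cases tau T x k <;> cases tau T x n <;> cases twist T (x k) (x (k + 1)) <;> rfl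

omit hconn in
/-- The interior hypotheses of the simulation hold everywhere on a cycle. [folklore] -/
theorem cycle_hint (k : ℕ) (hk : 1 ≤ k) (_hK : k ≤ 2 * n) :
    G.neighborFinset (x k) = {x (k - 1), x (k + 1)} ∧ x (k - 1) ≠ x (k + 1) := by
  refine ⟨cycle_neighborFinset hreg hd hk, ?_⟩
  have := cycle_ne hreg hd (k - 1)
  rwa [show k - 1 + 2 = k + 1 by omega] at this

/-- The starting state of the double traversal: `((x₀, x₁, 1), (x₁, x₀, 1 ⊕ t₀))`. [folklore] -/
def cycleStart (T : Set (Sym2 (Fin v))) [DecidablePred (· ∈ T)] : CFIVertex G × CFIVertex G :=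
  (linkV (⟨(x 0, x 1), adj_trailVert_of_two_regular hreg hd 0⟩, xor true (tau T x 0)),
    linkV (conn G T (⟨(x 0, x 1), adj_trailVert_of_two_regular hreg hd 0⟩, xor true (tau T x 0))))

omit hconn in
/-- **The double traversal reaches the forward link `(x_k, x_{k+1}, 1 ⊕ τ_k)` after `3k` steps.**
[cite: ChenFlumLiu2025, Lemma 6.8] -/
theorem trailRun_cycleStart {k : ℕ} (hk : k ≤ 2 * n) :
    (trailRun (cfiGraph G T) (3 * k) (cycleStart hreg hd T)).1 =
      linkV (⟨(x k, x (k + 1)), adj_trailVert_of_two_regular hreg hd k⟩, xor true (tau T x k)) := by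
  have := (sim_trailRun (T := T) (trailVert G d) (K := 2 * n) (fun k _ => adj_trailVert_of_two_regular hreg hd k)
    (cycle_hint hreg hd) true k hk).1
  exact congrArg Prod.fst this

omit hconn in
/-- Everything on the double traversal is reachable from its start. [folklore] -/
theorem reachable_trailRun_cycleStart (j : ℕ) :
    (cfiGraph G T).Reachable (cycleStart hreg hd T).1 (trailRun (cfiGraph G T) j (cycleStart hreg hd T)).1 := by
  have hregZ := degree_eq_two_of_reg (T := T) hreg
  have hsZ : (cfiGraph G T).Adj (cycleStart hreg hd T).1 (cycleStart hreg hd T).2 := adj_linkV_conn _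
  rw [trailRun_eq_of_two_regular hregZ hsZ j]
  show (cfiGraph G T).Reachable (trailVert (cfiGraph G T) (cycleStart hreg hd T) 0)
    (trailVert (cfiGraph G T) (cycleStart hreg hd T) j)
  induction j with
  | zero => exact SimpleGraph.Reachable.refl _
  | succ j ih => exact ih.trans (adj_trailVert_of_two_regular hregZ hsZ j).reachable

/-- **Both forward links over every position are reached** when one period carries the twist bit
`1` (the second lap flips all letters). [cite: ChenFlumLiu2025, Lemma 6.8 (and Fig. 1.1)] -/
theorem reachable_forward_link (htau : tau T x n = true) {k : ℕ} (hk : k ≤ n) (c : Bool) :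
    (cfiGraph G T).Reachable (cycleStart hreg hd T).1
      (linkV (⟨(x k, x (k + 1)), adj_trailVert_of_two_regular hreg hd k⟩, c)) := by
  by_cases hc : c = xor true (tau T x k)
  · rw [hc, ← trailRun_cycleStart hreg hd (k := k) (by omega)]
    exact reachable_trailRun_cycleStart hreg hd _
  · have hc' : c = xor true (tau T x (k + n)) := by
      rw [cycle_tau_add hreg hconn hd, htau]
      revert hc
      cases c <;> cases tau T x k <;> simp
    have heq : linkV (⟨(x k, x (k + 1)), adj_trailVert_of_two_regular hreg hd k⟩, c) =
        linkV (⟨(x (k + n), x (k + n + 1)), adj_trailVert_of_two_regular hreg hd (k + n)⟩, xor true (tau T x (k + n))) := by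
      refine linkV_eq_iff.mpr ⟨(cycle_period hreg hconn hd k).symm, ?_, hc'⟩
      rw [show k + n + 1 = (k + 1) + n by omega, cycle_period hreg hconn hd]
    rw [heq, ← trailRun_cycleStart hreg hd (k := k + n) (by omega)]
    exact reachable_trailRun_cycleStart hreg hd _

/-- **`Y^e(C)` is connected for a cycle `C`.** [cite: ChenFlumLiu2025, Lemma 6.8 (and Fig. 1.1)] -/
theorem reachable_of_singleton {e : Sym2 (Fin v)} (he : e ∈ G.edgeSet) (hT : ∀ f, f ∈ T ↔ f = e)
    (y z : CFIVertex G) : (cfiGraph G T).Reachable y z := by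
  have htau := cycle_tau_card hreg hconn hd he hT
  -- every vertex is reachable from the start of the double traversal
  suffices hall : ∀ y, (cfiGraph G T).Reachable (cycleStart hreg hd T).1 y from (hall y).symm.trans (hall z)
  intro y
  -- every vertex is a forward link, or adjacent to one
  rcases linkV_or_midV y with ⟨⟨⟨⟨a, b⟩, hab⟩, c⟩, rfl⟩ | ⟨⟨a, S⟩, rfl⟩
  · obtain ⟨k, hk1, hkn, rfl⟩ := cycle_cover_pos hreg hconn hd a
    obtain ⟨j, rfl⟩ : ∃ j, k = j + 1 := ⟨k - 1, by omega⟩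
    have hb : b ∈ G.neighborFinset (x (j + 1)) := (G.mem_neighborFinset _ _).mpr hab
    rw [cycle_neighborFinset hreg hd hk1, Nat.add_sub_cancel, mem_insert, mem_singleton] at hb
    rcases hb with rfl | rfl
    · -- backward link: adjacent to the forward link over position `j`
      exact (reachable_forward_link hreg hconn hd htau (k := j) (by omega) (xor c (twist T (x (j + 1)) (x j)))).trans
        (adj_linkV_conn (T := T) (⟨(x (j + 1), x j), hab⟩, c)).symm.reachable
    · exact reachable_forward_link hreg hconn hd htau hkn c
  · obtain ⟨k, -, hkn, rfl⟩ := cycle_cover_pos hreg hconn hd a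
    have hadj : (cfiGraph G T).Adj (midV ⟨x k, S⟩)
        (linkV (⟨(x k, x (k + 1)), adj_trailVert_of_two_regular hreg hd k⟩, decide (x (k + 1) ∈ S.1))) :=
      adj_midV_linkV_of_iff _ S _ decide_eq_true_iff
    exact (reachable_forward_link hreg hconn hd htau hkn _).trans hadj.symm.reachable

end Cycle

section CycleVerdict

variable {ρ : CFIVertex G → CFIVertex G}

/-- **`Y^e(C)` is rejected for a cycle `C`**: no core, no dead end, connected.
[cite: ChenFlumLiu2025, Thm. 8.1 and Lemma 6.8] -/
theorem not_verdict_cycle_of_singleton (hreg : ∀ u, G.degree u = 2) (hconn : G.Connected) {e : Sym2 (Fin v)}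
    (he : e ∈ G.edgeSet) (hT : ∀ f, f ∈ T ↔ f = e) : ¬ Verdict (cfiGraph G T) ρ := by
  obtain ⟨u⟩ := hconn.nonempty
  obtain ⟨w, hw⟩ := (G.degree_pos_iff_exists_adj u).mp (by rw [hreg]; decide)
  have hlow : ∀ u, G.degree u ≤ 2 := fun u => by rw [hreg]
  rintro (⟨⟨x, hx⟩, -⟩ | ⟨-, ⟨x, hx1, -⟩ | ⟨-, y, z, hyz⟩⟩)
  · exact not_isCore_of_low hlow x hx
  · rw [degree_eq_two_of_reg hreg] at hx1
    exact absurd hx1 (by decide)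
  · exact hyz (reachable_of_singleton hreg hconn (d := (u, w)) hw he hT y z)

end CycleVerdict

/-! ### Main results -/

section Main

variable {ρ : CFIVertex G → CFIVertex G}

omit [DecidableRel G.Adj] [DecidablePred (· ∈ T)] in
/-- In a connected graph on at least two vertices every vertex has a neighbour. [folklore] -/
theorem degree_pos_of_connected [DecidableRel G.Adj] (hconn : G.Connected) (hv : 2 ≤ v) (u : Fin v) : 0 < G.degree u := by
  obtain ⟨u', hu'⟩ : ∃ u' : Fin v, u' ≠ u := by
    by_cases h : u = ⟨0, by omega⟩
    · exact ⟨⟨1, by omega⟩, fun h' => by rw [h] at h'; exact absurd (congrArg Fin.val h') (by simp)⟩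
    · exact ⟨⟨0, by omega⟩, fun h' => h h'.symm⟩
  obtain ⟨W⟩ := hconn.preconnected u u'
  cases W with
  | nil => exact absurd rfl hu'
  | cons h _ => exact (G.degree_pos_iff_exists_adj u).mpr ⟨_, h⟩

/-- **The even uncoloured CFI graph `CFI(G, T)`, `T` without edges, is ACCEPTED** by the parity
separator, for every connected base graph on at least two vertices and all admissible
representatives. [cite: ChenFlumLiu2025, Thm. 8.1] -/
theorem verdict_cfiGraph_of_forall_notMem (hconn : G.Connected) (hv : 2 ≤ v) (hT : ∀ f, f ∉ T)
    (hρ : IsRepMap (cfiGraph G T) ρ) : Verdict (cfiGraph G T) ρ := by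
  by_cases hhigh : ∃ u, 3 ≤ G.degree u
  · obtain ⟨u, h3⟩ := hhigh
    exact verdict_of_forall_notMem hT hρ h3
  · have hlow : ∀ u, G.degree u ≤ 2 := fun u => by
      by_contra h
      exact hhigh ⟨u, by omega⟩
    by_cases hleaf : ∃ ℓ, G.degree ℓ = 1
    · obtain ⟨ℓ, h1⟩ := hleaf
      exact verdict_path_of_forall_notMem hlow h1 hT
    · have hreg : ∀ u, G.degree u = 2 := fun u => by
        have h1 : G.degree u ≠ 1 := fun h => hleaf ⟨u, h⟩
        have := degree_pos_of_connected hconn hv u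
        have := hlow u
        omega
      exact verdict_cycle_of_forall_notMem hreg ⟨⟨0, by omega⟩⟩ hT

/-- **The odd uncoloured CFI graph `CFI(G, T)`, `T = {e}` a single edge, is REJECTED** by the
parity separator, for every connected base graph on at least two vertices, every edge `e` and all
admissible representatives. [cite: ChenFlumLiu2025, Thm. 8.1] -/
theorem not_verdict_cfiGraph_of_singleton (hconn : G.Connected) (hv : 2 ≤ v) {e : Sym2 (Fin v)} (he : e ∈ G.edgeSet)
    (hT : ∀ f, f ∈ T ↔ f = e) (hρ : IsRepMap (cfiGraph G T) ρ) : ¬ Verdict (cfiGraph G T) ρ := by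
  by_cases hhigh : ∃ u, 3 ≤ G.degree u
  · obtain ⟨u, h3⟩ := hhigh
    exact not_verdict_of_singleton hconn he hT hρ h3
  · have hlow : ∀ u, G.degree u ≤ 2 := fun u => by
      by_contra h
      exact hhigh ⟨u, by omega⟩
    by_cases hleaf : ∃ ℓ, G.degree ℓ = 1
    · obtain ⟨ℓ, h1⟩ := hleaf
      exact not_verdict_path_of_singleton hconn hlow h1 he hT
    · have hreg : ∀ u, G.degree u = 2 := fun u => by
        have h1 : G.degree u ≠ 1 := fun h => hleaf ⟨u, h⟩
        have := degree_pos_of_connected hconn hv u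
        have := hlow u
        omega
      exact not_verdict_cycle_of_singleton hreg hconn he hT

end Main

end Literature.ModelTheory.FiniteModelTheory

end

/-!
## Part III. The parity separator as a functional program on adjacency codes, and its polynomial running time

Topic `Literature/ModelTheory/FiniteModelTheory`; the algorithmic half of the discharge of
`ChenFlumLiu2025_ptime_separation` (`CFIUncoloured.lean`; Chen–Flum–Liu 2025, Thm. 8.1: "There is a
polynomial time algorithm accepting (all graphs isomorphic to) `Y(G)` for all `G` and rejecting the
corresponding `Ỹ(G)`").

III.1 (the program). The invariant `Verdict` of Part I is written as a
functional program `CFISep.verdictL n bits` over the size `n` and the adjacency bits of a graph code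
(vertices `0, …, n-1`, adjacency `TwoColouring.adj`), built only from `List.range`, `filter`,
`length`, `any`/`all`, `findIdx`, bounded iteration and the tree's least-label closure
`MinLabel.minLabels` (naive union–find): `nbrs`/`deg` (adjacency lists and degrees), `six` (an edge
lies on a six-cycle: four nested loops), `rigidEdges` and the core labels `lab` (`SameCore` ⇔ equal
labels, `sameCore_iff`), `isCoreL`, `isMidL`, `outNbrsL`/`firstMoveL`, the walk `exitsL`/`stepL`/
`walkL` (iterating `n` times while counting the moves: `trailLen`, `trailEnd`), `repL` (least middle
vertex of the core, by `findIdx` — the "arbitrary ordering of `V(Z)`" of the printed proof is the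
numbering), `corrBadL`/`pendBadL`, the counts `nCorrL`/`nPendL`, `firstNbrL`, the component labels
`ccLab` (`Reachable` ⇔ equal labels) and `verdictL`; and it computes the invariant:
**`CFISep.verdictL_eq_decide`**, `verdictL n bits = decide (Verdict (TwoColouring.graph n bits) (repMin _))`.

III.2 (polynomial time). Every function of the program is computed on codes by a polynomial-time
string function, assembled in the typed `FP` algebra `CodeFP` (`CodeFP.lean`, `CodeFPArith.lean`,
`CodeFPBudgets.lean`, `CodeFPClosure.lean`: projections, tests, `filter`/`all`/`any`/`findIdx` over raw
lists, `rawProduct`, `MinLabel.codeFP_minLabels`, and one bounded `foldl` for the walk, whose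
accumulator — two vertex numbers and a counter — stays linear in the input, `walkFP`), in the style of
`TwoColouringScanFP.lean`. Then, exactly as for `CPTCardInPTIME` (`CPTCardProgramProofs.lean`: a
string is the code of a graph iff re-encoding the graph read off it returns it,
`BGS.Sim.mem_graphClassLanguage_iff`), the class `CFISep.cfiSeparatingClass` of finite graphs accepted
by the separator (least representatives, adjacency decided classically — the verdict does not depend on
the decidability instance, `verdict_repMin_iff_of_decidableRel`) is polynomial-time decidable:
**`CFISep.isPTIMEClass_cfiSeparatingClass`**.
-/

noncomputable section

namespace Literature.ModelTheory.FiniteModelTheory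

open Finset Literature.Combinatorics.SimpleGraph Literature.Computability.Complexity
  Literature.Computability.Complexity.TwoColouring

namespace CFISep

/-! ### The program -/

section Program

variable (n : ℕ) (bits : List Bool)

/-- The adjacency list of vertex `i`. [folklore] -/
def nbrs (i : ℕ) : List ℕ := (List.range n).filter fun j => adj n bits i j

/-- The degree of vertex `i`. [folklore] -/
def deg (i : ℕ) : ℕ := (nbrs n bits i).length

/-- All fifteen disequalities of six naturals. [folklore] -/
def nodup6 (a b c d e f : ℕ) : Bool :=
  !(a == b) && !(a == c) && !(a == d) && !(a == e) && !(a == f) && !(b == c) && !(b == d) && !(b == e) &&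
    !(b == f) && !(c == d) && !(c == e) && !(c == f) && !(d == e) && !(d == f) && !(e == f)

/-- The innermost test of `six`: the cycle `i, j, a, b, c, d`. [folklore] -/
def sixBody (i j a b c d : ℕ) : Bool :=
  adj n bits j a && adj n bits a b && adj n bits b c && adj n bits c d && adj n bits d i && nodup6 i j a b c d

/-- `i, j` lie in this order on a six-cycle (`SixCycleThrough`). [cite: ChenFlumLiu2025, §8] -/
def six (i j : ℕ) : Bool :=
  (List.range n).any fun a => (List.range n).any fun b => (List.range n).any fun c =>
    (List.range n).any fun d => sixBody n bits i j a b c d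

/-- The rigid edges (ordered pairs). [cite: ChenFlumLiu2025, §8] -/
def rigidEdges : List (ℕ × ℕ) :=
  ((List.range n) ×ˢ (List.range n)).filter fun e => adj n bits e.1 e.2 && six n bits e.1 e.2

/-- The core labels: least vertex of each rigid component. [cite: ChenFlumLiu2025, §8 (the classes of `∼`)] -/
def coreLab : List ℕ := MinLabel.minLabels (rigidEdges n bits) n

/-- The core label of vertex `i`. [folklore] -/
def lab (i : ℕ) : ℕ := (coreLab n bits).getD i 0

/-- Core vertices. [cite: ChenFlumLiu2025, §8] -/
def isCoreL (i : ℕ) : Bool := decide (3 ≤ deg n bits i)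

/-- Middle vertices. [cite: ChenFlumLiu2025, Lemma 7.13] -/
def isMidL (i : ℕ) : Bool := isCoreL n bits i && (nbrs n bits i).all fun j => lab n bits i == lab n bits j

/-- The neighbours outside the core. [folklore] -/
def outNbrsL (i : ℕ) : List ℕ := (nbrs n bits i).filter fun j => !(lab n bits i == lab n bits j)

/-- The first move of the walk from a core link. [folklore] -/
def firstMoveL (i : ℕ) : ℕ := if (outNbrsL n bits i).length = 1 then (outNbrsL n bits i).headD 0 else i

/-- The exits of a state of the walk. [folklore] -/
def exitsL (s : ℕ × ℕ) : List ℕ := (nbrs n bits s.2).filter fun q => !(q == s.1)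

/-- One step of the walk. [folklore] -/
def stepL (s : ℕ × ℕ) : ℕ × ℕ := if (exitsL n bits s).length = 1 then (s.2, (exitsL n bits s).headD 0) else s

/-- `k` steps of the walk. [folklore] -/
def runL (k : ℕ) (s : ℕ × ℕ) : ℕ × ℕ := (stepL n bits)^[k] s

/-- The number of moving steps among the first `n`. [folklore] -/
def movesL (s : ℕ × ℕ) : ℕ := ((List.range n).filter fun k => decide ((exitsL n bits (runL n bits k s)).length = 1)).length

/-- One round of the counting walk: step and count. [folklore] -/
def walkStep (acc : (ℕ × ℕ) × ℕ) : (ℕ × ℕ) × ℕ :=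
  (stepL n bits acc.1, acc.2 + if (exitsL n bits acc.1).length = 1 then 1 else 0)

/-- The counting walk: `n` rounds from `(s, 0)`. [folklore] -/
def walkL (s : ℕ × ℕ) : (ℕ × ℕ) × ℕ := (walkStep n bits)^[n] (s, 0)

/-- The length of the maximal walk (`trailLen`). [folklore] -/
def lenL (s : ℕ × ℕ) : ℕ := (walkL n bits s).2

/-- The end of the maximal walk (`trailEnd`). [folklore] -/
def endL (s : ℕ × ℕ) : ℕ := (walkL n bits s).1.2

/-- The least middle vertex of the core of `i` (`repMin`; `i` if none). [cite: ChenFlumLiu2025, §8 (an arbitrary ordering)] -/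
def repL (i : ℕ) : ℕ :=
  if (List.range n).findIdx (fun j => (lab n bits j == lab n bits i) && isMidL n bits j) < n then
    (List.range n).findIdx (fun j => (lab n bits j == lab n bits i) && isMidL n bits j)
  else i

/-- Adjacency to the representative. [folklore] -/
def phi (i : ℕ) : Bool := adj n bits i (repL n bits i)

/-- The start of the walk from a core link. [folklore] -/
def linkStartL (i : ℕ) : ℕ × ℕ := (i, firstMoveL n bits i)

/-- Bad core links of corridor type. [cite: ChenFlumLiu2025, §8] -/
def corrBadL (i : ℕ) : Bool :=
  isCoreL n bits (endL n bits (linkStartL n bits i)) && !(phi n bits i == phi n bits (endL n bits (linkStartL n bits i)))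

/-- Bad core links of pendant type. [cite: ChenFlumLiu2025, §8] -/
def pendBadL (i : ℕ) : Bool :=
  !isCoreL n bits (endL n bits (linkStartL n bits i)) &&
    ((phi n bits i && (lenL n bits (linkStartL n bits i) % 3 == 0)) ||
      (!phi n bits i && (lenL n bits (linkStartL n bits i) % 3 == 1)))

/-- The core links. [cite: ChenFlumLiu2025, Lemma 7.13] -/
def coreLinksL : List ℕ := (List.range n).filter fun i => isCoreL n bits i && !isMidL n bits i

/-- The number of bad core links of corridor type. [folklore] -/
def nCorrL : ℕ := ((coreLinksL n bits).filter (corrBadL n bits)).length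

/-- The number of bad core links of pendant type. [folklore] -/
def nPendL : ℕ := ((coreLinksL n bits).filter (pendBadL n bits)).length

/-- The unique neighbour of a vertex of degree one (`firstNbr`). [folklore] -/
def firstNbrL (i : ℕ) : ℕ := if (nbrs n bits i).length = 1 then (nbrs n bits i).headD 0 else i

/-- All edges (ordered pairs). [folklore] -/
def allEdges : List (ℕ × ℕ) := ((List.range n) ×ˢ (List.range n)).filter fun e => adj n bits e.1 e.2

/-- The connected-component labels. [folklore] -/
def ccLab : List ℕ := MinLabel.minLabels (allEdges n bits) n

/-- **The verdict of the program.** [cite: ChenFlumLiu2025, Thm. 8.1] -/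
def verdictL : Bool :=
  ((List.range n).any (isCoreL n bits) && ((nCorrL n bits / 4 + nPendL n bits / 2) % 2 == 0)) ||
    (!(List.range n).any (isCoreL n bits) &&
      (((List.range n).any fun i => (deg n bits i == 1) && !(lenL n bits (i, firstNbrL n bits i) % 3 == 1)) ||
        (((List.range n).all fun i => deg n bits i == 2) &&
          (List.range n).any fun u => (List.range n).any fun w =>
            !((ccLab n bits).getD u 0 == (ccLab n bits).getD w 0))))

end Program

/-! ### Lists over `range n` versus finsets over `Fin n` -/

section Bridge

variable {n : ℕ}

/-- A finset of `Fin n` read as a finset of naturals. [folklore] -/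
abbrev valF (s : Finset (Fin n)) : Finset ℕ := s.map Fin.valEmbedding

/-- Membership in `valF`. [folklore] -/
theorem mem_valF {s : Finset (Fin n)} {a : ℕ} : a ∈ valF s ↔ ∃ h : a < n, (⟨a, h⟩ : Fin n) ∈ s := by
  rw [Finset.mem_map]
  constructor
  · rintro ⟨x, hx, rfl⟩
    exact ⟨x.isLt, hx⟩
  · rintro ⟨h, hx⟩
    exact ⟨⟨a, h⟩, hx, rfl⟩

/-- `valF` is injective. [folklore] -/
theorem valF_injective : Function.Injective (valF (n := n)) := fun _ _ h => Finset.map_injective _ h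

/-- `valF` preserves cardinalities. [folklore] -/
theorem card_valF (s : Finset (Fin n)) : (valF s).card = s.card := Finset.card_map _

/-- A filtered finset of `Fin n` is the filtered range. [folklore] -/
theorem valF_filter_univ (P : ℕ → Bool) :
    valF (Finset.univ.filter fun j : Fin n => P j.val = true) = ((List.range n).filter P).toFinset := by
  ext a
  rw [mem_valF, List.mem_toFinset, List.mem_filter, List.mem_range]
  constructor
  · rintro ⟨h, hx⟩
    rw [Finset.mem_filter] at hx
    exact ⟨h, hx.2⟩
  · rintro ⟨h, hP⟩
    exact ⟨h, Finset.mem_filter.mpr ⟨Finset.mem_univ _, hP⟩⟩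

/-- Filters of the range have no duplicates. [folklore] -/
theorem nodup_filter_range (P : ℕ → Bool) : ((List.range n).filter P).Nodup :=
  List.Nodup.filter _ List.nodup_range

/-- **Counting over `Fin n` is counting over `range n`.** [folklore] -/
theorem card_filter_univ_eq (P : ℕ → Bool) :
    (Finset.univ.filter fun j : Fin n => P j.val = true).card = ((List.range n).filter P).length := by
  rw [← card_valF, valF_filter_univ, List.toFinset_card_of_nodup (nodup_filter_range P)]

/-- A finset of `Fin n` whose values are a singleton list. [folklore] -/
theorem eq_singleton_of_valF_eq {s : Finset (Fin n)} {q : ℕ} (hq : q < n) (h : valF s = {q}) :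
    s = {(⟨q, hq⟩ : Fin n)} := by
  apply valF_injective
  rw [h]
  ext a
  simp

/-- A one-element filtered list is the singleton of its head. [folklore] -/
theorem filter_eq_singleton_headD {l : List ℕ} (h : l.length = 1) (d : ℕ) : l = [l.headD d] := by
  match l, h with
  | [a], _ => rfl

/-- Existence over `Fin n` is `any` over the range. [folklore] -/
theorem exists_fin_iff_any (P : ℕ → Bool) : (∃ j : Fin n, P j.val = true) ↔ (List.range n).any P = true := by
  rw [List.any_eq_true]
  constructor
  · rintro ⟨j, hj⟩
    exact ⟨j.val, List.mem_range.mpr j.isLt, hj⟩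
  · rintro ⟨a, ha, hP⟩
    exact ⟨⟨a, List.mem_range.mp ha⟩, hP⟩

/-- Universal quantification over `Fin n` is `all` over the range. [folklore] -/
theorem forall_fin_iff_all (P : ℕ → Bool) : (∀ j : Fin n, P j.val = true) ↔ (List.range n).all P = true := by
  rw [List.all_eq_true]
  constructor
  · intro h a ha
    exact h ⟨a, List.mem_range.mp ha⟩
  · intro h j
    exact h j.val (List.mem_range.mpr j.isLt)

end Bridge

/-! ### The program computes the invariant -/

section Agree

/-- `Verdict` is decidable. [folklore] -/
instance instDecidableVerdict {V : Type*} [Fintype V] [DecidableEq V] (W : SimpleGraph V) [DecidableRel W.Adj]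
    (ρ : V → V) : Decidable (Verdict W ρ) := by
  unfold Verdict
  infer_instance

variable (n : ℕ) (bits : List Bool)

local notation "Z" => TwoColouring.graph n bits

/-- Adjacency, read by the program. [folklore] -/
theorem adj_iff (i j : Fin n) : (Z).Adj i j ↔ adj n bits i.val j.val = true := graph_adj n bits i j

/-- **The neighbourhood is the adjacency list.** [folklore] -/
theorem valF_neighborFinset (i : Fin n) : valF ((Z).neighborFinset i) = (nbrs n bits i.val).toFinset := by
  have : (Z).neighborFinset i = Finset.univ.filter fun j : Fin n => adj n bits i.val j.val = true := by
    ext j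
    rw [SimpleGraph.mem_neighborFinset, Finset.mem_filter, adj_iff]
    simp
  rw [this, valF_filter_univ]
  rfl

/-- Adjacency lists have no duplicates. [folklore] -/
theorem nbrs_nodup (i : ℕ) : (nbrs n bits i).Nodup := nodup_filter_range _

/-- **The degree is the length of the adjacency list.** [folklore] -/
theorem degree_eq (i : Fin n) : (Z).degree i = deg n bits i.val := by
  rw [← SimpleGraph.card_neighborFinset_eq_degree, ← card_valF, valF_neighborFinset,
    List.toFinset_card_of_nodup (nbrs_nodup n bits _)]
  rfl

/-- `IsCore` is `isCoreL`. [folklore] -/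
theorem isCore_iff (i : Fin n) : IsCore (Z) i ↔ isCoreL n bits i.val = true := by
  unfold IsCore isCoreL
  rw [degree_eq, decide_eq_true_iff]

/-- The fifteen disequalities. [folklore] -/
theorem nodup6_iff (a b c d e f : Fin n) :
    [a, b, c, d, e, f].Nodup ↔ nodup6 a.val b.val c.val d.val e.val f.val = true := by
  rw [nodup_six_iff]
  unfold nodup6
  simp only [Bool.and_eq_true, Bool.not_eq_true', beq_eq_false_iff_ne, ne_eq, Fin.val_inj]
  tauto

/-- **`SixCycleThrough` is `six`.** [cite: ChenFlumLiu2025, §8] -/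
theorem sixCycleThrough_iff (i j : Fin n) : SixCycleThrough (Z) i j ↔ six n bits i.val j.val = true := by
  unfold SixCycleThrough six
  rw [← exists_fin_iff_any]
  refine exists_congr fun a => ?_
  rw [← exists_fin_iff_any]
  refine exists_congr fun b => ?_
  rw [← exists_fin_iff_any]
  refine exists_congr fun c => ?_
  rw [← exists_fin_iff_any]
  refine exists_congr fun d => ?_
  unfold sixBody
  rw [nodup6_iff, adj_iff, adj_iff, adj_iff, adj_iff, adj_iff]
  simp only [Bool.and_eq_true]
  tauto

/-- The rigid edges, read by the program. [folklore] -/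
theorem mem_rigidEdges {a b : ℕ} :
    (a, b) ∈ rigidEdges n bits ↔ ∃ (ha : a < n) (hb : b < n), (rigidGraph (Z)).Adj ⟨a, ha⟩ ⟨b, hb⟩ := by
  unfold rigidEdges
  rw [List.mem_filter, List.mem_product, List.mem_range, List.mem_range]
  constructor
  · rintro ⟨⟨ha, hb⟩, h⟩
    rw [Bool.and_eq_true] at h
    refine ⟨ha, hb, ?_⟩
    show (Z).Adj ⟨a, ha⟩ ⟨b, hb⟩ ∧ SixCycleThrough (Z) ⟨a, ha⟩ ⟨b, hb⟩
    rw [adj_iff, sixCycleThrough_iff]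
    exact h
  · rintro ⟨ha, hb, h⟩
    have h' : (Z).Adj ⟨a, ha⟩ ⟨b, hb⟩ ∧ SixCycleThrough (Z) ⟨a, ha⟩ ⟨b, hb⟩ := h
    rw [adj_iff, sixCycleThrough_iff] at h'
    exact ⟨⟨ha, hb⟩, by rw [Bool.and_eq_true]; exact h'⟩

/-- All rigid edges lie inside `[0, n)`. [folklore] -/
theorem rigidEdges_lt : ∀ e ∈ rigidEdges n bits, e.1 < n ∧ e.2 < n := by
  rintro ⟨a, b⟩ h
  obtain ⟨ha, hb, -⟩ := (mem_rigidEdges n bits).mp h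
  exact ⟨ha, hb⟩

/-- The equivalence generated by an edge list inside `[0, n)` that reads a symmetric adjacency is
reachability. [folklore] -/
theorem eqvGen_iff_reachable {E : List (ℕ × ℕ)} {R : SimpleGraph (Fin n)}
    (hE : ∀ {a b : ℕ}, (a, b) ∈ E ↔ ∃ (ha : a < n) (hb : b < n), R.Adj ⟨a, ha⟩ ⟨b, hb⟩) (i j : Fin n) :
    Relation.EqvGen (MinLabel.Adj E) i.val j.val ↔ R.Reachable i j := by
  constructor
  · -- along `EqvGen`, every vertex met is `< n` (it is `i` or an endpoint of an edge)
    suffices key : ∀ x y : ℕ, Relation.EqvGen (MinLabel.Adj E) x y →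
        ∀ hx : x < n, ∃ hy : y < n, R.Reachable ⟨x, hx⟩ ⟨y, hy⟩ by
      intro h
      obtain ⟨hy, hr⟩ := key _ _ h i.isLt
      exact hr
    intro x y h
    induction h with
    | rel a b hab =>
      intro ha
      obtain ⟨ha', hb, hadj⟩ := hE.mp hab
      exact ⟨hb, hadj.reachable⟩
    | refl a => intro ha; exact ⟨ha, SimpleGraph.Reachable.refl _⟩
    | symm a b hab ih =>
      intro hb
      -- `a < n`: `a = b` or `a` is an endpoint of an edge
      have ha : a < n := by
        rcases MinLabel.eq_or_endpoints_of_eqvGen E hab with rfl | ⟨⟨e, he, hae⟩, -⟩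
        · exact hb
        · obtain ⟨e1, e2⟩ := e
          obtain ⟨h1, h2, -⟩ := hE.mp he
          rcases hae with rfl | rfl
          · exact h1
          · exact h2
      obtain ⟨_, hr⟩ := ih ha
      exact ⟨ha, hr.symm⟩
    | trans a b c _ _ ih₁ ih₂ =>
      intro ha
      obtain ⟨hb, hr₁⟩ := ih₁ ha
      obtain ⟨hc, hr₂⟩ := ih₂ hb
      exact ⟨hc, hr₁.trans hr₂⟩
  · intro h
    rw [SimpleGraph.reachable_iff_reflTransGen] at h
    induction h with
    | refl => exact Relation.EqvGen.refl _
    | tail _ hab ih => exact ih.trans _ _ _ (Relation.EqvGen.rel _ _ (hE.mpr ⟨_, _, hab⟩))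

/-- Labels of the least-label closure agree iff the vertices are related. [folklore] -/
theorem getD_minLabels_eq_iff {E : List (ℕ × ℕ)} (hE : ∀ e ∈ E, e.1 < n ∧ e.2 < n) {a b : ℕ} (ha : a < n) (hb : b < n) :
    (MinLabel.minLabels E n).getD a 0 = (MinLabel.minLabels E n).getD b 0 ↔ Relation.EqvGen (MinLabel.Adj E) a b := by
  rw [MinLabel.getD_minLabels E hE ha, MinLabel.getD_minLabels E hE hb]
  constructor
  · intro h
    have h1 := MinLabel.eqvGen_classMin E a
    have h2 := MinLabel.eqvGen_classMin E b
    rw [h] at h1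
    exact (h1.symm _ _).trans _ _ _ h2
  · exact MinLabel.classMin_eq_of_eqvGen E

/-- **`SameCore` is equality of core labels.** [cite: ChenFlumLiu2025, §8 (the classes of `∼`)] -/
theorem sameCore_iff (i j : Fin n) : SameCore (Z) i j ↔ lab n bits i.val = lab n bits j.val := by
  unfold SameCore lab coreLab
  rw [getD_minLabels_eq_iff n (rigidEdges_lt n bits) i.isLt j.isLt,
    eqvGen_iff_reachable n (fun {a b} => mem_rigidEdges n bits)]

/-- `IsMid` is `isMidL`. [folklore] -/
theorem isMid_iff (i : Fin n) : IsMid (Z) i ↔ isMidL n bits i.val = true := by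
  unfold IsMid isMidL
  rw [Bool.and_eq_true, isCore_iff, List.all_eq_true]
  refine and_congr_right fun _ => ⟨fun h a ha => ?_, fun h j hj => ?_⟩
  · rw [nbrs, List.mem_filter, List.mem_range] at ha
    have := h ⟨a, ha.1⟩ ((adj_iff n bits _ _).mpr ha.2)
    rw [sameCore_iff] at this
    exact beq_iff_eq.mpr this
  · rw [sameCore_iff]
    have := h j.val (by rw [nbrs, List.mem_filter, List.mem_range]; exact ⟨j.isLt, (adj_iff n bits _ _).mp hj⟩)
    exact beq_iff_eq.mp this

/-- `outNbrs` is `outNbrsL`. [folklore] -/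
theorem valF_outNbrs (i : Fin n) : valF (outNbrs (Z) i) = (outNbrsL n bits i.val).toFinset := by
  have : outNbrs (Z) i = Finset.univ.filter fun j : Fin n =>
      (fun a => adj n bits i.val a && !(lab n bits i.val == lab n bits a)) j.val = true := by
    ext j
    rw [mem_outNbrs, Finset.mem_filter, adj_iff, sameCore_iff]
    simp
  rw [this]
  refine (valF_filter_univ (n := n) (fun a => adj n bits i.val a && !(lab n bits i.val == lab n bits a))).trans ?_
  rw [outNbrsL, nbrs, List.filter_filter]
  congr 1
  exact List.filter_congr fun x _ => by rw [Bool.and_comm]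

/-- A valued finset which is a one-element list. [folklore] -/
theorem eq_singleton_of_toFinset {s : Finset (Fin n)} {l : List ℕ} (hlt : ∀ a ∈ l, a < n)
    (h : valF s = l.toFinset) (h1 : l.length = 1) (d : ℕ) :
    ∃ hq : l.headD d < n, s = {⟨l.headD d, hq⟩} := by
  have hl' := filter_eq_singleton_headD h1 d
  have hq : l.headD d < n := hlt _ (by rw [hl']; exact List.mem_singleton.mpr rfl)
  refine ⟨hq, eq_singleton_of_valF_eq hq ?_⟩
  rw [h, hl']
  rfl

/-- The length of a list equals the cardinality of a finset it values. [folklore] -/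
theorem card_eq_length_of_toFinset {s : Finset (Fin n)} {l : List ℕ} (hl : l.Nodup) (h : valF s = l.toFinset) :
    s.card = l.length := by
  rw [← card_valF, h, List.toFinset_card_of_nodup hl]

/-- **The first move is the program's.** [folklore] -/
theorem firstMove_eq (i : Fin n) : (firstMove (Z) i).val = firstMoveL n bits i.val := by
  have hnd : (outNbrsL n bits i.val).Nodup := (nodup_filter_range _).filter _
  have hlt : ∀ a ∈ outNbrsL n bits i.val, a < n := fun a ha => by
    rw [outNbrsL, List.mem_filter, nbrs, List.mem_filter, List.mem_range] at ha
    exact ha.1.1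
  have hcard := card_eq_length_of_toFinset n hnd (valF_outNbrs n bits i)
  unfold firstMoveL
  by_cases h1 : (outNbrsL n bits i.val).length = 1
  · obtain ⟨hq, hs⟩ := eq_singleton_of_toFinset n hlt (valF_outNbrs n bits i) h1 0
    rw [firstMove_eq_of_outNbrs_eq hs, if_pos h1]
  · rw [firstMove_eq_self (by rw [hcard]; exact h1), if_neg h1]

/-! #### The walk -/

/-- The exits are the program's. [folklore] -/
theorem valF_exits (s : Fin n × Fin n) : valF (exits (Z) s) = (exitsL n bits (s.1.val, s.2.val)).toFinset := by
  ext a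
  rw [mem_valF, List.mem_toFinset, exitsL, List.mem_filter, nbrs, List.mem_filter, List.mem_range]
  simp only [mem_exits, adj_iff, Bool.not_eq_true', beq_eq_false_iff_ne, ne_eq, Fin.ext_iff]
  constructor
  · rintro ⟨h, hadj, hne⟩
    exact ⟨⟨h, hadj⟩, hne⟩
  · rintro ⟨⟨h, hadj⟩, hne⟩
    exact ⟨h, hadj, hne⟩

/-- The exits list has no duplicates and lies in `[0, n)`. [folklore] -/
theorem exitsL_nodup (s : ℕ × ℕ) : (exitsL n bits s).Nodup := (nodup_filter_range _).filter _

/-- See `exitsL_nodup`. [folklore] -/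
theorem exitsL_lt (s : ℕ × ℕ) : ∀ a ∈ exitsL n bits s, a < n := fun a ha => by
  rw [exitsL, List.mem_filter, nbrs, List.mem_filter, List.mem_range] at ha
  exact ha.1.1

/-- Moving is the program's test. [folklore] -/
theorem moves_iff (s : Fin n × Fin n) : Moves (Z) s ↔ (exitsL n bits (s.1.val, s.2.val)).length = 1 := by
  unfold Moves
  rw [card_eq_length_of_toFinset n (exitsL_nodup n bits _) (valF_exits n bits s)]

/-- **One step is the program's.** [folklore] -/
theorem trailStep_eq (s : Fin n × Fin n) :
    ((trailStep (Z) s).1.val, (trailStep (Z) s).2.val) = stepL n bits (s.1.val, s.2.val) := by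
  unfold stepL
  by_cases h1 : (exitsL n bits (s.1.val, s.2.val)).length = 1
  · obtain ⟨hq, hs⟩ := eq_singleton_of_toFinset n (exitsL_lt n bits _) (valF_exits n bits s) h1 0
    rw [trailStep_of_exits_eq hs, if_pos h1]
  · rw [trailStep_of_not_moves (by rw [moves_iff]; exact h1), if_neg h1]

/-- **The run is the program's.** [folklore] -/
theorem trailRun_eq (s : Fin n × Fin n) (k : ℕ) :
    ((trailRun (Z) k s).1.val, (trailRun (Z) k s).2.val) = runL n bits k (s.1.val, s.2.val) := by
  induction k with
  | zero => rfl
  | succ k ih =>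
    rw [trailRun_succ, trailStep_eq, ih]
    exact (Function.iterate_succ_apply' (stepL n bits) k _).symm

/-- The number of moves is the program's. [folklore] -/
theorem trailMoves_eq (s : Fin n × Fin n) : trailMoves (Z) n s = movesL n bits (s.1.val, s.2.val) := by
  unfold trailMoves movesL
  have : ((Finset.range n).filter fun k => Moves (Z) (trailRun (Z) k s)) =
      ((List.range n).filter fun k => decide ((exitsL n bits (runL n bits k (s.1.val, s.2.val))).length = 1)).toFinset := by
    ext k
    rw [Finset.mem_filter, Finset.mem_range, List.mem_toFinset, List.mem_filter, List.mem_range, moves_iff,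
      decide_eq_true_iff]
    rw [show ((trailRun (Z) k s).1.val, (trailRun (Z) k s).2.val) = runL n bits k (s.1.val, s.2.val) from
      trailRun_eq n bits s k]
  rw [this, List.toFinset_card_of_nodup (nodup_filter_range _)]

/-- The counting walk steps and counts. [folklore] -/
theorem walkStep_iterate (s : ℕ × ℕ) (k : ℕ) :
    (walkStep n bits)^[k] (s, 0) =
      (runL n bits k s, ((List.range k).filter fun j => decide ((exitsL n bits (runL n bits j s)).length = 1)).length) := by
  induction k with
  | zero => rfl
  | succ k ih =>
    rw [Function.iterate_succ_apply', ih]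
    have hrun : runL n bits (k + 1) s = stepL n bits (runL n bits k s) := by
      unfold runL
      rw [Function.iterate_succ_apply']
    rw [hrun, walkStep, List.range_succ, List.filter_append, List.length_append, List.filter_singleton]
    dsimp only
    by_cases h : (exitsL n bits (runL n bits k s)).length = 1
    · rw [if_pos h, decide_eq_true h]
      rfl
    · rw [if_neg h, decide_eq_false h]
      rfl

/-- **The length of the maximal walk is the program's.** [folklore] -/
theorem trailLen_eq (s : Fin n × Fin n) : trailLen (Z) s = lenL n bits (s.1.val, s.2.val) := by
  unfold trailLen lenL walkL
  rw [Fintype.card_fin, walkStep_iterate, trailMoves_eq]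
  rfl

/-- **The end of the maximal walk is the program's.** [folklore] -/
theorem trailEnd_eq (s : Fin n × Fin n) : (trailEnd (Z) s).val = endL n bits (s.1.val, s.2.val) := by
  unfold trailEnd endL walkL
  rw [Fintype.card_fin, walkStep_iterate]
  exact congrArg Prod.snd (trailRun_eq n bits s n)

/-! #### Representatives, bad links, counts -/

/-- **The least representative is the program's.** [cite: ChenFlumLiu2025, §8 (an arbitrary ordering of the vertices)] -/
theorem repMin_eq (x : Fin n) : (repMin (Z) x).val = repL n bits x.val := by
  set P : ℕ → Bool := fun a => (lab n bits a == lab n bits x.val) && isMidL n bits a with hP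
  have hmids : midsOf (Z) x = Finset.univ.filter fun j : Fin n => P j.val = true := by
    ext j
    rw [mem_midsOf, Finset.mem_filter, sameCore_iff, isMid_iff]
    show _ ↔ j ∈ Finset.univ ∧ ((lab n bits j.val == lab n bits x.val) && isMidL n bits j.val) = true
    rw [Bool.and_eq_true, beq_iff_eq]
    simp only [Finset.mem_univ, true_and]
    constructor
    · rintro ⟨h1, h2⟩; exact ⟨h1.symm, h2⟩
    · rintro ⟨h1, h2⟩; exact ⟨h1.symm, h2⟩
  have hk : (List.range n).findIdx P < n ↔ (midsOf (Z) x).Nonempty := by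
    rw [hmids]
    have h0 := List.findIdx_lt_length (xs := List.range n) (p := P)
    rw [List.length_range] at h0
    rw [h0]
    constructor
    · rintro ⟨a, ha, hPa⟩
      exact ⟨⟨a, List.mem_range.mp ha⟩, Finset.mem_filter.mpr ⟨Finset.mem_univ _, hPa⟩⟩
    · rintro ⟨j, hj⟩
      exact ⟨j.val, List.mem_range.mpr j.isLt, (Finset.mem_filter.mp hj).2⟩
  show (repMin (Z) x).val = if (List.range n).findIdx P < n then (List.range n).findIdx P else x.val
  unfold repMin
  by_cases hne : (midsOf (Z) x).Nonempty
  · have hlt : (List.range n).findIdx P < n := hk.mpr hne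
    rw [dif_pos hne, if_pos hlt]
    have hPk : P ((List.range n).findIdx P) = true := by
      have := List.findIdx_getElem (xs := List.range n) (p := P) (w := by rw [List.length_range]; exact hlt)
      rwa [List.getElem_range] at this
    have hkmem : (⟨(List.range n).findIdx P, hlt⟩ : Fin n) ∈ midsOf (Z) x := by
      rw [hmids]
      exact Finset.mem_filter.mpr ⟨Finset.mem_univ _, hPk⟩
    have hmin : ∀ j ∈ midsOf (Z) x, (⟨(List.range n).findIdx P, hlt⟩ : Fin n) ≤ j := by
      intro j hj
      rw [hmids, Finset.mem_filter] at hj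
      by_contra hlt'
      have hjk : j.val < (List.range n).findIdx P := by
        rw [not_le, Fin.lt_def] at hlt'
        exact hlt'
      have := List.not_of_lt_findIdx (p := P) (xs := List.range n) hjk
      simp only [List.getElem_range] at this
      rw [hj.2] at this
      exact Bool.noConfusion this
    have : (midsOf (Z) x).min' hne = ⟨(List.range n).findIdx P, hlt⟩ :=
      le_antisymm (Finset.min'_le _ _ hkmem) (Finset.le_min' _ _ _ hmin)
    rw [this]
  · rw [dif_neg hne, if_neg (fun h => hne (hk.mp h))]

/-- Adjacency to the representative is the program's bit. [folklore] -/
theorem adj_repMin_iff (x : Fin n) : (Z).Adj x (repMin (Z) x) ↔ phi n bits x.val = true := by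
  rw [adj_iff, repMin_eq]
  rfl

/-- The start of the walk from a core link is the program's. [folklore] -/
theorem linkStart_eq (x : Fin n) :
    ((linkStart (Z) x).1.val, (linkStart (Z) x).2.val) = linkStartL n bits x.val := by
  unfold linkStart linkStartL
  rw [firstMove_eq]

/-- The end of the walk from a core link is the program's. [folklore] -/
theorem trailEnd_linkStart_eq (x : Fin n) :
    (trailEnd (Z) (linkStart (Z) x)).val = endL n bits (linkStartL n bits x.val) := by
  rw [trailEnd_eq, linkStart_eq]

/-- The length of the walk from a core link is the program's. [folklore] -/
theorem trailLen_linkStart_eq (x : Fin n) :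
    trailLen (Z) (linkStart (Z) x) = lenL n bits (linkStartL n bits x.val) := by
  rw [trailLen_eq, linkStart_eq]

/-- **`CorrBad` is `corrBadL`.** [folklore] -/
theorem corrBad_iff (x : Fin n) : CorrBad (Z) (repMin (Z)) x ↔ corrBadL n bits x.val = true := by
  unfold CorrBad corrBadL
  rw [isCore_iff, adj_repMin_iff, adj_repMin_iff, trailEnd_linkStart_eq]
  generalize phi n bits x.val = a
  generalize phi n bits (endL n bits (linkStartL n bits x.val)) = b
  generalize isCoreL n bits (endL n bits (linkStartL n bits x.val)) = c
  cases a <;> cases b <;> cases c <;> simp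

/-- **`PendBad` is `pendBadL`.** [folklore] -/
theorem pendBad_iff (x : Fin n) : PendBad (Z) (repMin (Z)) x ↔ pendBadL n bits x.val = true := by
  unfold PendBad pendBadL
  rw [isCore_iff, adj_repMin_iff, trailEnd_linkStart_eq, trailLen_linkStart_eq]
  generalize phi n bits x.val = a
  generalize isCoreL n bits (endL n bits (linkStartL n bits x.val)) = c
  generalize lenL n bits (linkStartL n bits x.val) % 3 = r
  cases a <;> cases c <;> simp

/-- The core links are the program's. [folklore] -/
theorem coreLinks_eq : coreLinks (Z) = Finset.univ.filter fun j : Fin n =>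
    (fun a => isCoreL n bits a && !isMidL n bits a) j.val = true := by
  ext j
  rw [mem_coreLinks, Finset.mem_filter, isCore_iff, isMid_iff]
  simp

/-- Counting a program predicate over the core links. [folklore] -/
theorem card_filter_coreLinks (Q : Fin n → Prop) [DecidablePred Q] (q : ℕ → Bool) (hQ : ∀ j : Fin n, Q j ↔ q j.val = true) :
    ((coreLinks (Z)).filter Q).card = ((coreLinksL n bits).filter q).length := by
  rw [coreLinks_eq, Finset.filter_filter, coreLinksL, List.filter_filter]
  have : (Finset.univ.filter fun a : Fin n => (fun a => isCoreL n bits a && !isMidL n bits a) a.val = true ∧ Q a) =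
      Finset.univ.filter fun j : Fin n => (fun a => (isCoreL n bits a && !isMidL n bits a) && q a) j.val = true := by
    refine Finset.filter_congr fun j _ => ?_
    rw [hQ]
    simp only [Bool.and_eq_true]
  rw [this]
  refine (card_filter_univ_eq (n := n) (fun a => (isCoreL n bits a && !isMidL n bits a) && q a)).trans ?_
  congr 1
  exact List.filter_congr fun a _ => by simp only [Bool.and_comm]

/-- `nCorr` is `nCorrL`. [folklore] -/
theorem nCorr_eq : nCorr (Z) (repMin (Z)) = nCorrL n bits :=
  card_filter_coreLinks n bits _ _ (corrBad_iff n bits)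

/-- `nPend` is `nPendL`. [folklore] -/
theorem nPend_eq : nPend (Z) (repMin (Z)) = nPendL n bits :=
  card_filter_coreLinks n bits _ _ (pendBad_iff n bits)

/-- **The unique neighbour is the program's.** [folklore] -/
theorem firstNbr_eq (x : Fin n) : (firstNbr (Z) x).val = firstNbrL n bits x.val := by
  have hlt : ∀ a ∈ nbrs n bits x.val, a < n := fun a ha => by
    rw [nbrs, List.mem_filter, List.mem_range] at ha
    exact ha.1
  have hcard := card_eq_length_of_toFinset n (nbrs_nodup n bits _) (valF_neighborFinset n bits x)
  unfold firstNbrL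
  by_cases h1 : (nbrs n bits x.val).length = 1
  · obtain ⟨hq, hs⟩ := eq_singleton_of_toFinset n hlt (valF_neighborFinset n bits x) h1 0
    rw [firstNbr_eq_of_neighborFinset_eq hs, if_pos h1]
  · rw [firstNbr_eq_self (by rw [hcard]; exact h1), if_neg h1]

/-- The edges, read by the program. [folklore] -/
theorem mem_allEdges {a b : ℕ} : (a, b) ∈ allEdges n bits ↔ ∃ (ha : a < n) (hb : b < n), (Z).Adj ⟨a, ha⟩ ⟨b, hb⟩ := by
  unfold allEdges
  rw [List.mem_filter, List.mem_product, List.mem_range, List.mem_range]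
  constructor
  · rintro ⟨⟨ha, hb⟩, h⟩
    exact ⟨ha, hb, (adj_iff n bits _ _).mpr h⟩
  · rintro ⟨ha, hb, h⟩
    exact ⟨⟨ha, hb⟩, (adj_iff n bits _ _).mp h⟩

/-- All edges lie inside `[0, n)`. [folklore] -/
theorem allEdges_lt : ∀ e ∈ allEdges n bits, e.1 < n ∧ e.2 < n := by
  rintro ⟨a, b⟩ h
  obtain ⟨ha, hb, -⟩ := (mem_allEdges n bits).mp h
  exact ⟨ha, hb⟩

/-- **Reachability is equality of component labels.** [folklore] -/
theorem reachable_iff (u w : Fin n) : (Z).Reachable u w ↔ (ccLab n bits).getD u.val 0 = (ccLab n bits).getD w.val 0 := by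
  unfold ccLab
  rw [getD_minLabels_eq_iff n (allEdges_lt n bits) u.isLt w.isLt,
    eqvGen_iff_reachable n (fun {a b} => mem_allEdges n bits)]

/-- **THE PROGRAM COMPUTES THE INVARIANT** (least representatives, vertices ordered by their
numbers). [cite: ChenFlumLiu2025, Thm. 8.1] -/
theorem verdict_iff : Verdict (Z) (repMin (Z)) ↔ verdictL n bits = true := by
  have hcore : (∃ x, IsCore (Z) x) ↔ (List.range n).any (isCoreL n bits) = true := by
    rw [← exists_fin_iff_any]
    exact exists_congr fun x => isCore_iff n bits x
  have heven : Even (nCorr (Z) (repMin (Z)) / 4 + nPend (Z) (repMin (Z)) / 2) ↔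
      ((nCorrL n bits / 4 + nPendL n bits / 2) % 2 == 0) = true := by
    rw [nCorr_eq, nPend_eq, beq_iff_eq, Nat.even_iff]
  have hdead : (∃ x, (Z).degree x = 1 ∧ trailLen (Z) (x, firstNbr (Z) x) % 3 ≠ 1) ↔
      ((List.range n).any fun i => (deg n bits i == 1) && !(lenL n bits (i, firstNbrL n bits i) % 3 == 1)) = true := by
    rw [← exists_fin_iff_any]
    refine exists_congr fun x => ?_
    rw [degree_eq, trailLen_eq, Bool.and_eq_true, beq_iff_eq, Bool.not_eq_true', beq_eq_false_iff_ne]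
    dsimp only
    rw [firstNbr_eq]
  have hreg : (∀ x, (Z).degree x = 2) ↔ ((List.range n).all fun i => deg n bits i == 2) = true := by
    rw [← forall_fin_iff_all]
    exact forall_congr' fun x => by rw [degree_eq, beq_iff_eq]
  have hconn : (∃ u w, ¬ (Z).Reachable u w) ↔
      ((List.range n).any fun u => (List.range n).any fun w => !((ccLab n bits).getD u 0 == (ccLab n bits).getD w 0)) = true := by
    rw [← exists_fin_iff_any]
    refine exists_congr fun u => ?_
    rw [← exists_fin_iff_any]
    refine exists_congr fun w => ?_
    rw [reachable_iff, Bool.not_eq_true', beq_eq_false_iff_ne]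
  unfold Verdict verdictL
  rw [hcore, heven, hdead, hreg, hconn]
  simp only [Bool.or_eq_true, Bool.and_eq_true, Bool.not_eq_true']
  constructor
  · rintro (⟨h1, h2⟩ | ⟨h1, h2⟩)
    · exact Or.inl ⟨h1, h2⟩
    · refine Or.inr ⟨?_, h2⟩
      simpa using h1
  · rintro (⟨h1, h2⟩ | ⟨h1, h2⟩)
    · exact Or.inl ⟨h1, h2⟩
    · refine Or.inr ⟨?_, h2⟩
      simpa using h1

/-- **`verdictL = decide Verdict`.** [cite: ChenFlumLiu2025, Thm. 8.1] -/
theorem verdictL_eq_decide : verdictL n bits = decide (Verdict (Z) (repMin (Z))) := by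
  rw [Bool.eq_iff_iff, decide_eq_true_iff, verdict_iff]

end Agree

end CFISep

end Literature.ModelTheory.FiniteModelTheory

end


noncomputable section

namespace Literature.ModelTheory.FiniteModelTheory

open _root_.Computability Polynomial Literature.Computability.Complexity Literature.Computability.Complexity.Classes
  Literature.Computability.Complexity.CodeFP Literature.Computability.Complexity.Brick
  Literature.Computability.Complexity.TwoColouring

namespace CFISep

/-! ### Encoders of the contexts -/

/-- Context `((m, v), i)`: size in unary, adjacency bits, one vertex. [folklore] -/
abbrev c1E : (ℕ × List Bool) × ℕ → List Bool := pairE mvE natE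

/-- Walk states `(p, c)`. [folklore] -/
abbrev stE : ℕ × ℕ → List Bool := pairE natE natE

/-- Context `((m, v), (p, c))`. [folklore] -/
abbrev c2E : (ℕ × List Bool) × (ℕ × ℕ) → List Bool := pairE mvE stE

/-- Accumulators of the walk `((p, c), count)`. [folklore] -/
abbrev accE : (ℕ × ℕ) × ℕ → List Bool := pairE stE natE

/-! ### Adjacency lists, degrees, six-cycles, rigid edges, labels -/

/-- **`nbrs` on codes.** [cite: AroraBarak2009, §1.3] -/
theorem nbrsFP : CodeFP c1E (rawE natE) (fun p => nbrs p.1.1 p.1.2 p.2) := by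
  have hp : CodeFP (pairE c1E natE) bitE (fun t => adj t.1.1.1 t.1.1.2 t.1.2 t.2) :=
    (adjFP.comp ((fst _ _).fst'.pair ((fst _ _).snd'.pair (snd _ _))) :)
  exact ((filter hp).comp ((CodeFP.id c1E).pair (urange.comp (fst _ _).fst'))).congr fun _ => rfl

/-- **`deg` on codes.** [cite: AroraBarak2009, §1.3] -/
theorem degFP : CodeFP c1E natE (fun p => deg p.1.1 p.1.2 p.2) :=
  ((natLength natE).comp nbrsFP).congr fun _ => rfl

/-- `nodup6` is the decision of `List.Nodup`. [folklore] -/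
theorem nodup6_eq_decide (a b c d e f : ℕ) : nodup6 a b c d e f = decide ([a, b, c, d, e, f].Nodup) := by
  rw [Bool.eq_iff_iff, decide_eq_true_iff, nodup_six_iff]
  unfold nodup6
  simp only [Bool.and_eq_true, Bool.not_eq_true', beq_eq_false_iff_ne, ne_eq]
  tauto

/-- Context of the innermost loop of `six`: `(((((m, v), (i, j)), a), b), c)`. [folklore] -/
abbrev c6E : ((((ℕ × List Bool) × (ℕ × ℕ)) × ℕ) × ℕ) × ℕ → List Bool :=
  pairE (pairE (pairE (pairE mvE stE) natE) natE) natE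

/-- **`sixBody` on codes.** [cite: AroraBarak2009, §1.3] -/
theorem sixBodyFP : CodeFP (pairE c6E natE) bitE
    (fun t => sixBody t.1.1.1.1.1.1 t.1.1.1.1.1.2 t.1.1.1.1.2.1 t.1.1.1.1.2.2 t.1.1.1.2 t.1.1.2 t.1.2 t.2) := by
  -- projections
  have hmv : CodeFP (pairE c6E natE) mvE (fun t => t.1.1.1.1.1) := (fst _ _).fst'.fst'.fst'.fst'
  have hi : CodeFP (pairE c6E natE) natE (fun t => t.1.1.1.1.2.1) := (fst _ _).fst'.fst'.fst'.snd'.fst'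
  have hj : CodeFP (pairE c6E natE) natE (fun t => t.1.1.1.1.2.2) := (fst _ _).fst'.fst'.fst'.snd'.snd'
  have ha : CodeFP (pairE c6E natE) natE (fun t => t.1.1.1.2) := (fst _ _).fst'.fst'.snd'
  have hb : CodeFP (pairE c6E natE) natE (fun t => t.1.1.2) := (fst _ _).fst'.snd'
  have hc : CodeFP (pairE c6E natE) natE (fun t => t.1.2) := (fst _ _).snd'
  have hd : CodeFP (pairE c6E natE) natE (fun t => t.2) := snd _ _
  -- adjacencies
  have hadj : ∀ {x y : (((((ℕ × List Bool) × (ℕ × ℕ)) × ℕ) × ℕ) × ℕ) × ℕ → ℕ},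
      CodeFP (pairE c6E natE) natE x → CodeFP (pairE c6E natE) natE y →
        CodeFP (pairE c6E natE) bitE (fun t => adj t.1.1.1.1.1.1 t.1.1.1.1.1.2 (x t) (y t)) :=
    fun hx hy => (adjFP.comp (hmv.pair (hx.pair hy)) :)
  -- the list `[i, j, a, b, c, d]` and its `Nodup` test
  have hlist : CodeFP (pairE c6E natE) (rawE natE)
      (fun t => [t.1.1.1.1.2.1, t.1.1.1.1.2.2, t.1.1.1.2, t.1.1.2, t.1.2, t.2]) :=
    ((rawCons natE).comp (hi.pair ((rawCons natE).comp (hj.pair ((rawCons natE).comp (ha.pair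
      ((rawCons natE).comp (hb.pair ((rawCons natE).comp (hc.pair ((rawCons natE).comp (hd.pair
        (const _ ([] : List ℕ))))))))))))) :)
  have hnd : CodeFP (pairE c6E natE) bitE
      (fun t => nodup6 t.1.1.1.1.2.1 t.1.1.1.1.2.2 t.1.1.1.2 t.1.1.2 t.1.2 t.2) :=
    ((nodup natE_injective).comp hlist).congr fun t => (nodup6_eq_decide _ _ _ _ _ _).symm
  exact ((hadj hj ha).and ((hadj ha hb).and ((hadj hb hc).and ((hadj hc hd).and ((hadj hd hi).and hnd))))).congr
    fun t => by simp only [sixBody, Bool.and_assoc]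

/-- **`six` on codes** (four nested loops over the vertices). [cite: AroraBarak2009, §1.3] -/
theorem sixFP : CodeFP (pairE mvE stE) bitE (fun p => six p.1.1 p.1.2 p.2.1 p.2.2) := by
  have h4 := any sixBodyFP
  have h3 : CodeFP c6E bitE (fun t => (List.range t.1.1.1.1.1).any fun d =>
      sixBody t.1.1.1.1.1 t.1.1.1.1.2 t.1.1.1.2.1 t.1.1.1.2.2 t.1.1.2 t.1.2 t.2 d) :=
    (h4.comp ((CodeFP.id c6E).pair (urange.comp (fst _ _).fst'.fst'.fst'.fst'))).congr fun _ => rfl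
  have h2 : CodeFP (pairE (pairE (pairE mvE stE) natE) natE) bitE (fun t => (List.range t.1.1.1.1).any fun c =>
      (List.range t.1.1.1.1).any fun d => sixBody t.1.1.1.1 t.1.1.1.2 t.1.1.2.1 t.1.1.2.2 t.1.2 t.2 c d) :=
    ((any h3).comp ((CodeFP.id _).pair (urange.comp (fst _ _).fst'.fst'.fst'))).congr fun _ => rfl
  have h1 : CodeFP (pairE (pairE mvE stE) natE) bitE (fun t => (List.range t.1.1.1).any fun b =>
      (List.range t.1.1.1).any fun c => (List.range t.1.1.1).any fun d =>
        sixBody t.1.1.1 t.1.1.2 t.1.2.1 t.1.2.2 t.2 b c d) :=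
    ((any h2).comp ((CodeFP.id _).pair (urange.comp (fst _ _).fst'.fst'))).congr fun _ => rfl
  exact ((any h1).comp ((CodeFP.id _).pair (urange.comp (fst _ _).fst'))).congr fun _ => rfl

/-- **`rigidEdges` on codes.** [cite: AroraBarak2009, §1.3] -/
theorem rigidEdgesFP : CodeFP mvE (rawE stE) (fun c => rigidEdges c.1 c.2) := by
  have hlist : CodeFP mvE (rawE stE) (fun c => (List.range c.1).product (List.range c.1)) :=
    ((rawProduct natE natE).comp ((urange.comp (fst _ _)).pair (urange.comp (fst _ _))) :)
  exact ((filter (adjFP.and sixFP)).comp ((CodeFP.id mvE).pair hlist)).congr fun _ => rfl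

/-- **`coreLab` on codes** (least-label closure of the rigid edges). [cite: AroraBarak2009, §1.3] -/
theorem coreLabFP : CodeFP mvE (rawE natE) (fun c => coreLab c.1 c.2) :=
  ((MinLabel.codeFP_minLabels).comp (rigidEdgesFP.pair (fst _ _))).congr fun _ => rfl

/-- **`lab` on codes.** [cite: AroraBarak2009, §1.3] -/
theorem labFP : CodeFP c1E natE (fun p => lab p.1.1 p.1.2 p.2) :=
  ((rawGetD natE natE_zero).comp ((coreLabFP.comp (fst _ _)).pair (snd _ _))).congr fun _ => rfl

/-- **`isCoreL` on codes.** [cite: AroraBarak2009, §1.3] -/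
theorem isCoreFP : CodeFP c1E bitE (fun p => isCoreL p.1.1 p.1.2 p.2) :=
  (natLe.comp ((const _ 3).pair degFP)).congr fun _ => rfl

/-- The label test `lab i == lab j` on the context `(((m, v), i), j)`. [folklore] -/
theorem labBeqFP : CodeFP (pairE c1E natE) bitE (fun t => lab t.1.1.1 t.1.1.2 t.1.2 == lab t.1.1.1 t.1.1.2 t.2) :=
  ((beq natE_injective).comp ((labFP.comp (fst _ _)).pair (labFP.comp ((fst _ _).fst'.pair (snd _ _)))) :)

/-- **`isMidL` on codes.** [cite: AroraBarak2009, §1.3] -/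
theorem isMidFP : CodeFP c1E bitE (fun p => isMidL p.1.1 p.1.2 p.2) :=
  (isCoreFP.and ((all labBeqFP).comp ((CodeFP.id c1E).pair nbrsFP))).congr fun _ => rfl

/-- **`outNbrsL` on codes.** [cite: AroraBarak2009, §1.3] -/
theorem outNbrsFP : CodeFP c1E (rawE natE) (fun p => outNbrsL p.1.1 p.1.2 p.2) :=
  ((filter labBeqFP.not).comp ((CodeFP.id c1E).pair nbrsFP)).congr fun _ => rfl

/-- `if (l.length = 1) then head else default`, the common shape of `firstMoveL`, `firstNbrL`. [folklore] -/
theorem ite_length_eq (l : List ℕ) (x : ℕ) :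
    (if decide (l.length = 1) then l.headD 0 else x) = (if l.length = 1 then l.headD 0 else x) := by
  by_cases h : l.length = 1 <;> simp [h]

/-- **`firstMoveL` on codes.** [cite: AroraBarak2009, §1.3] -/
theorem firstMoveFP : CodeFP c1E natE (fun p => firstMoveL p.1.1 p.1.2 p.2) := by
  have hlen : CodeFP c1E bitE (fun p => decide ((outNbrsL p.1.1 p.1.2 p.2).length = 1)) :=
    (natEq.comp (((natLength natE).comp outNbrsFP).pair (const _ 1)) :)
  exact ((hlen.ite ((rawHeadD natE natE_zero).comp outNbrsFP) (snd _ _)).congr fun p => by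
    show (if decide _ then _ else _) = firstMoveL p.1.1 p.1.2 p.2
    rw [ite_length_eq]; rfl)

/-- **`firstNbrL` on codes.** [cite: AroraBarak2009, §1.3] -/
theorem firstNbrFP : CodeFP c1E natE (fun p => firstNbrL p.1.1 p.1.2 p.2) := by
  have hlen : CodeFP c1E bitE (fun p => decide ((nbrs p.1.1 p.1.2 p.2).length = 1)) :=
    (natEq.comp (((natLength natE).comp nbrsFP).pair (const _ 1)) :)
  exact ((hlen.ite ((rawHeadD natE natE_zero).comp nbrsFP) (snd _ _)).congr fun p => by
    show (if decide _ then _ else _) = firstNbrL p.1.1 p.1.2 p.2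
    rw [ite_length_eq]; rfl)

/-! ### The walk -/

/-- **`exitsL` on codes.** [cite: AroraBarak2009, §1.3] -/
theorem exitsFP : CodeFP c2E (rawE natE) (fun p => exitsL p.1.1 p.1.2 p.2) := by
  have hlist : CodeFP c2E (rawE natE) (fun p => nbrs p.1.1 p.1.2 p.2.2) := (nbrsFP.comp ((fst _ _).pair (snd _ _).snd') :)
  have hp : CodeFP (pairE c2E natE) bitE (fun t => !(t.2 == t.1.2.1)) :=
    ((beq natE_injective).comp ((snd _ _).pair (fst _ _).snd'.fst')).not
  exact ((filter hp).comp ((CodeFP.id c2E).pair hlist)).congr fun _ => rfl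

/-- **`stepL` on codes.** [cite: AroraBarak2009, §1.3] -/
theorem stepFP : CodeFP c2E stE (fun p => stepL p.1.1 p.1.2 p.2) := by
  have hlen : CodeFP c2E bitE (fun p => decide ((exitsL p.1.1 p.1.2 p.2).length = 1)) :=
    (natEq.comp (((natLength natE).comp exitsFP).pair (const _ 1)) :)
  have hmove : CodeFP c2E stE (fun p => (p.2.2, (exitsL p.1.1 p.1.2 p.2).headD 0)) :=
    (snd _ _).snd'.pair ((rawHeadD natE natE_zero).comp exitsFP)
  exact ((hlen.ite hmove (snd _ _)).congr fun p => by
    show (if decide _ then _ else _) = stepL p.1.1 p.1.2 p.2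
    unfold stepL
    by_cases h : (exitsL p.1.1 p.1.2 p.2).length = 1 <;> simp [h])

/-- **`walkStep` on codes.** [cite: AroraBarak2009, §1.3] -/
theorem walkStepFP : CodeFP (pairE mvE accE) accE (fun p => walkStep p.1.1 p.1.2 p.2) := by
  have hctx : CodeFP (pairE mvE accE) c2E (fun p => (p.1, p.2.1)) := (fst _ _).pair (snd _ _).fst'
  have hlen : CodeFP (pairE mvE accE) bitE (fun p => decide ((exitsL p.1.1 p.1.2 p.2.1).length = 1)) :=
    (natEq.comp (((natLength natE).comp (exitsFP.comp hctx)).pair (const _ 1)) :)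
  have hinc : CodeFP (pairE mvE accE) natE (fun p => if decide ((exitsL p.1.1 p.1.2 p.2.1).length = 1) then 1 else 0) :=
    hlen.ite (const _ 1) (const _ 0)
  exact ((stepFP.comp hctx).pair (natAdd.comp ((snd _ _).snd'.pair hinc))).congr fun p => by
    show (_, _) = walkStep p.1.1 p.1.2 p.2
    unfold walkStep
    by_cases h : (exitsL p.1.1 p.1.2 p.2.1).length = 1 <;> simp [h]

/-- The vertices met by the walk: those of the start, or below `m`. [folklore] -/
theorem runL_mem (m : ℕ) (v : List Bool) (s : ℕ × ℕ) (k : ℕ) :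
    ((runL m v k s).1 = s.1 ∨ (runL m v k s).1 = s.2 ∨ (runL m v k s).1 < m) ∧
      ((runL m v k s).2 = s.1 ∨ (runL m v k s).2 = s.2 ∨ (runL m v k s).2 < m) := by
  induction k with
  | zero => exact ⟨Or.inl rfl, Or.inr (Or.inl rfl)⟩
  | succ k ih =>
    have hrun : runL m v (k + 1) s = stepL m v (runL m v k s) := by
      unfold runL; rw [Function.iterate_succ_apply']
    rw [hrun]
    unfold stepL
    split_ifs with h
    · refine ⟨ih.2, Or.inr (Or.inr ?_)⟩
      have hmem : (exitsL m v (runL m v k s)).headD 0 ∈ exitsL m v (runL m v k s) := by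
        rw [filter_eq_singleton_headD h 0]
        simp
      exact exitsL_lt m v _ _ hmem
    · exact ih

/-- **`walkL` on codes**: `m` clocked rounds, a fold over a budget of `m` units; the accumulator holds
two vertex numbers (of the start, or below `m`) and a counter `≤ m`.
[cite: AroraBarak2009, §1.3 (polynomially bounded loops)] -/
theorem walkFP : CodeFP c2E accE (fun p => walkL p.1.1 p.1.2 p.2) := by
  have hstep : CodeFP (pairE c2E (pairE unitE accE)) accE (fun t => walkStep t.1.1.1 t.1.1.2 t.2.2) :=
    (walkStepFP.comp ((fst _ _).fst'.pair (snd _ _).snd') :)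
  have hinit : CodeFP c2E accE (fun s => (s.2, (0 : ℕ))) := (snd _ _).pair (const _ 0)
  have h := foldl (σ := (ℕ × List Bool) × (ℕ × ℕ)) (α := Unit) (β := (ℕ × ℕ) × ℕ) (eσ := c2E) (eα := unitE)
    (eβ := accE) (step := fun s _ b => walkStep s.1.1 s.1.2 b) (init := fun s => (s.2, (0 : ℕ))) hstep hinit
    (7 * X + 6) (fun s l₁ l₂ => by
      obtain ⟨⟨m, v⟩, p, c⟩ := s
      dsimp only
      rw [foldl_units_eq_iterate' (fun b => walkStep m v b) l₁ ((p, c), 0)]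
      rw [show (fun b => walkStep m v b) = walkStep m v from rfl, walkStep_iterate]
      set W := (pairE c2E (rawE unitE) (((m, v), (p, c)), l₁ ++ l₂)).length with hW
      have hW' : W = 2 * (2 * (2 * m + 2 + v.length) + 2 + (2 * (natE p).length + 2 + (natE c).length)) + 2 +
          (rawE unitE (l₁ ++ l₂)).length := by
        simp only [hW, pairE_apply, length_boolPair, length_unE]
        rfl
      have hl₁ : l₁.length ≤ W := by
        have := length_le_length_rawE unitE (l₁ ++ l₂)
        rw [List.length_append] at this
        omega
      -- the two vertices and the counter
      have hbound : ∀ x : ℕ, (x = p ∨ x = c ∨ x < m) → (natE x).length ≤ W := by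
        rintro x (rfl | rfl | hx)
        · omega
        · omega
        · have := length_natE_le x; omega
      obtain ⟨h1, h2⟩ := runL_mem m v (p, c) l₁.length
      have hx := hbound _ h1
      have hy := hbound _ h2
      have hcnt : (natE ((List.range l₁.length).filter fun j =>
          decide ((exitsL m v (runL m v j (p, c))).length = 1)).length).length ≤ W := by
        refine (length_natE_le _).trans ((List.length_filter_le _ _).trans ?_)
        rw [List.length_range]; exact hl₁
      simp only [eval_add, eval_mul, eval_X, eval_ofNat, pairE_apply, length_boolPair]
      omega)
  exact (h.comp ((CodeFP.id c2E).pair (replicateUnit.comp (fst _ _).fst'))).congr fun p => by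
    show _ = walkL p.1.1 p.1.2 p.2
    unfold walkL
    rw [foldl_units_eq_iterate]
    rfl

/-- **`lenL` on codes.** [cite: AroraBarak2009, §1.3] -/
theorem lenFP : CodeFP c2E natE (fun p => lenL p.1.1 p.1.2 p.2) := walkFP.snd'

/-- **`endL` on codes.** [cite: AroraBarak2009, §1.3] -/
theorem endFP : CodeFP c2E natE (fun p => endL p.1.1 p.1.2 p.2) := walkFP.fst'.snd'

/-! ### Representatives, bad links, counts -/

/-- **`repL` on codes** (`findIdx` over the vertices). [cite: AroraBarak2009, §1.3] -/
theorem repFP : CodeFP c1E natE (fun p => repL p.1.1 p.1.2 p.2) := by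
  have hpred : CodeFP (pairE c1E natE) bitE
      (fun t => (lab t.1.1.1 t.1.1.2 t.2 == lab t.1.1.1 t.1.1.2 t.1.2) && isMidL t.1.1.1 t.1.1.2 t.2) :=
    ((beq natE_injective).comp ((labFP.comp ((fst _ _).fst'.pair (snd _ _))).pair (labFP.comp (fst _ _)))).and
      (isMidFP.comp ((fst _ _).fst'.pair (snd _ _)))
  have hidx : CodeFP c1E natE (fun p => (List.range p.1.1).findIdx fun j =>
      (lab p.1.1 p.1.2 j == lab p.1.1 p.1.2 p.2) && isMidL p.1.1 p.1.2 j) :=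
    ((findIdxFP hpred).comp ((CodeFP.id c1E).pair (urange.comp (fst _ _).fst'))).congr fun _ => rfl
  have hlt : CodeFP c1E bitE (fun p => decide ((List.range p.1.1).findIdx (fun j =>
      (lab p.1.1 p.1.2 j == lab p.1.1 p.1.2 p.2) && isMidL p.1.1 p.1.2 j) < p.1.1)) :=
    (natLt.comp (hidx.pair (natOfUn.comp (fst _ _).fst')) :)
  exact (hlt.ite hidx (snd _ _)).congr fun p => by
    show (if decide _ then _ else _) = repL p.1.1 p.1.2 p.2
    unfold repL
    split_ifs <;> simp_all

/-- **`phi` on codes.** [cite: AroraBarak2009, §1.3] -/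
theorem phiFP : CodeFP c1E bitE (fun p => phi p.1.1 p.1.2 p.2) :=
  (adjFP.comp ((fst _ _).pair ((snd _ _).pair repFP))).congr fun _ => rfl

/-- **`linkStartL` on codes.** [cite: AroraBarak2009, §1.3] -/
theorem linkStartFP : CodeFP c1E stE (fun p => linkStartL p.1.1 p.1.2 p.2) := ((snd _ _).pair firstMoveFP).congr fun _ => rfl

/-- The end of the walk from a core link, on codes. [folklore] -/
theorem endLinkFP : CodeFP c1E natE (fun p => endL p.1.1 p.1.2 (linkStartL p.1.1 p.1.2 p.2)) :=
  (endFP.comp ((fst _ _).pair linkStartFP) :)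

/-- The length of the walk from a core link, on codes. [folklore] -/
theorem lenLinkFP : CodeFP c1E natE (fun p => lenL p.1.1 p.1.2 (linkStartL p.1.1 p.1.2 p.2)) :=
  (lenFP.comp ((fst _ _).pair linkStartFP) :)

/-- **`corrBadL` on codes.** [cite: AroraBarak2009, §1.3] -/
theorem corrBadFP : CodeFP c1E bitE (fun p => corrBadL p.1.1 p.1.2 p.2) := by
  have hend : CodeFP c1E c1E (fun p => (p.1, endL p.1.1 p.1.2 (linkStartL p.1.1 p.1.2 p.2))) := (fst _ _).pair endLinkFP
  exact ((isCoreFP.comp hend).and ((beq bitE_injective).comp (phiFP.pair (phiFP.comp hend))).not).congr fun _ => rfl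

/-- **`pendBadL` on codes.** [cite: AroraBarak2009, §1.3] -/
theorem pendBadFP : CodeFP c1E bitE (fun p => pendBadL p.1.1 p.1.2 p.2) := by
  have hend : CodeFP c1E c1E (fun p => (p.1, endL p.1.1 p.1.2 (linkStartL p.1.1 p.1.2 p.2))) := (fst _ _).pair endLinkFP
  have hmod : ∀ r : ℕ, CodeFP c1E bitE (fun p => lenL p.1.1 p.1.2 (linkStartL p.1.1 p.1.2 p.2) % 3 == r) := fun r =>
    ((beq natE_injective).comp ((natMod.comp (lenLinkFP.pair (const _ 3))).pair (const _ r)) :)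
  exact ((isCoreFP.comp hend).not.and ((phiFP.and (hmod 0)).or (phiFP.not.and (hmod 1)))).congr fun _ => rfl

/-- **`coreLinksL` on codes.** [cite: AroraBarak2009, §1.3] -/
theorem coreLinksFP : CodeFP mvE (rawE natE) (fun c => coreLinksL c.1 c.2) :=
  ((filter (isCoreFP.and isMidFP.not)).comp ((CodeFP.id mvE).pair (urange.comp (fst _ _)))).congr fun _ => rfl

/-- **`nCorrL` on codes.** [cite: AroraBarak2009, §1.3] -/
theorem nCorrFP : CodeFP mvE natE (fun c => nCorrL c.1 c.2) :=
  ((natLength natE).comp ((filter corrBadFP).comp ((CodeFP.id mvE).pair coreLinksFP))).congr fun _ => rfl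

/-- **`nPendL` on codes.** [cite: AroraBarak2009, §1.3] -/
theorem nPendFP : CodeFP mvE natE (fun c => nPendL c.1 c.2) :=
  ((natLength natE).comp ((filter pendBadFP).comp ((CodeFP.id mvE).pair coreLinksFP))).congr fun _ => rfl

/-! ### Components and the verdict -/

/-- **`allEdges` on codes.** [cite: AroraBarak2009, §1.3] -/
theorem allEdgesFP : CodeFP mvE (rawE stE) (fun c => allEdges c.1 c.2) := by
  have hlist : CodeFP mvE (rawE stE) (fun c => (List.range c.1).product (List.range c.1)) :=
    ((rawProduct natE natE).comp ((urange.comp (fst _ _)).pair (urange.comp (fst _ _))) :)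
  exact ((filter adjFP).comp ((CodeFP.id mvE).pair hlist)).congr fun _ => rfl

/-- **`ccLab` on codes.** [cite: AroraBarak2009, §1.3] -/
theorem ccLabFP : CodeFP mvE (rawE natE) (fun c => ccLab c.1 c.2) :=
  ((MinLabel.codeFP_minLabels).comp (allEdgesFP.pair (fst _ _))).congr fun _ => rfl

/-- The component label of a vertex, on codes. [folklore] -/
theorem ccGetDFP : CodeFP c1E natE (fun p => (ccLab p.1.1 p.1.2).getD p.2 0) :=
  ((rawGetD natE natE_zero).comp ((ccLabFP.comp (fst _ _)).pair (snd _ _))).congr fun _ => rfl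

/-- **The verdict on codes**: `(1ᵐ, v) ↦ [verdictL m v]`. [cite: ChenFlumLiu2025, Thm. 8.1] -/
theorem verdictFP : CodeFP mvE bitE (fun c => verdictL c.1 c.2) := by
  have hrange : CodeFP mvE (pairE mvE (rawE natE)) (fun c => (c, List.range c.1)) := (CodeFP.id mvE).pair (urange.comp (fst _ _))
  have hcore : CodeFP mvE bitE (fun c => (List.range c.1).any (isCoreL c.1 c.2)) := ((any isCoreFP).comp hrange).congr fun _ => rfl
  have harith : CodeFP mvE bitE (fun c => (nCorrL c.1 c.2 / 4 + nPendL c.1 c.2 / 2) % 2 == 0) :=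
    ((beq natE_injective).comp ((natMod.comp ((natAdd.comp ((natDiv.comp (nCorrFP.pair (const _ 4))).pair
      (natDiv.comp (nPendFP.pair (const _ 2))))).pair (const _ 2))).pair (const _ 0)) :)
  have hdeadP : CodeFP c1E bitE (fun p => (deg p.1.1 p.1.2 p.2 == 1) &&
      !(lenL p.1.1 p.1.2 (p.2, firstNbrL p.1.1 p.1.2 p.2) % 3 == 1)) :=
    ((beq natE_injective).comp (degFP.pair (const _ 1))).and
      ((beq natE_injective).comp ((natMod.comp ((lenFP.comp ((fst _ _).pair ((snd _ _).pair firstNbrFP))).pair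
        (const _ 3))).pair (const _ 1))).not
  have hdead : CodeFP mvE bitE (fun c => (List.range c.1).any fun i => (deg c.1 c.2 i == 1) &&
      !(lenL c.1 c.2 (i, firstNbrL c.1 c.2 i) % 3 == 1)) := ((any hdeadP).comp hrange).congr fun _ => rfl
  have hreg : CodeFP mvE bitE (fun c => (List.range c.1).all fun i => deg c.1 c.2 i == 2) :=
    ((all ((beq natE_injective).comp (degFP.pair (const _ 2)))).comp hrange).congr fun _ => rfl
  have hccP : CodeFP (pairE c1E natE) bitE (fun t => !((ccLab t.1.1.1 t.1.1.2).getD t.1.2 0 == (ccLab t.1.1.1 t.1.1.2).getD t.2 0)) :=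
    ((beq natE_injective).comp ((ccGetDFP.comp (fst _ _)).pair (ccGetDFP.comp ((fst _ _).fst'.pair (snd _ _))))).not
  have hcc1 : CodeFP c1E bitE (fun p => (List.range p.1.1).any fun w =>
      !((ccLab p.1.1 p.1.2).getD p.2 0 == (ccLab p.1.1 p.1.2).getD w 0)) :=
    ((any hccP).comp ((CodeFP.id c1E).pair (urange.comp (fst _ _).fst'))).congr fun _ => rfl
  have hcc : CodeFP mvE bitE (fun c => (List.range c.1).any fun u => (List.range c.1).any fun w =>
      !((ccLab c.1 c.2).getD u 0 == (ccLab c.1 c.2).getD w 0)) := ((any hcc1).comp hrange).congr fun _ => rfl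
  exact ((hcore.and harith).or (hcore.not.and (hdead.or (hreg.and hcc)))).congr fun _ => rfl

/-! ### The decision procedure and the class -/

/-- **The separating class**: the finite graphs `⟨n, H⟩` accepted by the separator with least
representatives (adjacency decided classically; see `verdict_repMin_iff_of_decidableRel`).
[cite: ChenFlumLiu2025, Thm. 8.1] -/
def cfiSeparatingClass : Set FinGraph :=
  {H | @Verdict (Fin H.1) _ _ H.2 (Classical.decRel _) (@repMin (Fin H.1) _ _ H.2 (Classical.decRel _) _)}

/-- The verdict with least representatives does not depend on the decidability instance of the
adjacency. [folklore] -/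
theorem verdict_repMin_iff_of_decidableRel {n : ℕ} (H : SimpleGraph (Fin n)) (I₁ I₂ : DecidableRel H.Adj) :
    @Verdict (Fin n) _ _ H I₁ (@repMin (Fin n) _ _ H I₁ _) ↔ @Verdict (Fin n) _ _ H I₂ (@repMin (Fin n) _ _ H I₂ _) := by
  have := Subsingleton.elim I₁ I₂
  subst this
  exact Iff.rfl

/-- **Membership of a decoded graph in the class is the program's verdict.** [cite: ChenFlumLiu2025, Thm. 8.1] -/
theorem mem_cfiSeparatingClass_iff (n : ℕ) (v : List Bool) :
    (⟨n, TwoColouring.graph n v⟩ : FinGraph) ∈ cfiSeparatingClass ↔ verdictL n v = true := by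
  show @Verdict (Fin n) _ _ (TwoColouring.graph n v) (Classical.decRel _) _ ↔ _
  rw [verdict_repMin_iff_of_decidableRel (TwoColouring.graph n v) (Classical.decRel _) inferInstance, verdict_iff]

/-- **The decision procedure on strings**: the code test and the verdict of the graph read off the
string. [cite: ChenFlumLiu2025, Thm. 8.1] -/
def decideSep (w : List Bool) : Bool :=
  decide (BGS.Sim.reencode (BGS.Sim.sizeOfCode w) (sndF w) = w) && verdictL (BGS.Sim.sizeOfCode w) (sndF w)

/-- **The decision procedure is polynomial time on codes.** [cite: ChenFlumLiu2025, Thm. 8.1] -/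
theorem decideSepFP : CodeFP strE bitE decideSep := by
  have hns : CodeFP strE mvE (fun w => (BGS.Sim.sizeOfCode w, sndF w)) := (BGS.Sim.sizeOfCodeFP.pair codeFP_hdrBody.snd' :)
  have htest : CodeFP strE bitE (fun w => decide (BGS.Sim.reencode (BGS.Sim.sizeOfCode w) (sndF w) = w)) :=
    ((CodeFP.eq (eα := strE) Function.injective_id).comp ((BGS.Sim.reencodeFP.comp hns).pair (CodeFP.id strE)) :)
  exact (htest.and (verdictFP.comp hns)).congr fun w => rfl

/-- **The separating class is polynomial-time decidable** (`IsPTIMEClass`: its language of adjacency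
codes is in the tree's `P`). [cite: ChenFlumLiu2025, Thm. 8.1] -/
theorem isPTIMEClass_cfiSeparatingClass : IsPTIMEClass cfiSeparatingClass := by
  obtain ⟨g, hg, hge⟩ := decideSepFP
  refine mem_P_of_mem_FP hg (graphClassLanguage cfiSeparatingClass) fun w => ?_
  have key : w ∈ graphClassLanguage cfiSeparatingClass ↔ decideSep w = true := by
    rw [BGS.Sim.mem_graphClassLanguage_iff, mem_cfiSeparatingClass_iff, decideSep, Bool.and_eq_true, decide_eq_true_eq]
  have hgw : g w = [decideSep w] := hge w
  constructor
  · intro hw; rw [hgw, key.mp hw]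
  · intro hw
    rw [hgw]
    cases h : decideSep w
    · rfl
    · exact absurd (key.mpr h) hw

end CFISep

end Literature.ModelTheory.FiniteModelTheory

end

/-!
## Part IV. The discharge
-/

namespace Literature.ModelTheory.FiniteModelTheory

/-- **Chen–Flum–Liu 2025, Thm. 8.1 (discharged): the even and the odd uncoloured CFI graphs are
separated by a polynomial-time decidable, isomorphism-closed class of finite graphs.**
[cite: ChenFlumLiu2025, Thm. 8.1] -/
theorem ChenFlumLiu2025_ptime_separation_holds : ChenFlumLiu2025_ptime_separation := by
  refine ⟨CFISep.cfiSeparatingClass, CFISep.isPTIMEClass_cfiSeparatingClass, ?_⟩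
  intro v G _ hc hv
  refine ⟨fun H hH => ?_, fun e he _ H hH hmem => ?_⟩
  · obtain ⟨ψ⟩ := hH
    -- `cfiEven G` is `cfiGraph G ∅` by definition
    have ψ' : H.2 ≃g cfiGraph G (∅ : Set (Sym2 (Fin v))) := ψ
    letI : DecidableRel H.2.Adj := Classical.decRel _
    show Verdict H.2 (repMin H.2)
    rw [verdict_repMin_iff_of_iso ψ'.symm]
    exact verdict_cfiGraph_of_forall_notMem hc hv (fun f hf => hf) ((isRepMap_repMin (Z := H.2)).transport ψ'.symm)
  · obtain ⟨ψ⟩ := hH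
    letI : DecidableRel H.2.Adj := Classical.decRel _
    have hmem' : Verdict H.2 (repMin H.2) := hmem
    rw [verdict_repMin_iff_of_iso ψ.symm] at hmem'
    exact not_verdict_cfiGraph_of_singleton hc hv he (fun f => Set.mem_singleton_iff)
      ((isRepMap_repMin (Z := H.2)).transport ψ.symm) hmem'

end Literature.ModelTheory.FiniteModelTheory
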